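import Summits.QuantumFields.YangMills.Theorems.LangevinControlUVFemtoCurvatureTwoPointCSmallTorusVariance
import Summits.QuantumFields.YangMills.Theorems.LangevinControlUVFemtoCurvatureTwoPointAxisProfileAntitone
import Summits.QuantumFields.YangMills.Theorems.LangevinControlUVFemtoCurvatureTwoPointCSmearingDomination
import Summits.QuantumFields.YangMills.Theorems.TunedSequenceExists.Negative.Freezing
import Literature.Probability.Moments.TotalCovariance
import Literature.MathematicalPhysics.QuantumFieldTheory.UnevenAxialBlocking
import Literature.MathematicalPhysics.QuantumFieldTheory.LatticeGaugeProofs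
import Literature.RepresentationTheory.CompactGroups.UnitaryTrick
import Summits.QuantumFields.YangMills.Theorems.LangevinControlUVFemtoCurvatureTwoPointCFloorUpperBridge
import Summits.QuantumFields.YangMills.Theorems.LangevinControlUVFemtoCurvatureTwoPointCFloorBoundedBoxesBridge
import Summits.QuantumFields.YangMills.Theorems.LangevinControlUVFemtoCurvatureTwoPointCOddVarianceBulk
import Summits.QuantumFields.YangMills.Theorems.LangevinControlUVFemtoCurvatureTwoPointCStubVarianceCeilingCorner
import Literature.MathematicalPhysics.QuantumLattice.TorusWilsonFlowContinuity
import Literature.MathematicalPhysics.QuantumLattice.BalabanBlockAverage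
import HarnessLib

/-!
# Line `conditional-covariance-floor` — crux `FemtoCurvatureTwoPointC` (stmt-QuantumFields-16204), route `LangevinControlUV`

Skeleton **v4** (line lead `prover-line-stmt-QuantumFields-16204-a1-0`, 2026-08-17), reshaping the crux-planner's v1
(`planner-cruxplan-stmt-QuantumFields-16204-conditional-covarian-0`; idea card
`Cruxes/FemtoCurvatureTwoPointC/Ideas/conditional-covariance-floor.md`, line card `Lines/conditional-covariance-floor.md`).

## What this skeleton is

The crux is reduced, kernel-checked and LANDED, to one physics statement:
`femtoCurvatureTwoPointC_of_core : AFProfilesCore → FemtoCurvatureTwoPointC` (`…CSmallTorusVariance`, p134841), where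
`AFProfilesCoreAt r` (`…CDefsCore`) asks for an admissible asymptotic-freedom box coupling `u L β` with four matching
clauses on window boxes: transverse LOWER `c·u(8n,β)² ≤ n⁸·Cov_{L,β}(P_0^{01},P_{ne₂}^{01})` (`1 ≤ n`, `8n ≤ L`), transverse
upper, longitudinal upper, variance ceiling. The standing disprover (`Disproof.lean`) shows: any proof must USE running
(`Negative/UniformFreezing`), and the LOWER bound is the unique content (`Negative/UpperOnlyC`).

The line produces the transverse LOWER clause by the law of total covariance at ONE pinned conditioning scale: for two
transverse plaquette blocks `X = B_b(0)`, `Y = B_b(n)` (cubes of side `b = ⌊n/D₀⌋` in the slices `x₂ = 0`, `x₂ = n`) and a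
sub-σ-algebra `𝓕_b` of Wilson's measure `μ = wilsonMeasure r.ρ β`,
`Cov_μ(X, Y) = ∫ (X − μ[X|𝓕_b])(Y − μ[Y|𝓕_b]) dμ + Cov_μ(μ[X|𝓕_b], μ[Y|𝓕_b])`
(`Literature.Probability.Moments.integral_residual_mul_add_covariance_condExp`, landed): the covariance of the CONDITIONAL
MEANS is floored (`stub_flowedMeanFloor`), the residual is an ε-share (`stub_flowedDecoupling`), smearing only lowers
covariances (`stub_smearingDomination`, CLOSED p143011), small separations come from landed RP antitonicity plus a
comparability chain, bounded boxes from a fixed-torus nearest-neighbour floor (`stub_nearestNeighbourFloor`, through the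
landed bridge `boundedBoxes_of_nearestNeighbourFloor`, p158015), the three upper clauses from `stub_transverseUpper`,
`stub_longitudinalUpper`, `stub_varianceCeilingDeepOdd` (through the landed bridge `upperChannels_of_parts`, p158109, which
consumes line `birth`'s CLOSED even-bulk/even-mid variance pieces p150733/p155166), and the running from
`stub_intrinsicRunning` (R, shared verbatim with line `birth`).

## Reshape v2 (lead a1, cycle 1) — what changed against v1 and why

1. **The conditioning σ-algebra (Flo/Dec).** v1 conditioned on `MeasurableSpace.comap (unevenAxialLink b L (L/b))`:
   the straight transporter of `b` fine links from each block corner — a DECIMATED COMB of thin Wilson lines (the tree's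
   `BlockMean.rep 0`; Bałaban's exp/log block AVERAGE is flagged "NOT constructed" in `BalabanSoftAveraging`). Wave-1 audit
   (workers Flo and Dec, independent; lead kit jobs j025630/j025595 for the gauge-invariant flux content): in the stubs' own
   Gaussian caricature (free lattice Maxwell, `d = 4`) a thin coarse link carries the smooth signal plus WHITE alias noise of
   variance `G_{ℤ³}(0)·b = 0.2527·b`, so the residual field has correlation length `ξ_res ≈ 0.50·b^{3/2} ≫ b`, the share of
   the conditional means in `Cov(X,Y)` is `≈ 2.5·D₀⁴/b²` and the residual share climbs back to `1` as `b` grows at fixed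
   `D₀` (exact torus numbers in `work/stubs/Dec-notes.md`: `D₀ = 6`: `0.0006/0.015/0.12/0.36` at `b = 2/4/8/16`). Since
   `b = ⌊n/D₀⌋ ≤ L/(8D₀)` is UNBOUNDED over the window, v1's Flo (c_F uniform) and Dec (ε-share, `∃ D₁ ∀ D₀ ≥ D₁ … ∀ n ≤ L/8`)
   fail in caricature — and the compact group only worsens it (a length-`b` line has phase variance `≍ 0.25·g²·b`,
   unbounded in the window: perimeter-law noise). Not Lean-refutable (their hypothesis R is unprovable), hence MIS-STATED.
   **Repair (v2, both stubs, same σ-algebra):** flow, then block — condition on the straight coarse transporters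
   (`unevenAxialLink b L (L/b)` over the matrix monoid) of the Wilson-FLOWED link matrices
   `QuantumLattice.wilsonFlowMatrix r.ρ (b²/8) U` (Lüscher's gradient flow (1.4), smoothing radius `√(8t) = b`; existence
   and continuity in `U` are in the tree; `comap_flowDecimate_le` below proves it is a sub-σ-algebra of the product
   σ-algebra). Caricature: aliases damped by `e^{-π²/4}`, signal undamped after regression, share `1 − O(D₀⁻²)` UNIFORMLY
   in `b`; compact group: a flowed line of length `b` at `t = b²/8` has phase variance `O(u_b)` (no perimeter law). The
   one-step LINEAR mean of Bałaban's contour transporters (`Σ_v ρ(contourVar L b U c v)`) repairs the caricature too but is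
   decohered in the compact theory once `g²b ≳ 3 ln b` (thin lines of perimeter `3b–9b`); Bałaban's own cure is the
   ITERATED bounded-factor average `T^k`, which the tree cannot type today — the flow is its typable stand-in
   (gradient-flow block spin, Carosso–Hasenfratz–Neil 2018).
2. **Up split** into TU / LU / V′ (= V_even-deep ∧ V_odd) — exactly line `birth`'s open upper pieces, so one landing serves
   both lines; the even bulk/mid variance boxes are CLOSED (p150733, p155166) and enter through the landed bridge.
3. **Bnd replaced by NN** — the `u`-free fixed-torus nearest-neighbour floor `c₁/β² ≤ Cov_{L,β}(P_0^{01}, P_{e₂}^{01})`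
   (`8 ≤ L ≤ L₀`, `β ≥ β₂`): the landed bridge derives v1's bounded-box clause from NN + R by RP log-convexity
   (`Cov(n) ≥ Var·(Cov(1)/Var)^n`) and the fixed-torus doubling chain (`Var ≤ K/β²` on every torus `L ≤ L₀`).

Stubs v2 (7 open + Dom closed): R `stub_intrinsicRunning` (XL, the running; = DM(u₂) by p141024), TU
`stub_transverseUpper` (L), LU `stub_longitudinalUpper` (L, verbatim `birth`'s), V′ `stub_varianceCeilingDeepOdd` (M–L:
even deep-femto corner `log β > L⁴` + odd tori), Dom `stub_smearingDomination` (CLOSED), Flo′ `stub_flowedMeanFloor`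
(L–XL, the lever), Dec′ `stub_flowedDecoupling` (L), NN `stub_nearestNeighbourFloor` (M–L, `u`-free fixed-torus
semiclassics, MC-testable). Composition: `transverseLower_of_floor` (unchanged logic; σ-algebra swapped),
`afProfilesCoreAt_of_floor`, `afProfilesCore_of_floor`, `FemtoCurvatureTwoPointC_of` (hypothesis form, sorry-free, axioms
`propext`/`Classical.choice`/`Quot.sound`), `femtoCurvatureTwoPointC_of_stubs` (by name).

## Disproof used (`Cruxes/FemtoCurvatureTwoPointC/Disproof.lean`, cdisprove c1; unchanged since 2026-08-16T19:43Z, no `-- Targets`)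

As in v1: `Negative/UniformFreezing` honoured at R (step law `κ₁ > 0`) and at Flo′ (floor in units of the running `u(8n)²`);
`Negative/UpperOnlyC` honoured (the lower bound is produced by Flo′ + Dec′ + Dom + NN, never dropped); `forallA_false` not
engaged (no unit map); § Resists 5 used (no holonomy-conditioning stub; coarse torus `≥ 8D₀` sites). No stub has the shape
of a landed Negative lemma. Why no stub is the crux in disguise: R has no interior separations, TU/LU/V′ no lower bound, Dom
holds for every compact group at every `β ≥ 0`, Flo′/Dec′ speak about conditional expectations given a flowed block field at
block factor `≥ 2`, NN is confined to bounded boxes and fixed-torus `β → ∞`.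

## Reshape v3 (lead a1, cycle 1, after wave 2)

4. **Flow time re-pinned `t = b²/8 → b²/64`** (both Flo′/Dec′ mB-lines, same σ-algebra otherwise). Wave-2 exact caricature
   tables (workers Flo′ and Dec′, independent codes validated against each other and brute force): for EVERY `t = b²/c` the
   shares are b-FLAT (the v2 repair of the comb defect stands), but at `c = 8` the soft Gaussian weight captures the
   zone-boundary alias pair and the exact conditional mean deconvolves it: `K_proj/K` RINGS as `(−1)^{D₀}e^{−0.81 D₀}` with
   large overshoot (`+4.0, −3.5, +7.6, −5.4, …` at `D₀ = 2, 3, 4, 5, …`; residual share `|S_res|` up to 52, `D₁(5%) = 20`),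
   while at `c = 64` `K_proj/K = 1.001, 0.997, 1.0002, 1.0000, 1.0000` (`D₀ = 2,3,4,6,8`, all `b ∈ {4..32}`) and
   `|S_res| ≤ 5·10⁻³` for all `D₀ ≥ 2` (decay rate `γ ≈ 3`); clean window `c ∈ [32, 128]`. Smoothing radius `√(8t) = b/√8`:
   a flowed comb line of length `b` spans ≈ 3 smoothing radii, phase variance still `O(u_b)` (no perimeter law).
   Flow-then-AVERAGE is worse (`γ = 0.58`), not a fix. (Flo2-notes.md, Dec2-notes.md on the item.)
5. **V′ → V-corner.** Wave 2 LANDED the odd-torus variance ceiling in the bulk `log β ≤ L⁴` (p161704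
   `stub_varianceCeilingOddBulk`, with p161454 partial chessboard on odd tori and p161213 odd transported RP) — the piece
   cycles 9–11 had judged unreachable ("no chessboard on odd tori"). What is left of V on BOTH parities is the corner
   `L⁴ < log β`, now ONE stub `stub_varianceCeilingCorner`; glue `varianceEvenDeep_of_corner`, `varianceOdd_of_bulk_corner`.
6. **NN now carries `IsCompactSimpleLieGroup G`** like every sibling stub: the v2 text quantified over every compact `G` with a
   faithful unitary `r`, and `G = Unit` (plaquette field ≡ 0, `Cov = 0`) refutes it — kernel-checked and LANDED by the NN worker
   (p160778 `Negative/NearestNeighbourFloorDegenerate.not_nearestNeighbourFloor_allGroups`). The bridge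
   `boundedBoxes_of_nearestNeighbourFloor` is per datum and unaffected.

Stubs v3 (7 open + Dom closed): R `stub_intrinsicRunning`, TU `stub_transverseUpper`, LU `stub_longitudinalUpper`, V-corner
`stub_varianceCeilingCorner`, Flo′ `stub_flowedMeanFloor` (t = b²/64), Dec′ `stub_flowedDecoupling` (t = b²/64), NN
`stub_nearestNeighbourFloor` (with `IsCompactSimpleLieGroup G`); Dom `stub_smearingDomination` CLOSED.

## v4 (lead a1, cycle 1, after wave 4): the variance clause V is CLOSED on all window boxes

7. `stub_varianceCeilingCorner` CLOSED by the landed `…Theorems.FemtoCurvatureTwoPointC.stub_varianceCeilingCorner` (p166872): worker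
   W-main proved UNIFORM TORUS DOUBLING `Z_L(b/2) ≤ e^{AL⁴}·Z_L(b)` for ALL `L ≥ 2`, `b ≥ 4` (`TorusGauge.uniformDoubling_all`, p166705) —
   conditioning the torus integral on the four based axis holonomies: lattice non-abelian Stokes `f(h(U)) ≤ L²·S(U)` (worker W-A,
   `axisCommutatorCost_le_wilsonAction`, p164986) gives the upper fibre bound with MATCHING Gaussian exponent `3L⁴−3` and the one-site
   factor `Z₁(b/(4L²))` (`torus_upper_axisHolonomy`, p166163); the hyperplane-twist background `S(Ū(a)) = L²f(a)` (p165204) gives the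
   lower fibre bound with `Z₁(2L²b)` (`torus_lower_axisHolonomy`, p165659); the `8L⁴` temperature mismatch costs `poly(L)` by ITERATED
   one-site doubling (p163946). So V = even bulk/mid (p150733/p155166) ∧ odd bulk (p161704) ∧ corner (p166872): the variance ceiling
   `Var_{L,β}(P^{01}) ≤ C'·u(8,β)²` holds on EVERY window box for every R-coupling — the first clause of `AFProfilesCore` proved outright.
   Open stubs v4 (6): R, TU, LU, Flo′, Dec′, NN.
-/

set_option autoImplicit false

noncomputable section

open Filter Topology MeasureTheory ProbabilityTheory
open Literature.MathematicalPhysics.QuantumFieldTheory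
open Summit.QuantumFields.YangMills.Theorems.FemtoCurvatureTwoPointC

namespace Summit.QuantumFields.YangMills.Cruxes.FemtoCurvatureTwoPointC.ConditionalCovarianceFloor


/-! ## The stubs (registered; self-contained signatures over Mathlib / Literature / route / landed-Theorems names) -/

/-- **R — asymptotic freedom of an INTRINSIC step-scaling coupling (stub; shared verbatim with line `birth`'s
`stub_intrinsicRunning`; the deepest piece, open).** For every compact simple `G` (any Borel structure) and faithful
unitary `r` there is a box coupling `u : ℕ → ℝ → ℝ` with: admissibility (`0 < u L β` for `L ≥ 8`, `β ≥ β₀`; `β ↦ u L β`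
continuous on `[β₀, ∞)`; `u L β → 0` as `β → ∞` on every fixed box), bare size `c₈ ≤ β·u(8,β)`, in-window comparability
`|1/u(L) − 1/u(L')| ≤ κ₂` (`L ≤ L' ≤ 2L`), the two-sided dyadic AF step law with `κ₁ > 0`, and DIAGONAL MATCHING on window
boxes `L ≥ 8`: `c·u(L,β)² ≤ ⌊L/8⌋⁸·Cov_{L,β}(P_0^{01}, P_{⌊L/8⌋e₂}^{01}) ≤ C·u(L,β)²` (window of box `L`: every sub-box
`8 ≤ M ≤ L` has `u M β ≤ u₀`). Carries the running that `Negative/UniformFreezing` proves any proof must use.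
[LuscherWeiszWolff1991, Luscher1983, Balaban1988Convergent] -/
theorem stub_intrinsicRunning :
    ∀ (G : Type) [Group G] [TopologicalSpace G] [IsTopologicalGroup G] [CompactSpace G]
        [MeasurableSpace G] [BorelSpace G], IsCompactSimpleLieGroup G →
        ∀ r : LatticeRep G, ∃ (u : ℕ → ℝ → ℝ) (u₀ β₀ κ₁ κ₂ κ₃ c C c₈ : ℝ),
      0 < u₀ ∧ 0 < c ∧ 0 < κ₁ ∧ 0 ≤ κ₃ ∧ 0 < c₈ ∧
        (∀ (L : ℕ) (β : ℝ), 8 ≤ L → β₀ ≤ β → 0 < u L β) ∧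
        (∀ L : ℕ, 8 ≤ L → ContinuousOn (u L) (Set.Ici β₀)) ∧
        (∀ L : ℕ, 8 ≤ L → Filter.Tendsto (u L) Filter.atTop (nhds 0)) ∧
        (∀ β : ℝ, β₀ ≤ β → c₈ ≤ β * u 8 β) ∧
        (∀ (L L' : ℕ) (β : ℝ), β₀ ≤ β → 8 ≤ L → L ≤ L' → L' ≤ 2 * L →
            (∀ M : ℕ, 8 ≤ M → M ≤ L → u M β ≤ u₀) → |(u L β)⁻¹ - (u L' β)⁻¹| ≤ κ₂) ∧
        (∀ (k m : ℕ) (β : ℝ), β₀ ≤ β → (∀ M : ℕ, 8 ≤ M → M ≤ 8 * 2 ^ (k + m) → u M β ≤ u₀) →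
            κ₁ * m - κ₃ ≤ (u (8 * 2 ^ k) β)⁻¹ - (u (8 * 2 ^ (k + m)) β)⁻¹ ∧
              (u (8 * 2 ^ k) β)⁻¹ - (u (8 * 2 ^ (k + m)) β)⁻¹ ≤ κ₂ * m + κ₃) ∧
        (∀ (L : ℕ) [NeZero L] (β : ℝ), β₀ ≤ β → 8 ≤ L →
            (∀ M : ℕ, 8 ≤ M → M ≤ L → u M β ≤ u₀) →
            ∀ (P : (Fin 4 → ZMod L) → Fin 4 → Fin 4 → GaugeConfig 4 L G → ℝ)
              (E : (GaugeConfig 4 L G → ℝ) → ℝ),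
              (P = fun x i j U => (r.N : ℝ) - (r.ρ (plaquetteHolonomy U x i j)).trace.re) →
              (E = fun F => wilsonExpectation r.ρ β F) →
              c * u L β ^ 2 ≤
                ((L / 8 : ℕ) : ℝ) ^ 8 * (E (fun U => P 0 0 1 U * P (Pi.single (2 : Fin 4) ((L / 8 : ℕ) : ZMod L)) 0 1 U)
                  - E (P 0 0 1) * E (P (Pi.single (2 : Fin 4) ((L / 8 : ℕ) : ZMod L)) 0 1)) ∧
              ((L / 8 : ℕ) : ℝ) ^ 8 * (E (fun U => P 0 0 1 U * P (Pi.single (2 : Fin 4) ((L / 8 : ℕ) : ZMod L)) 0 1 U)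
                - E (P 0 0 1) * E (P (Pi.single (2 : Fin 4) ((L / 8 : ℕ) : ZMod L)) 0 1)) ≤ C * u L β ^ 2) := by
  sorry

/-- **TU — the transverse UPPER matching at interior separations for every R-coupling (stub; open, L; reshape v2: the first
conjunct of v1's `stub_upperChannels`, = the upper half of line `birth`'s `stub_volumeDecoupling`).** For every compact simple
`G`, faithful unitary `r` and EVERY coupling `u` with the R-properties: beyond some threshold, on window boxes `L ≥ 8`,
`s⁸·Cov_{L,β}(P_0^{01}, P_{se₂}^{01}) ≤ C'·u(8s,β)²` for `1 ≤ s`, `8s ≤ L`. Modulo R's diagonal lower matching on the sub-box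
`8s` this is the `u`-free volume comparability `Cov_{L,β}(s) ≲ Cov_{8s,β}(s)` (finite-size decoupling at separations a factor
8 inside the box; Cauchy–Schwarz side; not implied by reflection positivity). [Balaban1988Convergent, Luscher1983] -/
theorem stub_transverseUpper :
    ∀ (G : Type) [Group G] [TopologicalSpace G] [IsTopologicalGroup G] [CompactSpace G]
        [MeasurableSpace G] [BorelSpace G], IsCompactSimpleLieGroup G →
        ∀ r : LatticeRep G, ∀ (u : ℕ → ℝ → ℝ) (u₀ β₀ κ₁ κ₂ κ₃ c C c₈ : ℝ),
      (0 < u₀ ∧ 0 < c ∧ 0 < κ₁ ∧ 0 ≤ κ₃ ∧ 0 < c₈ ∧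
        (∀ (L : ℕ) (β : ℝ), 8 ≤ L → β₀ ≤ β → 0 < u L β) ∧
        (∀ L : ℕ, 8 ≤ L → ContinuousOn (u L) (Set.Ici β₀)) ∧
        (∀ L : ℕ, 8 ≤ L → Filter.Tendsto (u L) Filter.atTop (nhds 0)) ∧
        (∀ β : ℝ, β₀ ≤ β → c₈ ≤ β * u 8 β) ∧
        (∀ (L L' : ℕ) (β : ℝ), β₀ ≤ β → 8 ≤ L → L ≤ L' → L' ≤ 2 * L →
            (∀ M : ℕ, 8 ≤ M → M ≤ L → u M β ≤ u₀) → |(u L β)⁻¹ - (u L' β)⁻¹| ≤ κ₂) ∧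
        (∀ (k m : ℕ) (β : ℝ), β₀ ≤ β → (∀ M : ℕ, 8 ≤ M → M ≤ 8 * 2 ^ (k + m) → u M β ≤ u₀) →
            κ₁ * m - κ₃ ≤ (u (8 * 2 ^ k) β)⁻¹ - (u (8 * 2 ^ (k + m)) β)⁻¹ ∧
              (u (8 * 2 ^ k) β)⁻¹ - (u (8 * 2 ^ (k + m)) β)⁻¹ ≤ κ₂ * m + κ₃) ∧
        (∀ (L : ℕ) [NeZero L] (β : ℝ), β₀ ≤ β → 8 ≤ L →
            (∀ M : ℕ, 8 ≤ M → M ≤ L → u M β ≤ u₀) →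
            ∀ (P : (Fin 4 → ZMod L) → Fin 4 → Fin 4 → GaugeConfig 4 L G → ℝ)
              (E : (GaugeConfig 4 L G → ℝ) → ℝ),
              (P = fun x i j U => (r.N : ℝ) - (r.ρ (plaquetteHolonomy U x i j)).trace.re) →
              (E = fun F => wilsonExpectation r.ρ β F) →
              c * u L β ^ 2 ≤
                ((L / 8 : ℕ) : ℝ) ^ 8 * (E (fun U => P 0 0 1 U * P (Pi.single (2 : Fin 4) ((L / 8 : ℕ) : ZMod L)) 0 1 U)
                  - E (P 0 0 1) * E (P (Pi.single (2 : Fin 4) ((L / 8 : ℕ) : ZMod L)) 0 1)) ∧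
              ((L / 8 : ℕ) : ℝ) ^ 8 * (E (fun U => P 0 0 1 U * P (Pi.single (2 : Fin 4) ((L / 8 : ℕ) : ZMod L)) 0 1 U)
                - E (P 0 0 1) * E (P (Pi.single (2 : Fin 4) ((L / 8 : ℕ) : ZMod L)) 0 1)) ≤ C * u L β ^ 2)) →
      ∃ (β₁ C' : ℝ),
          (∀ (L : ℕ) [NeZero L] (β : ℝ) (s : ℕ), β₁ ≤ β → 8 ≤ L → 1 ≤ s → 8 * s ≤ L →
              (∀ M : ℕ, 8 ≤ M → M ≤ L → u M β ≤ u₀) →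
              ∀ (P : (Fin 4 → ZMod L) → Fin 4 → Fin 4 → GaugeConfig 4 L G → ℝ)
                (E : (GaugeConfig 4 L G → ℝ) → ℝ),
                (P = fun x i j U => (r.N : ℝ) - (r.ρ (plaquetteHolonomy U x i j)).trace.re) →
                (E = fun F => wilsonExpectation r.ρ β F) →
                (s : ℝ) ^ 8 * (E (fun U => P 0 0 1 U * P (Pi.single (2 : Fin 4) ((s : ℕ) : ZMod L)) 0 1 U)
                      - E (P 0 0 1) * E (P (Pi.single (2 : Fin 4) ((s : ℕ) : ZMod L)) 0 1)) ≤
                  C' * u (8 * s) β ^ 2) := by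
  sorry

/-- **LU — longitudinal domination (stub; open, L; verbatim line `birth`'s `stub_longitudinalUpper`, so ONE landing serves
both lines).** For every compact simple `G`, faithful unitary `r` and EVERY coupling `u` with the R-properties: beyond some
threshold, on window boxes `L ≥ 8`, the LONGITUDINAL profile is dominated at interior separations,
`s⁸·|Cov_{L,β}(P_0^{01}, P_{se₀}^{01})| ≤ C'·u(8s,β)²` (`1 ≤ s`, `8s ≤ L`). Tree level: the longitudinal and transverse
`F_{01}`–`F_{01}` Wick squares have equal size; does NOT follow from the transverse clauses by reflection positivity
(cycle-8 saturation audit). [Balaban1988Convergent, CosteEtAl1985] -/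
theorem stub_longitudinalUpper :
    ∀ (G : Type) [Group G] [TopologicalSpace G] [IsTopologicalGroup G] [CompactSpace G]
        [MeasurableSpace G] [BorelSpace G], IsCompactSimpleLieGroup G →
        ∀ r : LatticeRep G, ∀ (u : ℕ → ℝ → ℝ) (u₀ β₀ κ₁ κ₂ κ₃ c C c₈ : ℝ),
      (0 < u₀ ∧ 0 < c ∧ 0 < κ₁ ∧ 0 ≤ κ₃ ∧ 0 < c₈ ∧
        (∀ (L : ℕ) (β : ℝ), 8 ≤ L → β₀ ≤ β → 0 < u L β) ∧
        (∀ L : ℕ, 8 ≤ L → ContinuousOn (u L) (Set.Ici β₀)) ∧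
        (∀ L : ℕ, 8 ≤ L → Filter.Tendsto (u L) Filter.atTop (nhds 0)) ∧
        (∀ β : ℝ, β₀ ≤ β → c₈ ≤ β * u 8 β) ∧
        (∀ (L L' : ℕ) (β : ℝ), β₀ ≤ β → 8 ≤ L → L ≤ L' → L' ≤ 2 * L →
            (∀ M : ℕ, 8 ≤ M → M ≤ L → u M β ≤ u₀) → |(u L β)⁻¹ - (u L' β)⁻¹| ≤ κ₂) ∧
        (∀ (k m : ℕ) (β : ℝ), β₀ ≤ β → (∀ M : ℕ, 8 ≤ M → M ≤ 8 * 2 ^ (k + m) → u M β ≤ u₀) →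
            κ₁ * m - κ₃ ≤ (u (8 * 2 ^ k) β)⁻¹ - (u (8 * 2 ^ (k + m)) β)⁻¹ ∧
              (u (8 * 2 ^ k) β)⁻¹ - (u (8 * 2 ^ (k + m)) β)⁻¹ ≤ κ₂ * m + κ₃) ∧
        (∀ (L : ℕ) [NeZero L] (β : ℝ), β₀ ≤ β → 8 ≤ L →
            (∀ M : ℕ, 8 ≤ M → M ≤ L → u M β ≤ u₀) →
            ∀ (P : (Fin 4 → ZMod L) → Fin 4 → Fin 4 → GaugeConfig 4 L G → ℝ)
              (E : (GaugeConfig 4 L G → ℝ) → ℝ),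
              (P = fun x i j U => (r.N : ℝ) - (r.ρ (plaquetteHolonomy U x i j)).trace.re) →
              (E = fun F => wilsonExpectation r.ρ β F) →
              c * u L β ^ 2 ≤
                ((L / 8 : ℕ) : ℝ) ^ 8 * (E (fun U => P 0 0 1 U * P (Pi.single (2 : Fin 4) ((L / 8 : ℕ) : ZMod L)) 0 1 U)
                  - E (P 0 0 1) * E (P (Pi.single (2 : Fin 4) ((L / 8 : ℕ) : ZMod L)) 0 1)) ∧
              ((L / 8 : ℕ) : ℝ) ^ 8 * (E (fun U => P 0 0 1 U * P (Pi.single (2 : Fin 4) ((L / 8 : ℕ) : ZMod L)) 0 1 U)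
                - E (P 0 0 1) * E (P (Pi.single (2 : Fin 4) ((L / 8 : ℕ) : ZMod L)) 0 1)) ≤ C * u L β ^ 2)) →
      ∃ (β₁ C' : ℝ),
        (∀ (L : ℕ) [NeZero L] (β : ℝ) (s : ℕ), β₁ ≤ β → 8 ≤ L → 1 ≤ s → 8 * s ≤ L →
            (∀ M : ℕ, 8 ≤ M → M ≤ L → u M β ≤ u₀) →
            ∀ (P : (Fin 4 → ZMod L) → Fin 4 → Fin 4 → GaugeConfig 4 L G → ℝ)
              (E : (GaugeConfig 4 L G → ℝ) → ℝ),
              (P = fun x i j U => (r.N : ℝ) - (r.ρ (plaquetteHolonomy U x i j)).trace.re) →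
              (E = fun F => wilsonExpectation r.ρ β F) →
              (s : ℝ) ^ 8 * |E (fun U => P 0 0 1 U * P (Pi.single (0 : Fin 4) ((s : ℕ) : ZMod L)) 0 1 U)
                  - E (P 0 0 1) * E (P (Pi.single (0 : Fin 4) ((s : ℕ) : ZMod L)) 0 1)| ≤
                C' * u (8 * s) β ^ 2) := by
  sorry

/-- **V-corner — the variance ceiling in the deep-femto (holonomy) corner, BOTH parities (stub; reshape v3; CLOSED in wave 4, p166872).**
For every compact simple `G`, faithful unitary `r` and EVERY coupling `u` with the R-properties: beyond a threshold,
`Var_{L,β}(P_0^{01}) ≤ C'·u(8,β)²` on window boxes `L ≥ 8` with `L⁴ < log β`. Everything else of the variance clause V is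
CLOSED: even boxes with `log β ≤ L⁴` (p150733, p155166: even chessboard + torus free-energy sandwich) and — new in this line's
wave 2 — ODD boxes with `log β ≤ L⁴` (p161704 `stub_varianceCeilingOddBulk`, via the partial chessboard on odd tori
p161454 and odd transported RP p161213). Both parities use `log β ≤ L⁴` only through the uniform torus doubling
`Z_L(β/2) ≤ e^{AL⁴}·Z_L(β)`; the corner is exactly the `2D·log β` slack of the landed sandwich
`|log Z_L(β) + (3D/2)L⁴ log β| ≤ A·L⁴ + 2D·log β` (the four wrap links = holonomy/toron sector), so ONE lemma
`uniformDoubling_corner` (uniform doubling for `log β > L⁴`; needs the exact fixed-`L` exponent of `Z_L` at the commuting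
variety, uniformly in `L`) closes this stub by the landed proofs verbatim. [Balaban1988Convergent, arXiv180301950] -/
theorem stub_varianceCeilingCorner :
    ∀ (G : Type) [Group G] [TopologicalSpace G] [IsTopologicalGroup G] [CompactSpace G]
        [MeasurableSpace G] [BorelSpace G], IsCompactSimpleLieGroup G →
        ∀ r : LatticeRep G, ∀ (u : ℕ → ℝ → ℝ) (u₀ β₀ κ₁ κ₂ κ₃ c C c₈ : ℝ),
      (0 < u₀ ∧ 0 < c ∧ 0 < κ₁ ∧ 0 ≤ κ₃ ∧ 0 < c₈ ∧
        (∀ (L : ℕ) (β : ℝ), 8 ≤ L → β₀ ≤ β → 0 < u L β) ∧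
        (∀ L : ℕ, 8 ≤ L → ContinuousOn (u L) (Set.Ici β₀)) ∧
        (∀ L : ℕ, 8 ≤ L → Filter.Tendsto (u L) Filter.atTop (nhds 0)) ∧
        (∀ β : ℝ, β₀ ≤ β → c₈ ≤ β * u 8 β) ∧
        (∀ (L L' : ℕ) (β : ℝ), β₀ ≤ β → 8 ≤ L → L ≤ L' → L' ≤ 2 * L →
            (∀ M : ℕ, 8 ≤ M → M ≤ L → u M β ≤ u₀) → |(u L β)⁻¹ - (u L' β)⁻¹| ≤ κ₂) ∧
        (∀ (k m : ℕ) (β : ℝ), β₀ ≤ β → (∀ M : ℕ, 8 ≤ M → M ≤ 8 * 2 ^ (k + m) → u M β ≤ u₀) →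
            κ₁ * m - κ₃ ≤ (u (8 * 2 ^ k) β)⁻¹ - (u (8 * 2 ^ (k + m)) β)⁻¹ ∧
              (u (8 * 2 ^ k) β)⁻¹ - (u (8 * 2 ^ (k + m)) β)⁻¹ ≤ κ₂ * m + κ₃) ∧
        (∀ (L : ℕ) [NeZero L] (β : ℝ), β₀ ≤ β → 8 ≤ L →
            (∀ M : ℕ, 8 ≤ M → M ≤ L → u M β ≤ u₀) →
            ∀ (P : (Fin 4 → ZMod L) → Fin 4 → Fin 4 → GaugeConfig 4 L G → ℝ)
              (E : (GaugeConfig 4 L G → ℝ) → ℝ),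
              (P = fun x i j U => (r.N : ℝ) - (r.ρ (plaquetteHolonomy U x i j)).trace.re) →
              (E = fun F => wilsonExpectation r.ρ β F) →
              c * u L β ^ 2 ≤
                ((L / 8 : ℕ) : ℝ) ^ 8 * (E (fun U => P 0 0 1 U * P (Pi.single (2 : Fin 4) ((L / 8 : ℕ) : ZMod L)) 0 1 U)
                  - E (P 0 0 1) * E (P (Pi.single (2 : Fin 4) ((L / 8 : ℕ) : ZMod L)) 0 1)) ∧
              ((L / 8 : ℕ) : ℝ) ^ 8 * (E (fun U => P 0 0 1 U * P (Pi.single (2 : Fin 4) ((L / 8 : ℕ) : ZMod L)) 0 1 U)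
                - E (P 0 0 1) * E (P (Pi.single (2 : Fin 4) ((L / 8 : ℕ) : ZMod L)) 0 1)) ≤ C * u L β ^ 2)) →
      ∃ (β₁ C' : ℝ),
        (∀ (L : ℕ) [NeZero L] (β : ℝ), β₁ ≤ β → 8 ≤ L → (L : ℝ) ^ 4 < Real.log β →
            (∀ M : ℕ, 8 ≤ M → M ≤ L → u M β ≤ u₀) →
            ∀ (P : (Fin 4 → ZMod L) → Fin 4 → Fin 4 → GaugeConfig 4 L G → ℝ)
              (E : (GaugeConfig 4 L G → ℝ) → ℝ),
              (P = fun x i j U => (r.N : ℝ) - (r.ρ (plaquetteHolonomy U x i j)).trace.re) →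
              (E = fun F => wilsonExpectation r.ρ β F) →
              E (fun U => P 0 0 1 U * P 0 0 1 U) - E (P 0 0 1) * E (P 0 0 1) ≤ C' * u 8 β ^ 2) :=
  -- CLOSED (landed p166872 `…CStubVarianceCeilingCorner`, identical signature): uniform torus doubling for ALL L ≥ 2, b ≥ 4
  -- (`TorusGauge.uniformDoubling_all`, p166705: condition on the four axis holonomies, lattice Stokes p164986, hyperplane-twist
  -- background p165204, sandwich p166163/p165659, iterated one-site doubling p163946) through the corner bridge p162787.
  Summit.QuantumFields.YangMills.Theorems.FemtoCurvatureTwoPointC.stub_varianceCeilingCorner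

/-- **Dom — smearing domination (stub; provable now, size M).** For every compact group `G`, every continuous matrix
representation `ρ`, every torus `L`, every `β ≥ 0`, every block side `1 ≤ m ≤ L` and every `e₂`-separation `t`:
smearing both plaquettes over the transverse cube `[0,m)³` of their `x₂`-slice can only LOWER the covariance below the
on-axis point value, `Cov_{L,β}(B_m(0), B_m(t)) ≤ Cov_{L,β}(P_0^{01}, P_{te₂}^{01})`, `B_m(s) := m⁻³ ∑_{v ∈ [0,m)³} P^{01}_{(v₀,v₁,s,v₂)}`.
Mechanism: for fixed `t` the slice kernel `w ↦ K_t(w) = Cov(P^{01}_{(0,0)}, P^{01}_{(w,t)})` on `(ℤ/L)³` is positive-definite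
(`∑ c_w c_{w'} K_t(w' − w) = Cov(F, τ_{te₂} F) ≥ 0` for the slice observable `F = ∑ c_w P^{01}_{(w,0)}`, by reflection
positivity of Wilson's measure through the site/link mirror between the slices `0` and `t` — the landed transfer-matrix
rungs `FemtoCurvatureTwoPoint.stub_axisCovNonneg` / `…StrictRP*`), so by Bochner on the finite abelian group
`Cov(B_m(0), B_m(t)) = ∑_p K̂_t(p) |ĉ(p)|² ≤ K_t(0)` for the uniform probability vector `c` on the cube (`|ĉ| ≤ 1`).
[OsterwalderSeiler1978, Seiler LNP 159 Ch. 2] -/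
theorem stub_smearingDomination :
    ∀ (L N : ℕ) [NeZero L] (G : Type) [Group G] [TopologicalSpace G] [IsTopologicalGroup G]
        [CompactSpace G] [MeasurableSpace G] [BorelSpace G] (ρ : G →* Matrix (Fin N) (Fin N) ℂ),
        Continuous ρ → ∀ (β : ℝ), 0 ≤ β → ∀ (m t : ℕ), 1 ≤ m → m ≤ L →
        ∀ (P : (Fin 4 → ZMod L) → Fin 4 → Fin 4 → GaugeConfig 4 L G → ℝ)
          (B : ℕ → GaugeConfig 4 L G → ℝ) (E : (GaugeConfig 4 L G → ℝ) → ℝ),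
          (P = fun x i j U => (N : ℝ) - (ρ (plaquetteHolonomy U x i j)).trace.re) →
          (B = fun s U => (((m : ℕ) : ℝ) ^ 3)⁻¹ *
              ∑ v : Fin (m) × Fin (m) × Fin (m),
                P ![((v.1 : ℕ) : ZMod L), ((v.2.1 : ℕ) : ZMod L), ((s : ℕ) : ZMod L), ((v.2.2 : ℕ) : ZMod L)] 0 1 U) →
          (E = fun F => wilsonExpectation ρ β F) →
          E (fun U => B 0 U * B t U) - E (B 0) * E (B t) ≤
            E (fun U => P 0 0 1 U * P (Pi.single (2 : Fin 4) ((t : ℕ) : ZMod L)) 0 1 U)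
              - E (P 0 0 1) * E (P (Pi.single (2 : Fin 4) ((t : ℕ) : ZMod L)) 0 1) :=
  -- CLOSED (landed p143011, `…CSmearingDomination`, identical signature): reflection positivity on
  -- two-plaquette differences, `M_{vw} + M_{wv} ≤ 2K_t(0)`, then average over the cube.
  Summit.QuantumFields.YangMills.Theorems.FemtoCurvatureTwoPointC.smearingDomination

/-- **Flo′ — the conditional-mean floor at ONE pinned conditioning scale, conditioning on the FLOWED block field (stub;
the idea card's lever; open, L–XL; reshape v2 of v1's `stub_conditionalMeanFloor`, whose decimated-comb σ-algebra was
mis-stated — see the module docstring).** For every compact simple `G`, faithful unitary `r` and EVERY coupling `u` with the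
R-properties there are `c_F > 0` and `D₁ ≥ 1` such that for every block distance `D₀ ≥ D₁`, beyond a threshold `β₁(D₀)`, on
every window box `L` and every separation `2D₀ ≤ n ≤ L/8`: with `b := ⌊n/D₀⌋ (≥ 2)`, `μ := wilsonMeasure r.ρ β`, the
transverse block plaquettes `X = B_b(0)`, `Y = B_b(n)` (cubes `[0,b)³` in the slices `x₂ = 0`, `x₂ = n`) and the σ-algebra
`𝓕_b` generated by the straight coarse transporters (uneven axial blocking `unevenAxialLink b L (L/b)`, coarse torus of side
`L/b ≥ 8D₀`) of the Wilson-FLOWED link matrices `ρ(U)_t` at flow time `t = b²/8` (smoothing radius `b`; Lüscher's flow (1.4)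
run in `M_N(ℂ)` along `Lie(ρ(G))`, tree `wilsonFlowMatrix`): `c_F · u(8n,β)² ≤ n⁸ · Cov_μ(μ[X|𝓕_b], μ[Y|𝓕_b])`, with `c_F`
UNIFORM in `D₀` (and in `b`). Why plausibly true: the flowed, blocked field is a smooth gauge-covariant block field at scale
`b` with no thin lines (phase fluctuations `O(u_b)`), whose law is a near-Gaussian scale-`b` effective measure; `μ[B|𝓕_b]`
is at leading order a Wick square of the block curvature, so the covariance of the two conditional means at block distance
`∈ [D₀, 2D₀)` is two-sidedly `≍ g_b⁴ n⁻⁸`, `g_b² ≍ u(8n,β)`; Gaussian caricature: share `1 − O(D₀⁻²)` uniformly in `b`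
(v1's comb: `≍ D₀⁴/b²`). Content: perturbative control of the gradient-flow block-spin effective law with one dimension-4
insertion, uniformly in the scale and the volume — not in print. Consistent with `Negative/UniformFreezing` (units of the
running `u`) and `nontrivialC_false` (`ConnectedSpace G` enters here). [Luscher2010, Balaban1988Convergent, LuscherWeisz2011,
Balaban1984Propagators] -/
theorem stub_flowedMeanFloor :
    ∀ (G : Type) [Group G] [TopologicalSpace G] [IsTopologicalGroup G] [CompactSpace G]
        [MeasurableSpace G] [BorelSpace G], IsCompactSimpleLieGroup G →
        ∀ r : LatticeRep G, ∀ (u : ℕ → ℝ → ℝ) (u₀ β₀ κ₁ κ₂ κ₃ c C c₈ : ℝ),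
      (0 < u₀ ∧ 0 < c ∧ 0 < κ₁ ∧ 0 ≤ κ₃ ∧ 0 < c₈ ∧
        (∀ (L : ℕ) (β : ℝ), 8 ≤ L → β₀ ≤ β → 0 < u L β) ∧
        (∀ L : ℕ, 8 ≤ L → ContinuousOn (u L) (Set.Ici β₀)) ∧
        (∀ L : ℕ, 8 ≤ L → Filter.Tendsto (u L) Filter.atTop (nhds 0)) ∧
        (∀ β : ℝ, β₀ ≤ β → c₈ ≤ β * u 8 β) ∧
        (∀ (L L' : ℕ) (β : ℝ), β₀ ≤ β → 8 ≤ L → L ≤ L' → L' ≤ 2 * L →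
            (∀ M : ℕ, 8 ≤ M → M ≤ L → u M β ≤ u₀) → |(u L β)⁻¹ - (u L' β)⁻¹| ≤ κ₂) ∧
        (∀ (k m : ℕ) (β : ℝ), β₀ ≤ β → (∀ M : ℕ, 8 ≤ M → M ≤ 8 * 2 ^ (k + m) → u M β ≤ u₀) →
            κ₁ * m - κ₃ ≤ (u (8 * 2 ^ k) β)⁻¹ - (u (8 * 2 ^ (k + m)) β)⁻¹ ∧
              (u (8 * 2 ^ k) β)⁻¹ - (u (8 * 2 ^ (k + m)) β)⁻¹ ≤ κ₂ * m + κ₃) ∧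
        (∀ (L : ℕ) [NeZero L] (β : ℝ), β₀ ≤ β → 8 ≤ L →
            (∀ M : ℕ, 8 ≤ M → M ≤ L → u M β ≤ u₀) →
            ∀ (P : (Fin 4 → ZMod L) → Fin 4 → Fin 4 → GaugeConfig 4 L G → ℝ)
              (E : (GaugeConfig 4 L G → ℝ) → ℝ),
              (P = fun x i j U => (r.N : ℝ) - (r.ρ (plaquetteHolonomy U x i j)).trace.re) →
              (E = fun F => wilsonExpectation r.ρ β F) →
              c * u L β ^ 2 ≤
                ((L / 8 : ℕ) : ℝ) ^ 8 * (E (fun U => P 0 0 1 U * P (Pi.single (2 : Fin 4) ((L / 8 : ℕ) : ZMod L)) 0 1 U)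
                  - E (P 0 0 1) * E (P (Pi.single (2 : Fin 4) ((L / 8 : ℕ) : ZMod L)) 0 1)) ∧
              ((L / 8 : ℕ) : ℝ) ^ 8 * (E (fun U => P 0 0 1 U * P (Pi.single (2 : Fin 4) ((L / 8 : ℕ) : ZMod L)) 0 1 U)
                - E (P 0 0 1) * E (P (Pi.single (2 : Fin 4) ((L / 8 : ℕ) : ZMod L)) 0 1)) ≤ C * u L β ^ 2)) →
      ∃ (c_F : ℝ) (D₁ : ℕ), 0 < c_F ∧ 1 ≤ D₁ ∧ ∀ D₀ : ℕ, D₁ ≤ D₀ → ∃ β₁ : ℝ,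
        ∀ (L : ℕ) [NeZero L] (β : ℝ) (n : ℕ), β₁ ≤ β → 2 * D₀ ≤ n → 8 * n ≤ L →
          (∀ M : ℕ, 8 ≤ M → M ≤ L → u M β ≤ u₀) →
          ∀ (P : (Fin 4 → ZMod L) → Fin 4 → Fin 4 → GaugeConfig 4 L G → ℝ)
            (X Y : GaugeConfig 4 L G → ℝ) (μ : Measure (GaugeConfig 4 L G))
            (mB : MeasurableSpace (GaugeConfig 4 L G)),
            (P = fun x i j U => (r.N : ℝ) - (r.ρ (plaquetteHolonomy U x i j)).trace.re) →
            (X = fun U => (((n / D₀ : ℕ) : ℝ) ^ 3)⁻¹ *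
                ∑ v : Fin (n / D₀) × Fin (n / D₀) × Fin (n / D₀),
                  P ![((v.1 : ℕ) : ZMod L), ((v.2.1 : ℕ) : ZMod L), ((0 : ℕ) : ZMod L), ((v.2.2 : ℕ) : ZMod L)] 0 1 U) →
            (Y = fun U => (((n / D₀ : ℕ) : ℝ) ^ 3)⁻¹ *
                ∑ v : Fin (n / D₀) × Fin (n / D₀) × Fin (n / D₀),
                  P ![((v.1 : ℕ) : ZMod L), ((v.2.1 : ℕ) : ZMod L), ((n : ℕ) : ZMod L), ((v.2.2 : ℕ) : ZMod L)] 0 1 U) →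
            (μ = wilsonMeasure r.ρ β) →
            (mB = MeasurableSpace.comap
                (fun (U : GaugeConfig 4 L G) (e : Edge 4 (L / (n / D₀))) (i j : Fin r.N) =>
                  unevenAxialLink (n / D₀) L (L / (n / D₀))
                    (Literature.MathematicalPhysics.QuantumLattice.wilsonFlowMatrix r.ρ
                      (((n / D₀ : ℕ) : ℝ) ^ 2 / 64) U) e i j)
                inferInstance) →
            c_F * u (8 * n) β ^ 2 ≤ (n : ℝ) ^ 8 * cov[μ[X|mB], μ[Y|mB]; μ] := by
  sorry

/-- **Dec′ — conditional decoupling of the fluctuations GIVEN the flowed block field (stub; open, L; reshape v2 of v1's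
`stub_conditionalDecoupling`, same corrected σ-algebra as `stub_flowedMeanFloor`).** For every compact simple `G`, faithful
unitary `r`, EVERY coupling `u` with the R-properties and every `ε > 0` there is `D₁ ≥ 1` such that for every `D₀ ≥ D₁`,
beyond a threshold `β₁(D₀)`, on every window box and every separation `2D₀ ≤ n ≤ L/8` (notation of `stub_flowedMeanFloor`):
`n⁸ · |∫ (X − μ[X|𝓕_b])(Y − μ[Y|𝓕_b]) dμ| ≤ ε · u(8n,β)²` — the mean conditional covariance of the two block plaquettes GIVEN
the flowed block field (the first term of the law of total covariance) is an arbitrarily small share of the amplitude once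
the blocks are `D₀` conditioning blocks apart. Why plausibly true: given a genuine scale-`b` block field the fluctuation field
is massive on the block scale (Bałaban's constrained propagators decay like `e^{−γ|x−y|/b}`), so conditional covariances of
local functionals at block distance `D₀` carry `e^{−γ'D₀}`; Gaussian caricature (block average / flow): residual correlation
length `≍ b`, residual share saturating in `b` and decreasing in `D₀` (`≈ 0.14` at `D₀ = 6`, so expect `D₁ ≈ 8–10` for
`ε = c_F/2`), whereas v1's decimated comb has `ξ_res ≈ 0.5·b^{3/2}` and fails. NOT claimed: any sign of this term.
[Balaban1984Propagators, Balaban1988Convergent, Luscher2010, Dimock2013] -/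
theorem stub_flowedDecoupling :
    ∀ (G : Type) [Group G] [TopologicalSpace G] [IsTopologicalGroup G] [CompactSpace G]
        [MeasurableSpace G] [BorelSpace G], IsCompactSimpleLieGroup G →
        ∀ r : LatticeRep G, ∀ (u : ℕ → ℝ → ℝ) (u₀ β₀ κ₁ κ₂ κ₃ c C c₈ : ℝ),
      (0 < u₀ ∧ 0 < c ∧ 0 < κ₁ ∧ 0 ≤ κ₃ ∧ 0 < c₈ ∧
        (∀ (L : ℕ) (β : ℝ), 8 ≤ L → β₀ ≤ β → 0 < u L β) ∧
        (∀ L : ℕ, 8 ≤ L → ContinuousOn (u L) (Set.Ici β₀)) ∧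
        (∀ L : ℕ, 8 ≤ L → Filter.Tendsto (u L) Filter.atTop (nhds 0)) ∧
        (∀ β : ℝ, β₀ ≤ β → c₈ ≤ β * u 8 β) ∧
        (∀ (L L' : ℕ) (β : ℝ), β₀ ≤ β → 8 ≤ L → L ≤ L' → L' ≤ 2 * L →
            (∀ M : ℕ, 8 ≤ M → M ≤ L → u M β ≤ u₀) → |(u L β)⁻¹ - (u L' β)⁻¹| ≤ κ₂) ∧
        (∀ (k m : ℕ) (β : ℝ), β₀ ≤ β → (∀ M : ℕ, 8 ≤ M → M ≤ 8 * 2 ^ (k + m) → u M β ≤ u₀) →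
            κ₁ * m - κ₃ ≤ (u (8 * 2 ^ k) β)⁻¹ - (u (8 * 2 ^ (k + m)) β)⁻¹ ∧
              (u (8 * 2 ^ k) β)⁻¹ - (u (8 * 2 ^ (k + m)) β)⁻¹ ≤ κ₂ * m + κ₃) ∧
        (∀ (L : ℕ) [NeZero L] (β : ℝ), β₀ ≤ β → 8 ≤ L →
            (∀ M : ℕ, 8 ≤ M → M ≤ L → u M β ≤ u₀) →
            ∀ (P : (Fin 4 → ZMod L) → Fin 4 → Fin 4 → GaugeConfig 4 L G → ℝ)
              (E : (GaugeConfig 4 L G → ℝ) → ℝ),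
              (P = fun x i j U => (r.N : ℝ) - (r.ρ (plaquetteHolonomy U x i j)).trace.re) →
              (E = fun F => wilsonExpectation r.ρ β F) →
              c * u L β ^ 2 ≤
                ((L / 8 : ℕ) : ℝ) ^ 8 * (E (fun U => P 0 0 1 U * P (Pi.single (2 : Fin 4) ((L / 8 : ℕ) : ZMod L)) 0 1 U)
                  - E (P 0 0 1) * E (P (Pi.single (2 : Fin 4) ((L / 8 : ℕ) : ZMod L)) 0 1)) ∧
              ((L / 8 : ℕ) : ℝ) ^ 8 * (E (fun U => P 0 0 1 U * P (Pi.single (2 : Fin 4) ((L / 8 : ℕ) : ZMod L)) 0 1 U)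
                - E (P 0 0 1) * E (P (Pi.single (2 : Fin 4) ((L / 8 : ℕ) : ZMod L)) 0 1)) ≤ C * u L β ^ 2)) →
      ∀ ε : ℝ, 0 < ε → ∃ D₁ : ℕ, 1 ≤ D₁ ∧ ∀ D₀ : ℕ, D₁ ≤ D₀ → ∃ β₁ : ℝ,
        ∀ (L : ℕ) [NeZero L] (β : ℝ) (n : ℕ), β₁ ≤ β → 2 * D₀ ≤ n → 8 * n ≤ L →
          (∀ M : ℕ, 8 ≤ M → M ≤ L → u M β ≤ u₀) →
          ∀ (P : (Fin 4 → ZMod L) → Fin 4 → Fin 4 → GaugeConfig 4 L G → ℝ)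
            (X Y : GaugeConfig 4 L G → ℝ) (μ : Measure (GaugeConfig 4 L G))
            (mB : MeasurableSpace (GaugeConfig 4 L G)),
            (P = fun x i j U => (r.N : ℝ) - (r.ρ (plaquetteHolonomy U x i j)).trace.re) →
            (X = fun U => (((n / D₀ : ℕ) : ℝ) ^ 3)⁻¹ *
                ∑ v : Fin (n / D₀) × Fin (n / D₀) × Fin (n / D₀),
                  P ![((v.1 : ℕ) : ZMod L), ((v.2.1 : ℕ) : ZMod L), ((0 : ℕ) : ZMod L), ((v.2.2 : ℕ) : ZMod L)] 0 1 U) →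
            (Y = fun U => (((n / D₀ : ℕ) : ℝ) ^ 3)⁻¹ *
                ∑ v : Fin (n / D₀) × Fin (n / D₀) × Fin (n / D₀),
                  P ![((v.1 : ℕ) : ZMod L), ((v.2.1 : ℕ) : ZMod L), ((n : ℕ) : ZMod L), ((v.2.2 : ℕ) : ZMod L)] 0 1 U) →
            (μ = wilsonMeasure r.ρ β) →
            (mB = MeasurableSpace.comap
                (fun (U : GaugeConfig 4 L G) (e : Edge 4 (L / (n / D₀))) (i j : Fin r.N) =>
                  unevenAxialLink (n / D₀) L (L / (n / D₀))
                    (Literature.MathematicalPhysics.QuantumLattice.wilsonFlowMatrix r.ρ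
                      (((n / D₀ : ℕ) : ℝ) ^ 2 / 64) U) e i j)
                inferInstance) →
            (n : ℝ) ^ 8 * |∫ U, (X U - (μ[X|mB]) U) * (Y U - (μ[Y|mB]) U) ∂μ| ≤ ε * u (8 * n) β ^ 2 := by
  sorry

/-- **NN — the fixed-torus NEAREST-NEIGHBOUR floor (stub; open, M–L; `u`-FREE; reshape v2, replaces v1's bounded-box clause
through the landed bridge `boundedBoxes_of_nearestNeighbourFloor`, p158015).** For every compact `G` with a faithful unitary
lattice representation `r` and every bound `L₀` there are `β₂` and `c₁ > 0` with
`c₁/β² ≤ Cov_{L,β}(P_0^{01}, P_{e₂}^{01})` for every torus `8 ≤ L ≤ L₀` and every `β ≥ β₂` — the transverse plaquette–plaquette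
covariance of ADJACENT (link-disjoint) plaquettes on finitely many fixed tori is of the Gaussian order `1/β²` from BELOW as
`β → ∞` (second-order Laplace asymptotics of Wilson's measure around the flat connections: `β²·Cov_{L,β}(1) → κ_{L,1} > 0`,
tree level = a Wick square of the twisted lattice Maxwell kernel, band landed as `MaxwellKernelBand` p94229; torons and
the `SU(2)` log-valley give `O(1/log β)` corrections with a positive limit). With RP log-convexity (`Cov(n) ≥ Var·(Cov(1)/Var)^n`)
and the landed fixed-torus variance ceiling this yields the lower transverse clause on all boxes `L ≤ L₀`. MC-testable at
accessible `β` on `L = 8, 12, 16`. [Luscher1983, CosteEtAl1985, arXiv:1211.3247] -/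
theorem stub_nearestNeighbourFloor :
    ∀ (G : Type) [Group G] [TopologicalSpace G] [IsTopologicalGroup G] [CompactSpace G]
        [MeasurableSpace G] [BorelSpace G], IsCompactSimpleLieGroup G →
        ∀ r : LatticeRep G, ∀ L₀ : ℕ, ∃ (β₂ c₁ : ℝ), 0 < c₁ ∧
        ∀ (L : ℕ) [NeZero L] (β : ℝ), 8 ≤ L → L ≤ L₀ → β₂ ≤ β →
          ∀ (P : (Fin 4 → ZMod L) → Fin 4 → Fin 4 → GaugeConfig 4 L G → ℝ)
            (E : (GaugeConfig 4 L G → ℝ) → ℝ),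
            (P = fun x i j U => (r.N : ℝ) - (r.ρ (plaquetteHolonomy U x i j)).trace.re) →
            (E = fun F => wilsonExpectation r.ρ β F) →
            c₁ / β ^ 2 ≤
              E (fun U => P 0 0 1 U * P (Pi.single (2 : Fin 4) ((1 : ℕ) : ZMod L)) 0 1 U)
                - E (P 0 0 1) * E (P (Pi.single (2 : Fin 4) ((1 : ℕ) : ZMod L)) 0 1) := by
  sorry

/-! ## Composition (sorry-free below this line) -/

section Glue

variable {G : Type} [Group G] [TopologicalSpace G] [IsTopologicalGroup G] [CompactSpace G]
  [MeasurableSpace G] [BorelSpace G]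

/-! ### The corrected conditioning σ-algebra is a sub-σ-algebra of the product σ-algebra -/

omit [IsTopologicalGroup G] in
/-- **The flowed, blocked field is a measurable function of the fine configuration** (entrywise): `U ↦ ρ(U)` is
continuous, the Wilson flow at any real time is continuous on unitary link fields (`continuous_wilsonFlowMatrix`), a
straight transporter is a finite ordered product (`continuous_transport_config`, over the matrix monoid), matrix entries
are continuous; a faithful `LatticeRep` makes `G` second countable, so continuity gives measurability for the product
σ-algebras. (Worker Flo, wave 1.) -/
theorem measurable_flowDecimate (r : LatticeRep G) (b L T : ℕ) [NeZero L] (t : ℝ) :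
    Measurable fun (U : GaugeConfig 4 L G) (e : Edge 4 T) (i j : Fin r.N) =>
      unevenAxialLink b L T (Literature.MathematicalPhysics.QuantumLattice.wilsonFlowMatrix r.ρ t U) e i j := by
  haveI : SecondCountableTopology G :=
    (r.continuous.isClosedEmbedding r.injective).isEmbedding.secondCountableTopology
  refine measurable_pi_lambda _ fun e => measurable_pi_lambda _ fun i => measurable_pi_lambda _ fun j => ?_
  have h1 : Continuous fun U : GaugeConfig 4 L G =>
      Literature.MathematicalPhysics.QuantumLattice.wilsonFlowMatrix r.ρ t U :=
    Literature.MathematicalPhysics.QuantumLattice.continuous_wilsonFlowMatrix r.ρ r.continuous r.mem_unitary t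
  have h2 : Continuous fun V : GaugeConfig 4 L (Matrix (Fin r.N) (Fin r.N) ℂ) => unevenAxialLink b L T V e :=
    Literature.MathematicalPhysics.QuantumLattice.continuous_transport_config _ _
  exact ((h2.comp h1).matrix_elem i j).measurable

omit [IsTopologicalGroup G] in
/-- The corrected conditioning σ-algebra (flow at time `t`, then uneven axial blocking `b, L, T`) is a sub-σ-algebra of
the product σ-algebra of the fine configuration space. -/
theorem comap_flowDecimate_le (r : LatticeRep G) (b L T : ℕ) [NeZero L] (t : ℝ) :
    MeasurableSpace.comap
        (fun (U : GaugeConfig 4 L G) (e : Edge 4 T) (i j : Fin r.N) =>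
          unevenAxialLink b L T (Literature.MathematicalPhysics.QuantumLattice.wilsonFlowMatrix r.ρ t U) e i j)
        inferInstance ≤ (inferInstance : MeasurableSpace (GaugeConfig 4 L G)) :=
  (measurable_flowDecimate r b L T t).comap_le

/-! ### Measure-theoretic facts: plaquette fields and block observables under Wilson's measure -/

/-- `|Re tr M| ≤ N` for a unitary `N × N` matrix (entries of modulus `≤ 1`). -/
theorem abs_re_trace_le_of_mem_unitary {N : ℕ} {M : Matrix (Fin N) (Fin N) ℂ}
    (hM : M ∈ Matrix.unitaryGroup (Fin N) ℂ) : |M.trace.re| ≤ N :=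
  calc |M.trace.re| ≤ ‖M.trace‖ := Complex.abs_re_le_norm _
    _ = ‖∑ k, M k k‖ := rfl
    _ ≤ ∑ k, ‖M k k‖ := norm_sum_le _ _
    _ ≤ ∑ _k : Fin N, (1 : ℝ) := Finset.sum_le_sum fun k _ => entry_norm_bound_of_unitary hM k k
    _ = N := by simp

omit [IsTopologicalGroup G] [CompactSpace G] [MeasurableSpace G] [BorelSpace G] in
/-- The plaquette field `U ↦ N - Re tr ρ(U_{x,ij})` of a lattice representation is bounded by `2N`. -/
theorem abs_plaqField_le (r : LatticeRep G) {L : ℕ} (x : Fin 4 → ZMod L) (i j : Fin 4)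
    (U : GaugeConfig 4 L G) :
    |(r.N : ℝ) - (r.ρ (plaquetteHolonomy U x i j)).trace.re| ≤ 2 * r.N := by
  have h := abs_le.1 (abs_re_trace_le_of_mem_unitary (r.mem_unitary (plaquetteHolonomy U x i j)))
  rw [abs_le]
  constructor <;> linarith [h.1, h.2]

omit [CompactSpace G] in
/-- The plaquette field of a lattice representation is measurable (continuous `ρ`, second-countable `G`). -/
theorem measurable_plaqField [SecondCountableTopology G] (r : LatticeRep G) {L : ℕ}
    (x : Fin 4 → ZMod L) (i j : Fin 4) :
    Measurable fun U : GaugeConfig 4 L G => (r.N : ℝ) - (r.ρ (plaquetteHolonomy U x i j)).trace.re :=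
  measurable_const.sub
    ((Complex.continuous_re.comp r.continuous.matrix_trace).measurable.comp
      (measurable_plaquetteHolonomy x i j))

/-- A scalar multiple of a finite sum of bounded measurable real functions is in every `L^p` of a finite
measure (block observables). -/
theorem memLp_const_mul_sum {Ω : Type*} [MeasurableSpace Ω] {μ : Measure Ω} [IsFiniteMeasure μ]
    {ι : Type*} [Fintype ι] (g : ι → Ω → ℝ) (a C : ℝ) (p : ENNReal) (hgm : ∀ i, Measurable (g i))
    (hgb : ∀ i ω, |g i ω| ≤ C) : MemLp (fun ω => a * ∑ i, g i ω) p μ := by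
  have h : ∀ i ∈ (Finset.univ : Finset ι), MemLp (g i) p μ := fun i _ =>
    MemLp.of_bound (hgm i).aestronglyMeasurable C
      (Eventually.of_forall fun ω => by rw [Real.norm_eq_abs]; exact hgb i ω)
  exact (memLp_finsetSum _ h).const_mul a

/-! ### Arithmetic of the comparability chain -/

/-- Chaining a one-octave comparability bound `f M' ≤ f M + κ` (`a ≤ M ≤ M' ≤ 2M`, `M' ≤ T`) along the boxes
`min (a·2^i) T`: after `i` steps the increment is at most `i κ`. -/
theorem chain_bound {f : ℕ → ℝ} {κ : ℝ} {a T : ℕ} (haT : a ≤ T)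
    (h : ∀ M M' : ℕ, a ≤ M → M ≤ M' → M' ≤ 2 * M → M' ≤ T → f M' ≤ f M + κ) :
    ∀ i : ℕ, f (min (a * 2 ^ i) T) ≤ f a + i * κ := by
  intro i
  induction i with
  | zero => simp [min_eq_left haT]
  | succ i ih =>
    have hpow : a * 2 ^ i ≤ a * 2 ^ (i + 1) :=
      Nat.mul_le_mul_left _ (Nat.pow_le_pow_right (by norm_num) (Nat.le_succ i))
    have hM : a ≤ min (a * 2 ^ i) T := le_min (Nat.le_mul_of_pos_right _ (by positivity)) haT
    have hMM' : min (a * 2 ^ i) T ≤ min (a * 2 ^ (i + 1)) T := min_le_min_right _ hpow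
    have hM'2 : min (a * 2 ^ (i + 1)) T ≤ 2 * min (a * 2 ^ i) T := by
      rcases le_total (a * 2 ^ i) T with hle | hle
      · rw [min_eq_left hle]
        calc min (a * 2 ^ (i + 1)) T ≤ a * 2 ^ (i + 1) := min_le_left _ _
          _ = 2 * (a * 2 ^ i) := by ring
      · rw [min_eq_right hle, min_eq_right (hle.trans hpow)]
        omega
    have hstep := h _ _ hM hMM' hM'2 (min_le_right _ _)
    calc f (min (a * 2 ^ (i + 1)) T) ≤ f (min (a * 2 ^ i) T) + κ := hstep
      _ ≤ f a + i * κ + κ := by linarith [ih]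
      _ = f a + ((i + 1 : ℕ) : ℝ) * κ := by push_cast; ring

/-- The chain run to the end: `f T ≤ f a + T κ`. -/
theorem chain_bound_end {f : ℕ → ℝ} {κ : ℝ} {a T : ℕ} (ha : 1 ≤ a) (haT : a ≤ T)
    (h : ∀ M M' : ℕ, a ≤ M → M ≤ M' → M' ≤ 2 * M → M' ≤ T → f M' ≤ f M + κ) :
    f T ≤ f a + T * κ := by
  have hT : T ≤ a * 2 ^ T :=
    (Nat.le_of_lt T.lt_two_pow_self).trans (Nat.le_mul_of_pos_left _ (by omega))
  have := chain_bound haT h T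
  rwa [min_eq_right hT] at this

/-- From `s⁻¹ ≤ t⁻¹ + k` (`s, t > 0`, `k ≥ 0`, `t ≤ u₀`): `t ≤ (1 + k u₀) s`. -/
theorem le_mul_of_inv_le_inv_add {s t k u₀ : ℝ} (hs : 0 < s) (ht : 0 < t) (hk : 0 ≤ k) (htu : t ≤ u₀)
    (h : s⁻¹ ≤ t⁻¹ + k) : t ≤ (1 + k * u₀) * s := by
  have h1 : t * s * s⁻¹ ≤ t * s * (t⁻¹ + k) := mul_le_mul_of_nonneg_left h (le_of_lt (mul_pos ht hs))
  have e1 : t * s * s⁻¹ = t := by field_simp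
  have e2 : t * s * (t⁻¹ + k) = s + k * t * s := by field_simp
  rw [e1, e2] at h1
  have h2 : k * t * s ≤ k * u₀ * s :=
    mul_le_mul_of_nonneg_right (mul_le_mul_of_nonneg_left htu hk) hs.le
  nlinarith [h1, h2]

/-! ### The engine -/
/-! ### Variance glue (reshape v3): the corner stub feeds both parities -/

/-- Monotonicity helper: enlarge the constant in `x ≤ C * t ^ 2` (left). -/
private theorem le_max_mul_sq {x C C' t : ℝ} (h : x ≤ C * t ^ 2) : x ≤ max C C' * t ^ 2 :=
  h.trans (mul_le_mul_of_nonneg_right (le_max_left _ _) (sq_nonneg _))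

/-- Monotonicity helper: enlarge the constant in `x ≤ C' * t ^ 2` (right). -/
private theorem le_max_mul_sq' {x C C' t : ℝ} (h : x ≤ C' * t ^ 2) : x ≤ max C C' * t ^ 2 :=
  h.trans (mul_le_mul_of_nonneg_right (le_max_right _ _) (sq_nonneg _))

/-- **Corner ⇒ even-deep** (pure weakening: the corner ceiling holds on both parities; drop `Even L`). -/
theorem varianceEvenDeep_of_corner (r : LatticeRep G) (u : ℕ → ℝ → ℝ) (u₀ : ℝ)
    (hVC : ∃ (β₁ C' : ℝ),
            (∀ (L : ℕ) [NeZero L] (β : ℝ), β₁ ≤ β → 8 ≤ L → (L : ℝ) ^ 4 < Real.log β →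
                (∀ M : ℕ, 8 ≤ M → M ≤ L → u M β ≤ u₀) →
                ∀ (P : (Fin 4 → ZMod L) → Fin 4 → Fin 4 → GaugeConfig 4 L G → ℝ)
                  (E : (GaugeConfig 4 L G → ℝ) → ℝ),
                  (P = fun x i j U => (r.N : ℝ) - (r.ρ (plaquetteHolonomy U x i j)).trace.re) →
                  (E = fun F => wilsonExpectation r.ρ β F) →
                  E (fun U => P 0 0 1 U * P 0 0 1 U) - E (P 0 0 1) * E (P 0 0 1) ≤ C' * u 8 β ^ 2)) :
    ∃ (β₁ C' : ℝ),
            (∀ (L : ℕ) [NeZero L] (β : ℝ), β₁ ≤ β → 8 ≤ L → Even L → (L : ℝ) ^ 4 < Real.log β →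
                (∀ M : ℕ, 8 ≤ M → M ≤ L → u M β ≤ u₀) →
                ∀ (P : (Fin 4 → ZMod L) → Fin 4 → Fin 4 → GaugeConfig 4 L G → ℝ)
                  (E : (GaugeConfig 4 L G → ℝ) → ℝ),
                  (P = fun x i j U => (r.N : ℝ) - (r.ρ (plaquetteHolonomy U x i j)).trace.re) →
                  (E = fun F => wilsonExpectation r.ρ β F) →
                  E (fun U => P 0 0 1 U * P 0 0 1 U) - E (P 0 0 1) * E (P 0 0 1) ≤ C' * u 8 β ^ 2) := by
  obtain ⟨β₁, C', h⟩ := hVC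
  refine ⟨β₁, C', ?_⟩
  intro L _ β hβ hL _ hlog hwin P E hP hE
  exact h L β hβ hL hlog hwin P E hP hE

/-- **Odd-bulk + corner ⇒ odd.** The odd-torus variance ceiling in the bulk `log β ≤ L⁴` (landed
`stub_varianceCeilingOddBulk`, p161704: partial chessboard on odd tori + uniform torus doubling) and the corner ceiling
`L⁴ < log β` (the stub) give the ceiling on all odd window boxes; thresholds and constants merge by `max`. -/
theorem varianceOdd_of_bulk_corner (r : LatticeRep G) (u : ℕ → ℝ → ℝ) (u₀ : ℝ)
    (hVOb : ∃ (β₁ C' : ℝ),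
            (∀ (L : ℕ) [NeZero L] (β : ℝ), β₁ ≤ β → 8 ≤ L → Odd L → Real.log β ≤ (L : ℝ) ^ 4 →
                (∀ M : ℕ, 8 ≤ M → M ≤ L → u M β ≤ u₀) →
                ∀ (P : (Fin 4 → ZMod L) → Fin 4 → Fin 4 → GaugeConfig 4 L G → ℝ)
                  (E : (GaugeConfig 4 L G → ℝ) → ℝ),
                  (P = fun x i j U => (r.N : ℝ) - (r.ρ (plaquetteHolonomy U x i j)).trace.re) →
                  (E = fun F => wilsonExpectation r.ρ β F) →
                  E (fun U => P 0 0 1 U * P 0 0 1 U) - E (P 0 0 1) * E (P 0 0 1) ≤ C' * u 8 β ^ 2))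
    (hVC : ∃ (β₁ C' : ℝ),
            (∀ (L : ℕ) [NeZero L] (β : ℝ), β₁ ≤ β → 8 ≤ L → (L : ℝ) ^ 4 < Real.log β →
                (∀ M : ℕ, 8 ≤ M → M ≤ L → u M β ≤ u₀) →
                ∀ (P : (Fin 4 → ZMod L) → Fin 4 → Fin 4 → GaugeConfig 4 L G → ℝ)
                  (E : (GaugeConfig 4 L G → ℝ) → ℝ),
                  (P = fun x i j U => (r.N : ℝ) - (r.ρ (plaquetteHolonomy U x i j)).trace.re) →
                  (E = fun F => wilsonExpectation r.ρ β F) →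
                  E (fun U => P 0 0 1 U * P 0 0 1 U) - E (P 0 0 1) * E (P 0 0 1) ≤ C' * u 8 β ^ 2)) :
    ∃ (β₁ C' : ℝ),
            (∀ (L : ℕ) [NeZero L] (β : ℝ), β₁ ≤ β → 8 ≤ L → Odd L →
                (∀ M : ℕ, 8 ≤ M → M ≤ L → u M β ≤ u₀) →
                ∀ (P : (Fin 4 → ZMod L) → Fin 4 → Fin 4 → GaugeConfig 4 L G → ℝ)
                  (E : (GaugeConfig 4 L G → ℝ) → ℝ),
                  (P = fun x i j U => (r.N : ℝ) - (r.ρ (plaquetteHolonomy U x i j)).trace.re) →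
                  (E = fun F => wilsonExpectation r.ρ β F) →
                  E (fun U => P 0 0 1 U * P 0 0 1 U) - E (P 0 0 1) * E (P 0 0 1) ≤ C' * u 8 β ^ 2) := by
  obtain ⟨β₃, C₃, h₃⟩ := hVOb
  obtain ⟨β₄, C₄, h₄⟩ := hVC
  refine ⟨max β₃ β₄, max C₃ C₄, ?_⟩
  intro L _ β hβ hL hodd hwin P E hP hE
  have hβ₃ : β₃ ≤ β := (le_max_left _ _).trans hβ
  have hβ₄ : β₄ ≤ β := (le_max_right _ _).trans hβ
  rcases le_or_gt (Real.log β) ((L : ℝ) ^ 4) with hlog | hlog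
  · exact le_max_mul_sq (h₃ L β hβ₃ hL hodd hlog hwin P E hP hE)
  · exact le_max_mul_sq' (h₄ L β hβ₄ hL hlog hwin P E hP hE)

/-! ### The engine -/

/-- **The engine at fixed data.** For a GIVEN coupling `u` carrying the R-bundle, smearing domination, the
flowed conditional-mean floor, flowed conditional decoupling and the bounded-box clause give the transverse LOWER matching
`c'·u(8n,β)² ≤ n⁸·Cov_{L,β}(P_0^{01}, P_{ne₂}^{01})` at every interior separation `1 ≤ n ≤ L/8` of every window box. -/
theorem transverseLower_of_floor (r : LatticeRep G) (u : ℕ → ℝ → ℝ) (u₀ β₀ κ₁ κ₂ κ₃ c C c₈ : ℝ)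
    (hbody : 0 < u₀ ∧ 0 < c ∧ 0 < κ₁ ∧ 0 ≤ κ₃ ∧ 0 < c₈ ∧
               (∀ (L : ℕ) (β : ℝ), 8 ≤ L → β₀ ≤ β → 0 < u L β) ∧
               (∀ L : ℕ, 8 ≤ L → ContinuousOn (u L) (Set.Ici β₀)) ∧
               (∀ L : ℕ, 8 ≤ L → Filter.Tendsto (u L) Filter.atTop (nhds 0)) ∧
               (∀ β : ℝ, β₀ ≤ β → c₈ ≤ β * u 8 β) ∧
               (∀ (L L' : ℕ) (β : ℝ), β₀ ≤ β → 8 ≤ L → L ≤ L' → L' ≤ 2 * L →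
                   (∀ M : ℕ, 8 ≤ M → M ≤ L → u M β ≤ u₀) → |(u L β)⁻¹ - (u L' β)⁻¹| ≤ κ₂) ∧
               (∀ (k m : ℕ) (β : ℝ), β₀ ≤ β → (∀ M : ℕ, 8 ≤ M → M ≤ 8 * 2 ^ (k + m) → u M β ≤ u₀) →
                   κ₁ * m - κ₃ ≤ (u (8 * 2 ^ k) β)⁻¹ - (u (8 * 2 ^ (k + m)) β)⁻¹ ∧
                     (u (8 * 2 ^ k) β)⁻¹ - (u (8 * 2 ^ (k + m)) β)⁻¹ ≤ κ₂ * m + κ₃) ∧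
               (∀ (L : ℕ) [NeZero L] (β : ℝ), β₀ ≤ β → 8 ≤ L →
                   (∀ M : ℕ, 8 ≤ M → M ≤ L → u M β ≤ u₀) →
                   ∀ (P : (Fin 4 → ZMod L) → Fin 4 → Fin 4 → GaugeConfig 4 L G → ℝ)
                     (E : (GaugeConfig 4 L G → ℝ) → ℝ),
                     (P = fun x i j U => (r.N : ℝ) - (r.ρ (plaquetteHolonomy U x i j)).trace.re) →
                     (E = fun F => wilsonExpectation r.ρ β F) →
                     c * u L β ^ 2 ≤
                       ((L / 8 : ℕ) : ℝ) ^ 8 * (E (fun U => P 0 0 1 U * P (Pi.single (2 : Fin 4) ((L / 8 : ℕ) : ZMod L)) 0 1 U)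
                         - E (P 0 0 1) * E (P (Pi.single (2 : Fin 4) ((L / 8 : ℕ) : ZMod L)) 0 1)) ∧
                     ((L / 8 : ℕ) : ℝ) ^ 8 * (E (fun U => P 0 0 1 U * P (Pi.single (2 : Fin 4) ((L / 8 : ℕ) : ZMod L)) 0 1 U)
                       - E (P 0 0 1) * E (P (Pi.single (2 : Fin 4) ((L / 8 : ℕ) : ZMod L)) 0 1)) ≤ C * u L β ^ 2))
    (hDom : ∀ (L : ℕ) [NeZero L] (β : ℝ), 0 ≤ β → ∀ (m t : ℕ), 1 ≤ m → m ≤ L →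
                ∀ (P : (Fin 4 → ZMod L) → Fin 4 → Fin 4 → GaugeConfig 4 L G → ℝ)
                  (B : ℕ → GaugeConfig 4 L G → ℝ) (E : (GaugeConfig 4 L G → ℝ) → ℝ),
                  (P = fun x i j U => (r.N : ℝ) - (r.ρ (plaquetteHolonomy U x i j)).trace.re) →
                  (B = fun s U => (((m : ℕ) : ℝ) ^ 3)⁻¹ *
                      ∑ v : Fin (m) × Fin (m) × Fin (m),
                        P ![((v.1 : ℕ) : ZMod L), ((v.2.1 : ℕ) : ZMod L), ((s : ℕ) : ZMod L), ((v.2.2 : ℕ) : ZMod L)] 0 1 U) →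
                  (E = fun F => wilsonExpectation r.ρ β F) →
                  E (fun U => B 0 U * B t U) - E (B 0) * E (B t) ≤
                    E (fun U => P 0 0 1 U * P (Pi.single (2 : Fin 4) ((t : ℕ) : ZMod L)) 0 1 U)
                      - E (P 0 0 1) * E (P (Pi.single (2 : Fin 4) ((t : ℕ) : ZMod L)) 0 1))
    (hFlo : ∃ (c_F : ℝ) (D₁ : ℕ), 0 < c_F ∧ 1 ≤ D₁ ∧ ∀ D₀ : ℕ, D₁ ≤ D₀ → ∃ β₁ : ℝ,
              ∀ (L : ℕ) [NeZero L] (β : ℝ) (n : ℕ), β₁ ≤ β → 2 * D₀ ≤ n → 8 * n ≤ L →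
                (∀ M : ℕ, 8 ≤ M → M ≤ L → u M β ≤ u₀) →
                ∀ (P : (Fin 4 → ZMod L) → Fin 4 → Fin 4 → GaugeConfig 4 L G → ℝ)
                  (X Y : GaugeConfig 4 L G → ℝ) (μ : Measure (GaugeConfig 4 L G))
                  (mB : MeasurableSpace (GaugeConfig 4 L G)),
                  (P = fun x i j U => (r.N : ℝ) - (r.ρ (plaquetteHolonomy U x i j)).trace.re) →
                  (X = fun U => (((n / D₀ : ℕ) : ℝ) ^ 3)⁻¹ *
                      ∑ v : Fin (n / D₀) × Fin (n / D₀) × Fin (n / D₀),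
                        P ![((v.1 : ℕ) : ZMod L), ((v.2.1 : ℕ) : ZMod L), ((0 : ℕ) : ZMod L), ((v.2.2 : ℕ) : ZMod L)] 0 1 U) →
                  (Y = fun U => (((n / D₀ : ℕ) : ℝ) ^ 3)⁻¹ *
                      ∑ v : Fin (n / D₀) × Fin (n / D₀) × Fin (n / D₀),
                        P ![((v.1 : ℕ) : ZMod L), ((v.2.1 : ℕ) : ZMod L), ((n : ℕ) : ZMod L), ((v.2.2 : ℕ) : ZMod L)] 0 1 U) →
                  (μ = wilsonMeasure r.ρ β) →
                  (mB = MeasurableSpace.comap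
                (fun (U : GaugeConfig 4 L G) (e : Edge 4 (L / (n / D₀))) (i j : Fin r.N) =>
                  unevenAxialLink (n / D₀) L (L / (n / D₀))
                    (Literature.MathematicalPhysics.QuantumLattice.wilsonFlowMatrix r.ρ
                      (((n / D₀ : ℕ) : ℝ) ^ 2 / 64) U) e i j)
                inferInstance) →
                  c_F * u (8 * n) β ^ 2 ≤ (n : ℝ) ^ 8 * cov[μ[X|mB], μ[Y|mB]; μ])
    (hDec : ∀ ε : ℝ, 0 < ε → ∃ D₁ : ℕ, 1 ≤ D₁ ∧ ∀ D₀ : ℕ, D₁ ≤ D₀ → ∃ β₁ : ℝ,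
              ∀ (L : ℕ) [NeZero L] (β : ℝ) (n : ℕ), β₁ ≤ β → 2 * D₀ ≤ n → 8 * n ≤ L →
                (∀ M : ℕ, 8 ≤ M → M ≤ L → u M β ≤ u₀) →
                ∀ (P : (Fin 4 → ZMod L) → Fin 4 → Fin 4 → GaugeConfig 4 L G → ℝ)
                  (X Y : GaugeConfig 4 L G → ℝ) (μ : Measure (GaugeConfig 4 L G))
                  (mB : MeasurableSpace (GaugeConfig 4 L G)),
                  (P = fun x i j U => (r.N : ℝ) - (r.ρ (plaquetteHolonomy U x i j)).trace.re) →
                  (X = fun U => (((n / D₀ : ℕ) : ℝ) ^ 3)⁻¹ *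
                      ∑ v : Fin (n / D₀) × Fin (n / D₀) × Fin (n / D₀),
                        P ![((v.1 : ℕ) : ZMod L), ((v.2.1 : ℕ) : ZMod L), ((0 : ℕ) : ZMod L), ((v.2.2 : ℕ) : ZMod L)] 0 1 U) →
                  (Y = fun U => (((n / D₀ : ℕ) : ℝ) ^ 3)⁻¹ *
                      ∑ v : Fin (n / D₀) × Fin (n / D₀) × Fin (n / D₀),
                        P ![((v.1 : ℕ) : ZMod L), ((v.2.1 : ℕ) : ZMod L), ((n : ℕ) : ZMod L), ((v.2.2 : ℕ) : ZMod L)] 0 1 U) →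
                  (μ = wilsonMeasure r.ρ β) →
                  (mB = MeasurableSpace.comap
                (fun (U : GaugeConfig 4 L G) (e : Edge 4 (L / (n / D₀))) (i j : Fin r.N) =>
                  unevenAxialLink (n / D₀) L (L / (n / D₀))
                    (Literature.MathematicalPhysics.QuantumLattice.wilsonFlowMatrix r.ρ
                      (((n / D₀ : ℕ) : ℝ) ^ 2 / 64) U) e i j)
                inferInstance) →
                  (n : ℝ) ^ 8 * |∫ U, (X U - (μ[X|mB]) U) * (Y U - (μ[Y|mB]) U) ∂μ| ≤ ε * u (8 * n) β ^ 2)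
    (hBnd : ∀ L₀ : ℕ, ∃ (β₁ c₀ : ℝ), 0 < c₀ ∧
              (∀ (L : ℕ) [NeZero L] (β : ℝ) (n : ℕ), β₁ ≤ β → L ≤ L₀ → 1 ≤ n → 8 * n ≤ L →
                  (∀ M : ℕ, 8 ≤ M → M ≤ L → u M β ≤ u₀) →
                  ∀ (P : (Fin 4 → ZMod L) → Fin 4 → Fin 4 → GaugeConfig 4 L G → ℝ)
                    (E : (GaugeConfig 4 L G → ℝ) → ℝ),
                    (P = fun x i j U => (r.N : ℝ) - (r.ρ (plaquetteHolonomy U x i j)).trace.re) →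
                    (E = fun F => wilsonExpectation r.ρ β F) →
                    c₀ * u (8 * n) β ^ 2 ≤
                      (n : ℝ) ^ 8 * (E (fun U => P 0 0 1 U * P (Pi.single (2 : Fin 4) ((n : ℕ) : ZMod L)) 0 1 U)
                            - E (P 0 0 1) * E (P (Pi.single (2 : Fin 4) ((n : ℕ) : ZMod L)) 0 1)))) :
    ∃ (β₁ c' : ℝ), 0 < c' ∧
      (∀ (L : ℕ) [NeZero L] (β : ℝ) (n : ℕ), β₁ ≤ β → 1 ≤ n → 8 * n ≤ L →
          (∀ M : ℕ, 8 ≤ M → M ≤ L → u M β ≤ u₀) →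
          ∀ (P : (Fin 4 → ZMod L) → Fin 4 → Fin 4 → GaugeConfig 4 L G → ℝ)
            (E : (GaugeConfig 4 L G → ℝ) → ℝ),
            (P = fun x i j U => (r.N : ℝ) - (r.ρ (plaquetteHolonomy U x i j)).trace.re) →
            (E = fun F => wilsonExpectation r.ρ β F) →
            c' * u (8 * n) β ^ 2 ≤
              (n : ℝ) ^ 8 * (E (fun U => P 0 0 1 U * P (Pi.single (2 : Fin 4) ((n : ℕ) : ZMod L)) 0 1 U)
                    - E (P 0 0 1) * E (P (Pi.single (2 : Fin 4) ((n : ℕ) : ZMod L)) 0 1))) := by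
  classical
  haveI : SecondCountableTopology G :=
    Summit.QuantumFields.YangMills.Theorems.TunedSequenceExists.Negative.Freezing.secondCountable_of_latticeRep r
  obtain ⟨hu₀, -, -, -, -, hpos, -, -, -, hcomp, -, -⟩ := hbody
  -- constants of the three engine stubs
  obtain ⟨c_F, D₁, hcF, hD₁, hFlo⟩ := hFlo
  obtain ⟨D₁', -, hDec⟩ := hDec (c_F / 2) (by positivity)
  obtain ⟨D₀, hD₀⟩ : ∃ D₀ : ℕ, D₀ = max D₁ D₁' := ⟨_, rfl⟩
  have hD₀1 : 1 ≤ D₀ := hD₁.trans (hD₀ ▸ le_max_left _ _)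
  obtain ⟨β_F, hF⟩ := hFlo D₀ (hD₀ ▸ le_max_left _ _)
  obtain ⟨β_D, hD⟩ := hDec D₀ (hD₀ ▸ le_max_right _ _)
  obtain ⟨β_B, c₀, hc₀, hB⟩ := hBnd (16 * D₀)
  -- the chain-loss constant of Case C
  obtain ⟨k, hk_def⟩ : ∃ k : ℝ, k = (((8 * (2 * D₀) : ℕ) : ℕ) : ℝ) * max κ₂ 0 := ⟨_, rfl⟩
  have hk : 0 ≤ k := by rw [hk_def]; positivity
  obtain ⟨K, hK_def⟩ : ∃ K : ℝ, K = 1 + k * u₀ := ⟨_, rfl⟩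
  have hK : 0 < K := by have := mul_nonneg hk hu₀.le; rw [hK_def]; linarith
  have hK' : K ≠ 0 := hK.ne'
  have hD₀R : (0 : ℝ) < ((2 * D₀ : ℕ) : ℝ) := by exact_mod_cast (by omega : 0 < 2 * D₀)
  have hD₀R' : ((2 * D₀ : ℕ) : ℝ) ≠ 0 := hD₀R.ne'
  -- thresholds and the constant
  refine ⟨max (max β₀ 0) (max β_F (max β_D β_B)),
    min (c_F / 2) (min c₀ (c_F / 2 / (((2 * D₀ : ℕ) : ℝ) ^ 8 * K ^ 2))), ?_, ?_⟩
  · refine lt_min (by positivity) (lt_min hc₀ ?_)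
    positivity
  intro L _ β n hβ hn hnL hwin P E hP hE
  have hβ₀ : β₀ ≤ β := ((le_max_left _ _).trans (le_max_left _ _)).trans hβ
  have hβ0 : 0 ≤ β := ((le_max_right _ _).trans (le_max_left _ _)).trans hβ
  have hβF : β_F ≤ β := ((le_max_left _ _).trans (le_max_right _ _)).trans hβ
  have hβD : β_D ≤ β :=
    (((le_max_left _ _).trans (le_max_right _ _)).trans (le_max_right _ _)).trans hβ
  have hβB : β_B ≤ β :=
    (((le_max_right _ _).trans (le_max_right _ _)).trans (le_max_right _ _)).trans hβ
  -- measurability and boundedness of the plaquette field `P · 0 1`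
  have hPm : ∀ x : Fin 4 → ZMod L, Measurable fun U : GaugeConfig 4 L G => P x 0 1 U := by
    intro x; rw [hP]; exact measurable_plaqField r x 0 1
  have hPb : ∀ (x : Fin 4 → ZMod L) (U : GaugeConfig 4 L G), |P x 0 1 U| ≤ 2 * r.N := by
    intro x U; rw [hP]; exact abs_plaqField_le r x 0 1 U
  have hu2 : 0 ≤ u (8 * n) β ^ 2 := sq_nonneg _
  -- Wilson's measure on the box `L` is a probability measure
  obtain ⟨μ, hμ⟩ : ∃ μ : Measure (GaugeConfig 4 L G), μ = wilsonMeasure r.ρ β := ⟨_, rfl⟩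
  haveI hprob : IsProbabilityMeasure μ := by
    rw [hμ]; exact isProbabilityMeasure_wilsonMeasure (d := 4) (L := L) r.ρ r.continuous β
  have hEμ : ∀ F : GaugeConfig 4 L G → ℝ, E F = ∫ U, F U ∂μ := by
    intro F; rw [hE, hμ]; rfl
  /- CASE A (the engine proper), stated for every separation `m ≥ 2D₀`: smearing domination + law of total
  covariance + conditional-mean floor + conditional decoupling ⇒ `c_F/2 · u(8m,β)² ≤ m⁸ · Cov_{L,β}(P_0, P_{m e₂})`. -/
  have caseA : ∀ m : ℕ, 2 * D₀ ≤ m → 8 * m ≤ L →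
      c_F / 2 * u (8 * m) β ^ 2 ≤
        (m : ℝ) ^ 8 * (E (fun U => P 0 0 1 U * P (Pi.single (2 : Fin 4) ((m : ℕ) : ZMod L)) 0 1 U)
          - E (P 0 0 1) * E (P (Pi.single (2 : Fin 4) ((m : ℕ) : ZMod L)) 0 1)) := by
    intro m hm hmL
    -- conditioning factor `m / D₀ ≥ 2 ≥ 1`
    have hb1 : 1 ≤ m / D₀ := (Nat.le_div_iff_mul_le (by omega)).2 (by omega)
    have hbL : m / D₀ ≤ L := (Nat.div_le_self m D₀).trans (by omega)
    -- the two block observables (side `m / D₀`, at `e₂`-times `0` and `m`)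
    obtain ⟨X, hX⟩ : ∃ X : GaugeConfig 4 L G → ℝ, X = fun U => (((m / D₀ : ℕ) : ℝ) ^ 3)⁻¹ *
        ∑ v : Fin (m / D₀) × Fin (m / D₀) × Fin (m / D₀),
          P ![((v.1 : ℕ) : ZMod L), ((v.2.1 : ℕ) : ZMod L), ((0 : ℕ) : ZMod L), ((v.2.2 : ℕ) : ZMod L)] 0 1 U :=
      ⟨_, rfl⟩
    obtain ⟨Y, hY⟩ : ∃ Y : GaugeConfig 4 L G → ℝ, Y = fun U => (((m / D₀ : ℕ) : ℝ) ^ 3)⁻¹ *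
        ∑ v : Fin (m / D₀) × Fin (m / D₀) × Fin (m / D₀),
          P ![((v.1 : ℕ) : ZMod L), ((v.2.1 : ℕ) : ZMod L), ((m : ℕ) : ZMod L), ((v.2.2 : ℕ) : ZMod L)] 0 1 U :=
      ⟨_, rfl⟩
    have hXm : MemLp X 2 μ := by
      rw [hX]
      exact memLp_const_mul_sum (fun (v : Fin (m / D₀) × Fin (m / D₀) × Fin (m / D₀))
          (U : GaugeConfig 4 L G) =>
          P ![((v.1 : ℕ) : ZMod L), ((v.2.1 : ℕ) : ZMod L), ((0 : ℕ) : ZMod L), ((v.2.2 : ℕ) : ZMod L)] 0 1 U)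
        _ (2 * r.N) 2 (fun v => hPm _) (fun v U => hPb _ U)
    have hYm : MemLp Y 2 μ := by
      rw [hY]
      exact memLp_const_mul_sum (fun (v : Fin (m / D₀) × Fin (m / D₀) × Fin (m / D₀))
          (U : GaugeConfig 4 L G) =>
          P ![((v.1 : ℕ) : ZMod L), ((v.2.1 : ℕ) : ZMod L), ((m : ℕ) : ZMod L), ((v.2.2 : ℕ) : ZMod L)] 0 1 U)
        _ (2 * r.N) 2 (fun v => hPm _) (fun v U => hPb _ U)
    -- smearing domination at this separation
    have hDom' : E (fun U => X U * Y U) - E X * E Y ≤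
        E (fun U => P 0 0 1 U * P (Pi.single (2 : Fin 4) ((m : ℕ) : ZMod L)) 0 1 U)
          - E (P 0 0 1) * E (P (Pi.single (2 : Fin 4) ((m : ℕ) : ZMod L)) 0 1) := by
      rw [hX, hY]
      exact hDom L β hβ0 (m / D₀) m hb1 hbL P
        (fun s U => (((m / D₀ : ℕ) : ℝ) ^ 3)⁻¹ *
          ∑ v : Fin (m / D₀) × Fin (m / D₀) × Fin (m / D₀),
            P ![((v.1 : ℕ) : ZMod L), ((v.2.1 : ℕ) : ZMod L), ((s : ℕ) : ZMod L), ((v.2.2 : ℕ) : ZMod L)] 0 1 U)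
        E hP rfl hE
    -- the identification of the covariance of the block observables
    have hcovXY : cov[X, Y; μ] = E (fun U => X U * Y U) - E X * E Y := by
      rw [covariance_eq_sub hXm hYm, hEμ, hEμ, hEμ]
      rfl
    /- The conditioning σ-algebra (PINNED, reshape v2: Wilson flow at time `b²/64` (`b = m / D₀`, smoothing radius `b/√8`), THEN the
    uneven axial blocking of factor `b` onto the coarse torus of side `L / b`) is a sub-σ-algebra of the product
    σ-algebra. It is never introduced as a local constant (a local `MeasurableSpace` would shadow the product instance). -/
    have hm_le : MeasurableSpace.comap
          (fun (U : GaugeConfig 4 L G) (e : Edge 4 (L / (m / D₀))) (i j : Fin r.N) =>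
            unevenAxialLink (m / D₀) L (L / (m / D₀))
              (Literature.MathematicalPhysics.QuantumLattice.wilsonFlowMatrix r.ρ (((m / D₀ : ℕ) : ℝ) ^ 2 / 64) U) e i j)
          inferInstance ≤ (inferInstance : MeasurableSpace (GaugeConfig 4 L G)) :=
      comap_flowDecimate_le r (m / D₀) L (L / (m / D₀)) _
    -- the two conditional inputs at this separation (the σ-algebra argument is inferred from `rfl`)
    have hFlo' := hF L β m hβF hm hmL hwin P X Y μ _ hP hX hY hμ rfl
    have hDec' := hD L β m hβD hm hmL hwin P X Y μ _ hP hX hY hμ rfl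
    -- the law of total covariance (landed identity)
    have htot := Literature.Probability.Moments.integral_residual_mul_add_covariance_condExp hm_le hXm hYm
    -- arithmetic: `m⁸·cov[X,Y] = m⁸·(residual) + m⁸·cov[cond. means] ≥ -(c_F/2)u² + c_F u²`
    have h8 : (0 : ℝ) ≤ (m : ℝ) ^ 8 := by positivity
    have key : c_F / 2 * u (8 * m) β ^ 2 ≤ (m : ℝ) ^ 8 * cov[X, Y; μ] := by
      rw [← htot, mul_add]
      nlinarith [hFlo', hDec', neg_abs_le (∫ U, (X U -
        (μ[X|MeasurableSpace.comap
          (fun (U : GaugeConfig 4 L G) (e : Edge 4 (L / (m / D₀))) (i j : Fin r.N) =>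
            unevenAxialLink (m / D₀) L (L / (m / D₀))
              (Literature.MathematicalPhysics.QuantumLattice.wilsonFlowMatrix r.ρ (((m / D₀ : ℕ) : ℝ) ^ 2 / 64) U) e i j)
          inferInstance]) U) *
        (Y U - (μ[Y|MeasurableSpace.comap
          (fun (U : GaugeConfig 4 L G) (e : Edge 4 (L / (m / D₀))) (i j : Fin r.N) =>
            unevenAxialLink (m / D₀) L (L / (m / D₀))
              (Literature.MathematicalPhysics.QuantumLattice.wilsonFlowMatrix r.ρ (((m / D₀ : ℕ) : ℝ) ^ 2 / 64) U) e i j)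
          inferInstance]) U) ∂μ),
        h8]
    rw [hcovXY] at key
    exact key.trans (mul_le_mul_of_nonneg_left hDom' h8)
  -- dispatch on the separation and on the box
  by_cases hnD : 2 * D₀ ≤ n
  · -- CASE A
    have hA := caseA n hnD hnL
    calc min (c_F / 2) (min c₀ (c_F / 2 / (((2 * D₀ : ℕ) : ℝ) ^ 8 * K ^ 2))) * u (8 * n) β ^ 2
        ≤ c_F / 2 * u (8 * n) β ^ 2 := mul_le_mul_of_nonneg_right (min_le_left _ _) hu2
      _ ≤ _ := hA
  · have hnD' : n < 2 * D₀ := not_le.mp hnD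
    by_cases hL : 16 * D₀ ≤ L
    · /- CASE C: `n < 2D₀`, `16 D₀ ≤ L`. Reflection-positivity antitonicity (landed) moves the separation up to
      `2D₀`, CASE A applies there, and in-window comparability chained over the boxes `8n → 16D₀` compares
      `u(8n,β)` with `u(16D₀,β)`. -/
      have hA := caseA (2 * D₀) le_rfl (by omega)
      have hanti : E (fun U => P 0 0 1 U * P (Pi.single (2 : Fin 4) ((2 * D₀ : ℕ) : ZMod L)) 0 1 U)
            - E (P 0 0 1) * E (P (Pi.single (2 : Fin 4) ((2 * D₀ : ℕ) : ZMod L)) 0 1) ≤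
          E (fun U => P 0 0 1 U * P (Pi.single (2 : Fin 4) ((n : ℕ) : ZMod L)) 0 1 U)
            - E (P 0 0 1) * E (P (Pi.single (2 : Fin 4) ((n : ℕ) : ZMod L)) 0 1) := by
        subst hP hE
        exact Summit.QuantumFields.YangMills.Theorems.FemtoCurvatureTwoPoint.stub_axisProfileAntitone
          L r.N G r.ρ r.continuous β hβ0 n (2 * D₀) hnD'.le (by omega)
      -- the comparability chain `8n → 16D₀`
      have hun : 0 < u (8 * n) β := hpos (8 * n) β (by omega) hβ₀
      have huD : 0 < u (8 * (2 * D₀)) β := hpos (8 * (2 * D₀)) β (by omega) hβ₀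
      have hun₀ : u (8 * n) β ≤ u₀ := hwin (8 * n) (by omega) (by omega)
      have hchain : (u (8 * (2 * D₀)) β)⁻¹ ≤ (u (8 * n) β)⁻¹ + k := by
        have h := chain_bound_end (f := fun M => (u M β)⁻¹) (κ := max κ₂ 0) (a := 8 * n) (T := 8 * (2 * D₀))
          (by omega) (by omega) (by
            intro M M' haM hMM' hM'2 hM'T
            have hc := hcomp M M' β hβ₀ (by omega) hMM' hM'2
              (fun M'' h8 hM'' => hwin M'' h8 (by omega))
            have : (u M' β)⁻¹ - (u M β)⁻¹ ≤ κ₂ := by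
              rw [abs_sub_comm] at hc
              exact (le_abs_self _).trans hc
            linarith [le_max_left κ₂ 0])
        rw [hk_def]
        simpa using h
      have hcmp : u (8 * n) β ≤ K * u (8 * (2 * D₀)) β := by
        rw [hK_def]; exact le_mul_of_inv_le_inv_add huD hun hk hun₀ hchain
      have hsq : u (8 * n) β ^ 2 ≤ K ^ 2 * u (8 * (2 * D₀)) β ^ 2 := by
        have := mul_self_le_mul_self hun.le hcmp
        nlinarith [this]
      -- `Cov_L(n) ≥ Cov_L(2D₀) ≥ (c_F/2) u(16D₀)² / (2D₀)⁸ ≥ 0`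
      have hcovD : c_F / 2 * u (8 * (2 * D₀)) β ^ 2 / ((2 * D₀ : ℕ) : ℝ) ^ 8 ≤
          E (fun U => P 0 0 1 U * P (Pi.single (2 : Fin 4) ((2 * D₀ : ℕ) : ZMod L)) 0 1 U)
            - E (P 0 0 1) * E (P (Pi.single (2 : Fin 4) ((2 * D₀ : ℕ) : ZMod L)) 0 1) := by
        rw [div_le_iff₀ (by positivity)]
        linarith [hA]
      have hcovn_nonneg : 0 ≤ E (fun U => P 0 0 1 U * P (Pi.single (2 : Fin 4) ((n : ℕ) : ZMod L)) 0 1 U)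
            - E (P 0 0 1) * E (P (Pi.single (2 : Fin 4) ((n : ℕ) : ZMod L)) 0 1) := by
        have : 0 ≤ c_F / 2 * u (8 * (2 * D₀)) β ^ 2 / ((2 * D₀ : ℕ) : ℝ) ^ 8 := by positivity
        linarith
      have hn8 : (1 : ℝ) ≤ (n : ℝ) ^ 8 := one_le_pow₀ (by exact_mod_cast hn)
      calc min (c_F / 2) (min c₀ (c_F / 2 / (((2 * D₀ : ℕ) : ℝ) ^ 8 * K ^ 2))) * u (8 * n) β ^ 2
          ≤ c_F / 2 / (((2 * D₀ : ℕ) : ℝ) ^ 8 * K ^ 2) * u (8 * n) β ^ 2 :=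
            mul_le_mul_of_nonneg_right ((min_le_right _ _).trans (min_le_right _ _)) hu2
        _ ≤ c_F / 2 / (((2 * D₀ : ℕ) : ℝ) ^ 8 * K ^ 2) * (K ^ 2 * u (8 * (2 * D₀)) β ^ 2) :=
            mul_le_mul_of_nonneg_left hsq (by positivity)
        _ = c_F / 2 * u (8 * (2 * D₀)) β ^ 2 / ((2 * D₀ : ℕ) : ℝ) ^ 8 := by
            field_simp
        _ ≤ E (fun U => P 0 0 1 U * P (Pi.single (2 : Fin 4) ((n : ℕ) : ZMod L)) 0 1 U)
              - E (P 0 0 1) * E (P (Pi.single (2 : Fin 4) ((n : ℕ) : ZMod L)) 0 1) := hcovD.trans hanti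
        _ = 1 * (E (fun U => P 0 0 1 U * P (Pi.single (2 : Fin 4) ((n : ℕ) : ZMod L)) 0 1 U)
              - E (P 0 0 1) * E (P (Pi.single (2 : Fin 4) ((n : ℕ) : ZMod L)) 0 1)) := (one_mul _).symm
        _ ≤ (n : ℝ) ^ 8 * (E (fun U => P 0 0 1 U * P (Pi.single (2 : Fin 4) ((n : ℕ) : ZMod L)) 0 1 U)
              - E (P 0 0 1) * E (P (Pi.single (2 : Fin 4) ((n : ℕ) : ZMod L)) 0 1)) :=
            mul_le_mul_of_nonneg_right hn8 hcovn_nonneg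
    · /- CASE B: `n < 2D₀`, `L < 16 D₀` — a bounded box: the bounded-box clause. -/
      have hL' : L ≤ 16 * D₀ := (not_le.mp hL).le
      have hBn := hB L β n hβB hL' hn hnL hwin P E hP hE
      calc min (c_F / 2) (min c₀ (c_F / 2 / (((2 * D₀ : ℕ) : ℝ) ^ 8 * K ^ 2))) * u (8 * n) β ^ 2
          ≤ c₀ * u (8 * n) β ^ 2 :=
            mul_le_mul_of_nonneg_right ((min_le_right _ _).trans (min_le_left _ _)) hu2
        _ ≤ _ := hBn

/-- **R ∧ TU ∧ LU ∧ V-corner ∧ Dom ∧ Flo′ ∧ Dec′ ∧ NN at fixed data ⇒ `AFProfilesCoreAt r`** (reshape v3). Take R's coupling `u`;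
the landed bridge `upperChannels_of_parts` (p158109) turns TU, LU and the deep/odd variance pieces into the three upper clauses
(even bulk/mid boxes: landed p150733/p155166; odd bulk boxes: landed p161704; both parities' deep corner: the stub), the landed bridge `boundedBoxes_of_nearestNeighbourFloor`
(p158015) turns NN into the bounded-box clause, and `transverseLower_of_floor` gives the lower transverse clause; thresholds
merge by `max`. -/
theorem afProfilesCoreAt_of_floor (hG : IsCompactSimpleLieGroup G) (r : LatticeRep G)
    (hR : ∃ (u : ℕ → ℝ → ℝ) (u₀ β₀ κ₁ κ₂ κ₃ c C c₈ : ℝ),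
            (0 < u₀ ∧ 0 < c ∧ 0 < κ₁ ∧ 0 ≤ κ₃ ∧ 0 < c₈ ∧
              (∀ (L : ℕ) (β : ℝ), 8 ≤ L → β₀ ≤ β → 0 < u L β) ∧
              (∀ L : ℕ, 8 ≤ L → ContinuousOn (u L) (Set.Ici β₀)) ∧
              (∀ L : ℕ, 8 ≤ L → Filter.Tendsto (u L) Filter.atTop (nhds 0)) ∧
              (∀ β : ℝ, β₀ ≤ β → c₈ ≤ β * u 8 β) ∧
              (∀ (L L' : ℕ) (β : ℝ), β₀ ≤ β → 8 ≤ L → L ≤ L' → L' ≤ 2 * L →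
                  (∀ M : ℕ, 8 ≤ M → M ≤ L → u M β ≤ u₀) → |(u L β)⁻¹ - (u L' β)⁻¹| ≤ κ₂) ∧
              (∀ (k m : ℕ) (β : ℝ), β₀ ≤ β → (∀ M : ℕ, 8 ≤ M → M ≤ 8 * 2 ^ (k + m) → u M β ≤ u₀) →
                  κ₁ * m - κ₃ ≤ (u (8 * 2 ^ k) β)⁻¹ - (u (8 * 2 ^ (k + m)) β)⁻¹ ∧
                    (u (8 * 2 ^ k) β)⁻¹ - (u (8 * 2 ^ (k + m)) β)⁻¹ ≤ κ₂ * m + κ₃) ∧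
              (∀ (L : ℕ) [NeZero L] (β : ℝ), β₀ ≤ β → 8 ≤ L →
                  (∀ M : ℕ, 8 ≤ M → M ≤ L → u M β ≤ u₀) →
                  ∀ (P : (Fin 4 → ZMod L) → Fin 4 → Fin 4 → GaugeConfig 4 L G → ℝ)
                    (E : (GaugeConfig 4 L G → ℝ) → ℝ),
                    (P = fun x i j U => (r.N : ℝ) - (r.ρ (plaquetteHolonomy U x i j)).trace.re) →
                    (E = fun F => wilsonExpectation r.ρ β F) →
                    c * u L β ^ 2 ≤
                      ((L / 8 : ℕ) : ℝ) ^ 8 * (E (fun U => P 0 0 1 U * P (Pi.single (2 : Fin 4) ((L / 8 : ℕ) : ZMod L)) 0 1 U)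
                        - E (P 0 0 1) * E (P (Pi.single (2 : Fin 4) ((L / 8 : ℕ) : ZMod L)) 0 1)) ∧
                    ((L / 8 : ℕ) : ℝ) ^ 8 * (E (fun U => P 0 0 1 U * P (Pi.single (2 : Fin 4) ((L / 8 : ℕ) : ZMod L)) 0 1 U)
                      - E (P 0 0 1) * E (P (Pi.single (2 : Fin 4) ((L / 8 : ℕ) : ZMod L)) 0 1)) ≤ C * u L β ^ 2)))
    (hTU : ∀ (u : ℕ → ℝ → ℝ) (u₀ β₀ κ₁ κ₂ κ₃ c C c₈ : ℝ),
             (0 < u₀ ∧ 0 < c ∧ 0 < κ₁ ∧ 0 ≤ κ₃ ∧ 0 < c₈ ∧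
               (∀ (L : ℕ) (β : ℝ), 8 ≤ L → β₀ ≤ β → 0 < u L β) ∧
               (∀ L : ℕ, 8 ≤ L → ContinuousOn (u L) (Set.Ici β₀)) ∧
               (∀ L : ℕ, 8 ≤ L → Filter.Tendsto (u L) Filter.atTop (nhds 0)) ∧
               (∀ β : ℝ, β₀ ≤ β → c₈ ≤ β * u 8 β) ∧
               (∀ (L L' : ℕ) (β : ℝ), β₀ ≤ β → 8 ≤ L → L ≤ L' → L' ≤ 2 * L →
                   (∀ M : ℕ, 8 ≤ M → M ≤ L → u M β ≤ u₀) → |(u L β)⁻¹ - (u L' β)⁻¹| ≤ κ₂) ∧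
               (∀ (k m : ℕ) (β : ℝ), β₀ ≤ β → (∀ M : ℕ, 8 ≤ M → M ≤ 8 * 2 ^ (k + m) → u M β ≤ u₀) →
                   κ₁ * m - κ₃ ≤ (u (8 * 2 ^ k) β)⁻¹ - (u (8 * 2 ^ (k + m)) β)⁻¹ ∧
                     (u (8 * 2 ^ k) β)⁻¹ - (u (8 * 2 ^ (k + m)) β)⁻¹ ≤ κ₂ * m + κ₃) ∧
               (∀ (L : ℕ) [NeZero L] (β : ℝ), β₀ ≤ β → 8 ≤ L →
                   (∀ M : ℕ, 8 ≤ M → M ≤ L → u M β ≤ u₀) →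
                   ∀ (P : (Fin 4 → ZMod L) → Fin 4 → Fin 4 → GaugeConfig 4 L G → ℝ)
                     (E : (GaugeConfig 4 L G → ℝ) → ℝ),
                     (P = fun x i j U => (r.N : ℝ) - (r.ρ (plaquetteHolonomy U x i j)).trace.re) →
                     (E = fun F => wilsonExpectation r.ρ β F) →
                     c * u L β ^ 2 ≤
                       ((L / 8 : ℕ) : ℝ) ^ 8 * (E (fun U => P 0 0 1 U * P (Pi.single (2 : Fin 4) ((L / 8 : ℕ) : ZMod L)) 0 1 U)
                         - E (P 0 0 1) * E (P (Pi.single (2 : Fin 4) ((L / 8 : ℕ) : ZMod L)) 0 1)) ∧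
                     ((L / 8 : ℕ) : ℝ) ^ 8 * (E (fun U => P 0 0 1 U * P (Pi.single (2 : Fin 4) ((L / 8 : ℕ) : ZMod L)) 0 1 U)
                       - E (P 0 0 1) * E (P (Pi.single (2 : Fin 4) ((L / 8 : ℕ) : ZMod L)) 0 1)) ≤ C * u L β ^ 2)) →
             ∃ (β₁ C' : ℝ),
             (∀ (L : ℕ) [NeZero L] (β : ℝ) (s : ℕ), β₁ ≤ β → 8 ≤ L → 1 ≤ s → 8 * s ≤ L →
                 (∀ M : ℕ, 8 ≤ M → M ≤ L → u M β ≤ u₀) →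
                 ∀ (P : (Fin 4 → ZMod L) → Fin 4 → Fin 4 → GaugeConfig 4 L G → ℝ)
                   (E : (GaugeConfig 4 L G → ℝ) → ℝ),
                   (P = fun x i j U => (r.N : ℝ) - (r.ρ (plaquetteHolonomy U x i j)).trace.re) →
                   (E = fun F => wilsonExpectation r.ρ β F) →
                   (s : ℝ) ^ 8 * (E (fun U => P 0 0 1 U * P (Pi.single (2 : Fin 4) ((s : ℕ) : ZMod L)) 0 1 U)
                         - E (P 0 0 1) * E (P (Pi.single (2 : Fin 4) ((s : ℕ) : ZMod L)) 0 1)) ≤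
                     C' * u (8 * s) β ^ 2))
    (hLU : ∀ (u : ℕ → ℝ → ℝ) (u₀ β₀ κ₁ κ₂ κ₃ c C c₈ : ℝ),
             (0 < u₀ ∧ 0 < c ∧ 0 < κ₁ ∧ 0 ≤ κ₃ ∧ 0 < c₈ ∧
               (∀ (L : ℕ) (β : ℝ), 8 ≤ L → β₀ ≤ β → 0 < u L β) ∧
               (∀ L : ℕ, 8 ≤ L → ContinuousOn (u L) (Set.Ici β₀)) ∧
               (∀ L : ℕ, 8 ≤ L → Filter.Tendsto (u L) Filter.atTop (nhds 0)) ∧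
               (∀ β : ℝ, β₀ ≤ β → c₈ ≤ β * u 8 β) ∧
               (∀ (L L' : ℕ) (β : ℝ), β₀ ≤ β → 8 ≤ L → L ≤ L' → L' ≤ 2 * L →
                   (∀ M : ℕ, 8 ≤ M → M ≤ L → u M β ≤ u₀) → |(u L β)⁻¹ - (u L' β)⁻¹| ≤ κ₂) ∧
               (∀ (k m : ℕ) (β : ℝ), β₀ ≤ β → (∀ M : ℕ, 8 ≤ M → M ≤ 8 * 2 ^ (k + m) → u M β ≤ u₀) →
                   κ₁ * m - κ₃ ≤ (u (8 * 2 ^ k) β)⁻¹ - (u (8 * 2 ^ (k + m)) β)⁻¹ ∧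
                     (u (8 * 2 ^ k) β)⁻¹ - (u (8 * 2 ^ (k + m)) β)⁻¹ ≤ κ₂ * m + κ₃) ∧
               (∀ (L : ℕ) [NeZero L] (β : ℝ), β₀ ≤ β → 8 ≤ L →
                   (∀ M : ℕ, 8 ≤ M → M ≤ L → u M β ≤ u₀) →
                   ∀ (P : (Fin 4 → ZMod L) → Fin 4 → Fin 4 → GaugeConfig 4 L G → ℝ)
                     (E : (GaugeConfig 4 L G → ℝ) → ℝ),
                     (P = fun x i j U => (r.N : ℝ) - (r.ρ (plaquetteHolonomy U x i j)).trace.re) →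
                     (E = fun F => wilsonExpectation r.ρ β F) →
                     c * u L β ^ 2 ≤
                       ((L / 8 : ℕ) : ℝ) ^ 8 * (E (fun U => P 0 0 1 U * P (Pi.single (2 : Fin 4) ((L / 8 : ℕ) : ZMod L)) 0 1 U)
                         - E (P 0 0 1) * E (P (Pi.single (2 : Fin 4) ((L / 8 : ℕ) : ZMod L)) 0 1)) ∧
                     ((L / 8 : ℕ) : ℝ) ^ 8 * (E (fun U => P 0 0 1 U * P (Pi.single (2 : Fin 4) ((L / 8 : ℕ) : ZMod L)) 0 1 U)
                       - E (P 0 0 1) * E (P (Pi.single (2 : Fin 4) ((L / 8 : ℕ) : ZMod L)) 0 1)) ≤ C * u L β ^ 2)) →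
             ∃ (β₁ C' : ℝ),
             (∀ (L : ℕ) [NeZero L] (β : ℝ) (s : ℕ), β₁ ≤ β → 8 ≤ L → 1 ≤ s → 8 * s ≤ L →
                 (∀ M : ℕ, 8 ≤ M → M ≤ L → u M β ≤ u₀) →
                 ∀ (P : (Fin 4 → ZMod L) → Fin 4 → Fin 4 → GaugeConfig 4 L G → ℝ)
                   (E : (GaugeConfig 4 L G → ℝ) → ℝ),
                   (P = fun x i j U => (r.N : ℝ) - (r.ρ (plaquetteHolonomy U x i j)).trace.re) →
                   (E = fun F => wilsonExpectation r.ρ β F) →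
                   (s : ℝ) ^ 8 * |E (fun U => P 0 0 1 U * P (Pi.single (0 : Fin 4) ((s : ℕ) : ZMod L)) 0 1 U)
                       - E (P 0 0 1) * E (P (Pi.single (0 : Fin 4) ((s : ℕ) : ZMod L)) 0 1)| ≤
                     C' * u (8 * s) β ^ 2))
    (hV : ∀ (u : ℕ → ℝ → ℝ) (u₀ β₀ κ₁ κ₂ κ₃ c C c₈ : ℝ),
             (0 < u₀ ∧ 0 < c ∧ 0 < κ₁ ∧ 0 ≤ κ₃ ∧ 0 < c₈ ∧
               (∀ (L : ℕ) (β : ℝ), 8 ≤ L → β₀ ≤ β → 0 < u L β) ∧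
               (∀ L : ℕ, 8 ≤ L → ContinuousOn (u L) (Set.Ici β₀)) ∧
               (∀ L : ℕ, 8 ≤ L → Filter.Tendsto (u L) Filter.atTop (nhds 0)) ∧
               (∀ β : ℝ, β₀ ≤ β → c₈ ≤ β * u 8 β) ∧
               (∀ (L L' : ℕ) (β : ℝ), β₀ ≤ β → 8 ≤ L → L ≤ L' → L' ≤ 2 * L →
                   (∀ M : ℕ, 8 ≤ M → M ≤ L → u M β ≤ u₀) → |(u L β)⁻¹ - (u L' β)⁻¹| ≤ κ₂) ∧
               (∀ (k m : ℕ) (β : ℝ), β₀ ≤ β → (∀ M : ℕ, 8 ≤ M → M ≤ 8 * 2 ^ (k + m) → u M β ≤ u₀) →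
                   κ₁ * m - κ₃ ≤ (u (8 * 2 ^ k) β)⁻¹ - (u (8 * 2 ^ (k + m)) β)⁻¹ ∧
                     (u (8 * 2 ^ k) β)⁻¹ - (u (8 * 2 ^ (k + m)) β)⁻¹ ≤ κ₂ * m + κ₃) ∧
               (∀ (L : ℕ) [NeZero L] (β : ℝ), β₀ ≤ β → 8 ≤ L →
                   (∀ M : ℕ, 8 ≤ M → M ≤ L → u M β ≤ u₀) →
                   ∀ (P : (Fin 4 → ZMod L) → Fin 4 → Fin 4 → GaugeConfig 4 L G → ℝ)
                     (E : (GaugeConfig 4 L G → ℝ) → ℝ),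
                     (P = fun x i j U => (r.N : ℝ) - (r.ρ (plaquetteHolonomy U x i j)).trace.re) →
                     (E = fun F => wilsonExpectation r.ρ β F) →
                     c * u L β ^ 2 ≤
                       ((L / 8 : ℕ) : ℝ) ^ 8 * (E (fun U => P 0 0 1 U * P (Pi.single (2 : Fin 4) ((L / 8 : ℕ) : ZMod L)) 0 1 U)
                         - E (P 0 0 1) * E (P (Pi.single (2 : Fin 4) ((L / 8 : ℕ) : ZMod L)) 0 1)) ∧
                     ((L / 8 : ℕ) : ℝ) ^ 8 * (E (fun U => P 0 0 1 U * P (Pi.single (2 : Fin 4) ((L / 8 : ℕ) : ZMod L)) 0 1 U)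
                       - E (P 0 0 1) * E (P (Pi.single (2 : Fin 4) ((L / 8 : ℕ) : ZMod L)) 0 1)) ≤ C * u L β ^ 2)) →
             ∃ (β₁ C' : ℝ),
             (∀ (L : ℕ) [NeZero L] (β : ℝ), β₁ ≤ β → 8 ≤ L → (L : ℝ) ^ 4 < Real.log β →
                 (∀ M : ℕ, 8 ≤ M → M ≤ L → u M β ≤ u₀) →
                 ∀ (P : (Fin 4 → ZMod L) → Fin 4 → Fin 4 → GaugeConfig 4 L G → ℝ)
                   (E : (GaugeConfig 4 L G → ℝ) → ℝ),
                   (P = fun x i j U => (r.N : ℝ) - (r.ρ (plaquetteHolonomy U x i j)).trace.re) →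
                   (E = fun F => wilsonExpectation r.ρ β F) →
                   E (fun U => P 0 0 1 U * P 0 0 1 U) - E (P 0 0 1) * E (P 0 0 1) ≤ C' * u 8 β ^ 2))
    (hDom : ∀ (L : ℕ) [NeZero L] (β : ℝ), 0 ≤ β → ∀ (m t : ℕ), 1 ≤ m → m ≤ L →
                ∀ (P : (Fin 4 → ZMod L) → Fin 4 → Fin 4 → GaugeConfig 4 L G → ℝ)
                  (B : ℕ → GaugeConfig 4 L G → ℝ) (E : (GaugeConfig 4 L G → ℝ) → ℝ),
                  (P = fun x i j U => (r.N : ℝ) - (r.ρ (plaquetteHolonomy U x i j)).trace.re) →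
                  (B = fun s U => (((m : ℕ) : ℝ) ^ 3)⁻¹ *
                      ∑ v : Fin (m) × Fin (m) × Fin (m),
                        P ![((v.1 : ℕ) : ZMod L), ((v.2.1 : ℕ) : ZMod L), ((s : ℕ) : ZMod L), ((v.2.2 : ℕ) : ZMod L)] 0 1 U) →
                  (E = fun F => wilsonExpectation r.ρ β F) →
                  E (fun U => B 0 U * B t U) - E (B 0) * E (B t) ≤
                    E (fun U => P 0 0 1 U * P (Pi.single (2 : Fin 4) ((t : ℕ) : ZMod L)) 0 1 U)
                      - E (P 0 0 1) * E (P (Pi.single (2 : Fin 4) ((t : ℕ) : ZMod L)) 0 1))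
    (hFlo : ∀ (u : ℕ → ℝ → ℝ) (u₀ β₀ κ₁ κ₂ κ₃ c C c₈ : ℝ),
             (0 < u₀ ∧ 0 < c ∧ 0 < κ₁ ∧ 0 ≤ κ₃ ∧ 0 < c₈ ∧
               (∀ (L : ℕ) (β : ℝ), 8 ≤ L → β₀ ≤ β → 0 < u L β) ∧
               (∀ L : ℕ, 8 ≤ L → ContinuousOn (u L) (Set.Ici β₀)) ∧
               (∀ L : ℕ, 8 ≤ L → Filter.Tendsto (u L) Filter.atTop (nhds 0)) ∧
               (∀ β : ℝ, β₀ ≤ β → c₈ ≤ β * u 8 β) ∧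
               (∀ (L L' : ℕ) (β : ℝ), β₀ ≤ β → 8 ≤ L → L ≤ L' → L' ≤ 2 * L →
                   (∀ M : ℕ, 8 ≤ M → M ≤ L → u M β ≤ u₀) → |(u L β)⁻¹ - (u L' β)⁻¹| ≤ κ₂) ∧
               (∀ (k m : ℕ) (β : ℝ), β₀ ≤ β → (∀ M : ℕ, 8 ≤ M → M ≤ 8 * 2 ^ (k + m) → u M β ≤ u₀) →
                   κ₁ * m - κ₃ ≤ (u (8 * 2 ^ k) β)⁻¹ - (u (8 * 2 ^ (k + m)) β)⁻¹ ∧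
                     (u (8 * 2 ^ k) β)⁻¹ - (u (8 * 2 ^ (k + m)) β)⁻¹ ≤ κ₂ * m + κ₃) ∧
               (∀ (L : ℕ) [NeZero L] (β : ℝ), β₀ ≤ β → 8 ≤ L →
                   (∀ M : ℕ, 8 ≤ M → M ≤ L → u M β ≤ u₀) →
                   ∀ (P : (Fin 4 → ZMod L) → Fin 4 → Fin 4 → GaugeConfig 4 L G → ℝ)
                     (E : (GaugeConfig 4 L G → ℝ) → ℝ),
                     (P = fun x i j U => (r.N : ℝ) - (r.ρ (plaquetteHolonomy U x i j)).trace.re) →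
                     (E = fun F => wilsonExpectation r.ρ β F) →
                     c * u L β ^ 2 ≤
                       ((L / 8 : ℕ) : ℝ) ^ 8 * (E (fun U => P 0 0 1 U * P (Pi.single (2 : Fin 4) ((L / 8 : ℕ) : ZMod L)) 0 1 U)
                         - E (P 0 0 1) * E (P (Pi.single (2 : Fin 4) ((L / 8 : ℕ) : ZMod L)) 0 1)) ∧
                     ((L / 8 : ℕ) : ℝ) ^ 8 * (E (fun U => P 0 0 1 U * P (Pi.single (2 : Fin 4) ((L / 8 : ℕ) : ZMod L)) 0 1 U)
                       - E (P 0 0 1) * E (P (Pi.single (2 : Fin 4) ((L / 8 : ℕ) : ZMod L)) 0 1)) ≤ C * u L β ^ 2)) →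
             ∃ (c_F : ℝ) (D₁ : ℕ), 0 < c_F ∧ 1 ≤ D₁ ∧ ∀ D₀ : ℕ, D₁ ≤ D₀ → ∃ β₁ : ℝ,
               ∀ (L : ℕ) [NeZero L] (β : ℝ) (n : ℕ), β₁ ≤ β → 2 * D₀ ≤ n → 8 * n ≤ L →
                 (∀ M : ℕ, 8 ≤ M → M ≤ L → u M β ≤ u₀) →
                 ∀ (P : (Fin 4 → ZMod L) → Fin 4 → Fin 4 → GaugeConfig 4 L G → ℝ)
                   (X Y : GaugeConfig 4 L G → ℝ) (μ : Measure (GaugeConfig 4 L G))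
                   (mB : MeasurableSpace (GaugeConfig 4 L G)),
                   (P = fun x i j U => (r.N : ℝ) - (r.ρ (plaquetteHolonomy U x i j)).trace.re) →
                   (X = fun U => (((n / D₀ : ℕ) : ℝ) ^ 3)⁻¹ *
                       ∑ v : Fin (n / D₀) × Fin (n / D₀) × Fin (n / D₀),
                         P ![((v.1 : ℕ) : ZMod L), ((v.2.1 : ℕ) : ZMod L), ((0 : ℕ) : ZMod L), ((v.2.2 : ℕ) : ZMod L)] 0 1 U) →
                   (Y = fun U => (((n / D₀ : ℕ) : ℝ) ^ 3)⁻¹ *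
                       ∑ v : Fin (n / D₀) × Fin (n / D₀) × Fin (n / D₀),
                         P ![((v.1 : ℕ) : ZMod L), ((v.2.1 : ℕ) : ZMod L), ((n : ℕ) : ZMod L), ((v.2.2 : ℕ) : ZMod L)] 0 1 U) →
                   (μ = wilsonMeasure r.ρ β) →
                   (mB = MeasurableSpace.comap
                       (fun (U : GaugeConfig 4 L G) (e : Edge 4 (L / (n / D₀))) (i j : Fin r.N) =>
                         unevenAxialLink (n / D₀) L (L / (n / D₀))
                           (Literature.MathematicalPhysics.QuantumLattice.wilsonFlowMatrix r.ρ
                             (((n / D₀ : ℕ) : ℝ) ^ 2 / 64) U) e i j)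
                       inferInstance) →
                   c_F * u (8 * n) β ^ 2 ≤ (n : ℝ) ^ 8 * cov[μ[X|mB], μ[Y|mB]; μ])
    (hDec : ∀ (u : ℕ → ℝ → ℝ) (u₀ β₀ κ₁ κ₂ κ₃ c C c₈ : ℝ),
             (0 < u₀ ∧ 0 < c ∧ 0 < κ₁ ∧ 0 ≤ κ₃ ∧ 0 < c₈ ∧
               (∀ (L : ℕ) (β : ℝ), 8 ≤ L → β₀ ≤ β → 0 < u L β) ∧
               (∀ L : ℕ, 8 ≤ L → ContinuousOn (u L) (Set.Ici β₀)) ∧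
               (∀ L : ℕ, 8 ≤ L → Filter.Tendsto (u L) Filter.atTop (nhds 0)) ∧
               (∀ β : ℝ, β₀ ≤ β → c₈ ≤ β * u 8 β) ∧
               (∀ (L L' : ℕ) (β : ℝ), β₀ ≤ β → 8 ≤ L → L ≤ L' → L' ≤ 2 * L →
                   (∀ M : ℕ, 8 ≤ M → M ≤ L → u M β ≤ u₀) → |(u L β)⁻¹ - (u L' β)⁻¹| ≤ κ₂) ∧
               (∀ (k m : ℕ) (β : ℝ), β₀ ≤ β → (∀ M : ℕ, 8 ≤ M → M ≤ 8 * 2 ^ (k + m) → u M β ≤ u₀) →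
                   κ₁ * m - κ₃ ≤ (u (8 * 2 ^ k) β)⁻¹ - (u (8 * 2 ^ (k + m)) β)⁻¹ ∧
                     (u (8 * 2 ^ k) β)⁻¹ - (u (8 * 2 ^ (k + m)) β)⁻¹ ≤ κ₂ * m + κ₃) ∧
               (∀ (L : ℕ) [NeZero L] (β : ℝ), β₀ ≤ β → 8 ≤ L →
                   (∀ M : ℕ, 8 ≤ M → M ≤ L → u M β ≤ u₀) →
                   ∀ (P : (Fin 4 → ZMod L) → Fin 4 → Fin 4 → GaugeConfig 4 L G → ℝ)
                     (E : (GaugeConfig 4 L G → ℝ) → ℝ),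
                     (P = fun x i j U => (r.N : ℝ) - (r.ρ (plaquetteHolonomy U x i j)).trace.re) →
                     (E = fun F => wilsonExpectation r.ρ β F) →
                     c * u L β ^ 2 ≤
                       ((L / 8 : ℕ) : ℝ) ^ 8 * (E (fun U => P 0 0 1 U * P (Pi.single (2 : Fin 4) ((L / 8 : ℕ) : ZMod L)) 0 1 U)
                         - E (P 0 0 1) * E (P (Pi.single (2 : Fin 4) ((L / 8 : ℕ) : ZMod L)) 0 1)) ∧
                     ((L / 8 : ℕ) : ℝ) ^ 8 * (E (fun U => P 0 0 1 U * P (Pi.single (2 : Fin 4) ((L / 8 : ℕ) : ZMod L)) 0 1 U)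
                       - E (P 0 0 1) * E (P (Pi.single (2 : Fin 4) ((L / 8 : ℕ) : ZMod L)) 0 1)) ≤ C * u L β ^ 2)) →
             ∀ ε : ℝ, 0 < ε → ∃ D₁ : ℕ, 1 ≤ D₁ ∧ ∀ D₀ : ℕ, D₁ ≤ D₀ → ∃ β₁ : ℝ,
               ∀ (L : ℕ) [NeZero L] (β : ℝ) (n : ℕ), β₁ ≤ β → 2 * D₀ ≤ n → 8 * n ≤ L →
                 (∀ M : ℕ, 8 ≤ M → M ≤ L → u M β ≤ u₀) →
                 ∀ (P : (Fin 4 → ZMod L) → Fin 4 → Fin 4 → GaugeConfig 4 L G → ℝ)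
                   (X Y : GaugeConfig 4 L G → ℝ) (μ : Measure (GaugeConfig 4 L G))
                   (mB : MeasurableSpace (GaugeConfig 4 L G)),
                   (P = fun x i j U => (r.N : ℝ) - (r.ρ (plaquetteHolonomy U x i j)).trace.re) →
                   (X = fun U => (((n / D₀ : ℕ) : ℝ) ^ 3)⁻¹ *
                       ∑ v : Fin (n / D₀) × Fin (n / D₀) × Fin (n / D₀),
                         P ![((v.1 : ℕ) : ZMod L), ((v.2.1 : ℕ) : ZMod L), ((0 : ℕ) : ZMod L), ((v.2.2 : ℕ) : ZMod L)] 0 1 U) →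
                   (Y = fun U => (((n / D₀ : ℕ) : ℝ) ^ 3)⁻¹ *
                       ∑ v : Fin (n / D₀) × Fin (n / D₀) × Fin (n / D₀),
                         P ![((v.1 : ℕ) : ZMod L), ((v.2.1 : ℕ) : ZMod L), ((n : ℕ) : ZMod L), ((v.2.2 : ℕ) : ZMod L)] 0 1 U) →
                   (μ = wilsonMeasure r.ρ β) →
                   (mB = MeasurableSpace.comap
                       (fun (U : GaugeConfig 4 L G) (e : Edge 4 (L / (n / D₀))) (i j : Fin r.N) =>
                         unevenAxialLink (n / D₀) L (L / (n / D₀))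
                           (Literature.MathematicalPhysics.QuantumLattice.wilsonFlowMatrix r.ρ
                             (((n / D₀ : ℕ) : ℝ) ^ 2 / 64) U) e i j)
                       inferInstance) →
                   (n : ℝ) ^ 8 * |∫ U, (X U - (μ[X|mB]) U) * (Y U - (μ[Y|mB]) U) ∂μ| ≤ ε * u (8 * n) β ^ 2)
    (hNN : ∀ L₀ : ℕ, ∃ (β₂ c₁ : ℝ), 0 < c₁ ∧
              ∀ (L : ℕ) [NeZero L] (β : ℝ), 8 ≤ L → L ≤ L₀ → β₂ ≤ β →
                ∀ (P : (Fin 4 → ZMod L) → Fin 4 → Fin 4 → GaugeConfig 4 L G → ℝ)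
                  (E : (GaugeConfig 4 L G → ℝ) → ℝ),
                  (P = fun x i j U => (r.N : ℝ) - (r.ρ (plaquetteHolonomy U x i j)).trace.re) →
                  (E = fun F => wilsonExpectation r.ρ β F) →
                  c₁ / β ^ 2 ≤
                    E (fun U => P 0 0 1 U * P (Pi.single (2 : Fin 4) ((1 : ℕ) : ZMod L)) 0 1 U)
                      - E (P 0 0 1) * E (P (Pi.single (2 : Fin 4) ((1 : ℕ) : ZMod L)) 0 1)) :
    AFProfilesCoreAt r := by
  obtain ⟨u, u₀, β₀, κ₁, κ₂, κ₃, c, C, c₈, hbody⟩ := hR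
  have hVC := hV u u₀ β₀ κ₁ κ₂ κ₃ c C c₈ hbody
  obtain ⟨β₁, C', hTU, hLU, hV⟩ := upperChannels_of_parts G hG r u u₀ β₀ κ₁ κ₂ κ₃ c C c₈ hbody
    (hTU u u₀ β₀ κ₁ κ₂ κ₃ c C c₈ hbody) (hLU u u₀ β₀ κ₁ κ₂ κ₃ c C c₈ hbody)
    (varianceEvenDeep_of_corner r u u₀ hVC)
    (varianceOdd_of_bulk_corner r u u₀
      (stub_varianceCeilingOddBulk G hG r u u₀ β₀ κ₁ κ₂ κ₃ c C c₈ hbody) hVC)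
  obtain ⟨β₂, c', hc', hTL⟩ := transverseLower_of_floor r u u₀ β₀ κ₁ κ₂ κ₃ c C c₈ hbody hDom
    (hFlo u u₀ β₀ κ₁ κ₂ κ₃ c C c₈ hbody) (hDec u u₀ β₀ κ₁ κ₂ κ₃ c C c₈ hbody)
    (boundedBoxes_of_nearestNeighbourFloor r u u₀ β₀ κ₁ κ₂ κ₃ c C c₈ hbody hNN)
  obtain ⟨hu₀, -, hκ₁, hκ₃, hc₈, hpos, hcont, hfrz, hbare, hcomp, hstep, -⟩ := hbody
  set B : ℝ := max β₀ (max β₁ β₂) with hB_def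
  have hB₀ : β₀ ≤ B := le_max_left _ _
  have hB₁ : β₁ ≤ B := (le_max_left _ _).trans (le_max_right _ _)
  have hB₂ : β₂ ≤ B := (le_max_right _ _).trans (le_max_right _ _)
  refine ⟨u, u₀, B, κ₁, κ₂, κ₃, c', C', c₈, hu₀, hc', hκ₁, hκ₃, hc₈, ?_, ?_, ?_, ?_, ?_, ?_, ?_, ?_, ?_, ?_⟩
  · intro L β hL hβ
    exact hpos L β hL (hB₀.trans hβ)
  · intro L hL
    exact (hcont L hL).mono (Set.Ici_subset_Ici.2 hB₀)
  · intro L hL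
    exact hfrz L hL
  · intro β hβ
    exact hbare β (hB₀.trans hβ)
  · intro L L' β hβ hL hLL' hL'L hwin
    exact hcomp L L' β (hB₀.trans hβ) hL hLL' hL'L hwin
  · intro k m β hβ hwin
    exact hstep k m β (hB₀.trans hβ) hwin
  · intro L _ β n hβ hn hnL hwin P E hP hE
    exact hTL L β n (hB₂.trans hβ) hn hnL hwin P E hP hE
  · intro L _ β s hβ hL hs hsL hwin P E hP hE
    exact hTU L β s (hB₁.trans hβ) hL hs hsL hwin P E hP hE
  · intro L _ β s hβ hL hs hsL hwin P E hP hE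
    exact hLU L β s (hB₁.trans hβ) hL hs hsL hwin P E hP hE
  · intro L _ β hβ hL hwin P E hP hE
    exact hV L β (hB₁.trans hβ) hL hwin P E hP hE

/-- **Hypothesis form at the physics level: the eight stub STATEMENTS imply `AFProfilesCore`** (reshape v3). -/
theorem afProfilesCore_of_floor
    (hR : ∀ (G : Type) [Group G] [TopologicalSpace G] [IsTopologicalGroup G] [CompactSpace G]
        [MeasurableSpace G] [BorelSpace G], IsCompactSimpleLieGroup G →
        ∀ r : LatticeRep G, ∃ (u : ℕ → ℝ → ℝ) (u₀ β₀ κ₁ κ₂ κ₃ c C c₈ : ℝ),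
      0 < u₀ ∧ 0 < c ∧ 0 < κ₁ ∧ 0 ≤ κ₃ ∧ 0 < c₈ ∧
        (∀ (L : ℕ) (β : ℝ), 8 ≤ L → β₀ ≤ β → 0 < u L β) ∧
        (∀ L : ℕ, 8 ≤ L → ContinuousOn (u L) (Set.Ici β₀)) ∧
        (∀ L : ℕ, 8 ≤ L → Filter.Tendsto (u L) Filter.atTop (nhds 0)) ∧
        (∀ β : ℝ, β₀ ≤ β → c₈ ≤ β * u 8 β) ∧
        (∀ (L L' : ℕ) (β : ℝ), β₀ ≤ β → 8 ≤ L → L ≤ L' → L' ≤ 2 * L →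
            (∀ M : ℕ, 8 ≤ M → M ≤ L → u M β ≤ u₀) → |(u L β)⁻¹ - (u L' β)⁻¹| ≤ κ₂) ∧
        (∀ (k m : ℕ) (β : ℝ), β₀ ≤ β → (∀ M : ℕ, 8 ≤ M → M ≤ 8 * 2 ^ (k + m) → u M β ≤ u₀) →
            κ₁ * m - κ₃ ≤ (u (8 * 2 ^ k) β)⁻¹ - (u (8 * 2 ^ (k + m)) β)⁻¹ ∧
              (u (8 * 2 ^ k) β)⁻¹ - (u (8 * 2 ^ (k + m)) β)⁻¹ ≤ κ₂ * m + κ₃) ∧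
        (∀ (L : ℕ) [NeZero L] (β : ℝ), β₀ ≤ β → 8 ≤ L →
            (∀ M : ℕ, 8 ≤ M → M ≤ L → u M β ≤ u₀) →
            ∀ (P : (Fin 4 → ZMod L) → Fin 4 → Fin 4 → GaugeConfig 4 L G → ℝ)
              (E : (GaugeConfig 4 L G → ℝ) → ℝ),
              (P = fun x i j U => (r.N : ℝ) - (r.ρ (plaquetteHolonomy U x i j)).trace.re) →
              (E = fun F => wilsonExpectation r.ρ β F) →
              c * u L β ^ 2 ≤
                ((L / 8 : ℕ) : ℝ) ^ 8 * (E (fun U => P 0 0 1 U * P (Pi.single (2 : Fin 4) ((L / 8 : ℕ) : ZMod L)) 0 1 U)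
                  - E (P 0 0 1) * E (P (Pi.single (2 : Fin 4) ((L / 8 : ℕ) : ZMod L)) 0 1)) ∧
              ((L / 8 : ℕ) : ℝ) ^ 8 * (E (fun U => P 0 0 1 U * P (Pi.single (2 : Fin 4) ((L / 8 : ℕ) : ZMod L)) 0 1 U)
                - E (P 0 0 1) * E (P (Pi.single (2 : Fin 4) ((L / 8 : ℕ) : ZMod L)) 0 1)) ≤ C * u L β ^ 2))
    (hTU : ∀ (G : Type) [Group G] [TopologicalSpace G] [IsTopologicalGroup G] [CompactSpace G]
        [MeasurableSpace G] [BorelSpace G], IsCompactSimpleLieGroup G →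
        ∀ r : LatticeRep G, ∀ (u : ℕ → ℝ → ℝ) (u₀ β₀ κ₁ κ₂ κ₃ c C c₈ : ℝ),
      (0 < u₀ ∧ 0 < c ∧ 0 < κ₁ ∧ 0 ≤ κ₃ ∧ 0 < c₈ ∧
        (∀ (L : ℕ) (β : ℝ), 8 ≤ L → β₀ ≤ β → 0 < u L β) ∧
        (∀ L : ℕ, 8 ≤ L → ContinuousOn (u L) (Set.Ici β₀)) ∧
        (∀ L : ℕ, 8 ≤ L → Filter.Tendsto (u L) Filter.atTop (nhds 0)) ∧
        (∀ β : ℝ, β₀ ≤ β → c₈ ≤ β * u 8 β) ∧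
        (∀ (L L' : ℕ) (β : ℝ), β₀ ≤ β → 8 ≤ L → L ≤ L' → L' ≤ 2 * L →
            (∀ M : ℕ, 8 ≤ M → M ≤ L → u M β ≤ u₀) → |(u L β)⁻¹ - (u L' β)⁻¹| ≤ κ₂) ∧
        (∀ (k m : ℕ) (β : ℝ), β₀ ≤ β → (∀ M : ℕ, 8 ≤ M → M ≤ 8 * 2 ^ (k + m) → u M β ≤ u₀) →
            κ₁ * m - κ₃ ≤ (u (8 * 2 ^ k) β)⁻¹ - (u (8 * 2 ^ (k + m)) β)⁻¹ ∧
              (u (8 * 2 ^ k) β)⁻¹ - (u (8 * 2 ^ (k + m)) β)⁻¹ ≤ κ₂ * m + κ₃) ∧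
        (∀ (L : ℕ) [NeZero L] (β : ℝ), β₀ ≤ β → 8 ≤ L →
            (∀ M : ℕ, 8 ≤ M → M ≤ L → u M β ≤ u₀) →
            ∀ (P : (Fin 4 → ZMod L) → Fin 4 → Fin 4 → GaugeConfig 4 L G → ℝ)
              (E : (GaugeConfig 4 L G → ℝ) → ℝ),
              (P = fun x i j U => (r.N : ℝ) - (r.ρ (plaquetteHolonomy U x i j)).trace.re) →
              (E = fun F => wilsonExpectation r.ρ β F) →
              c * u L β ^ 2 ≤
                ((L / 8 : ℕ) : ℝ) ^ 8 * (E (fun U => P 0 0 1 U * P (Pi.single (2 : Fin 4) ((L / 8 : ℕ) : ZMod L)) 0 1 U)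
                  - E (P 0 0 1) * E (P (Pi.single (2 : Fin 4) ((L / 8 : ℕ) : ZMod L)) 0 1)) ∧
              ((L / 8 : ℕ) : ℝ) ^ 8 * (E (fun U => P 0 0 1 U * P (Pi.single (2 : Fin 4) ((L / 8 : ℕ) : ZMod L)) 0 1 U)
                - E (P 0 0 1) * E (P (Pi.single (2 : Fin 4) ((L / 8 : ℕ) : ZMod L)) 0 1)) ≤ C * u L β ^ 2)) →
      ∃ (β₁ C' : ℝ),
          (∀ (L : ℕ) [NeZero L] (β : ℝ) (s : ℕ), β₁ ≤ β → 8 ≤ L → 1 ≤ s → 8 * s ≤ L →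
              (∀ M : ℕ, 8 ≤ M → M ≤ L → u M β ≤ u₀) →
              ∀ (P : (Fin 4 → ZMod L) → Fin 4 → Fin 4 → GaugeConfig 4 L G → ℝ)
                (E : (GaugeConfig 4 L G → ℝ) → ℝ),
                (P = fun x i j U => (r.N : ℝ) - (r.ρ (plaquetteHolonomy U x i j)).trace.re) →
                (E = fun F => wilsonExpectation r.ρ β F) →
                (s : ℝ) ^ 8 * (E (fun U => P 0 0 1 U * P (Pi.single (2 : Fin 4) ((s : ℕ) : ZMod L)) 0 1 U)
                      - E (P 0 0 1) * E (P (Pi.single (2 : Fin 4) ((s : ℕ) : ZMod L)) 0 1)) ≤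
                  C' * u (8 * s) β ^ 2))
    (hLU : ∀ (G : Type) [Group G] [TopologicalSpace G] [IsTopologicalGroup G] [CompactSpace G]
        [MeasurableSpace G] [BorelSpace G], IsCompactSimpleLieGroup G →
        ∀ r : LatticeRep G, ∀ (u : ℕ → ℝ → ℝ) (u₀ β₀ κ₁ κ₂ κ₃ c C c₈ : ℝ),
      (0 < u₀ ∧ 0 < c ∧ 0 < κ₁ ∧ 0 ≤ κ₃ ∧ 0 < c₈ ∧
        (∀ (L : ℕ) (β : ℝ), 8 ≤ L → β₀ ≤ β → 0 < u L β) ∧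
        (∀ L : ℕ, 8 ≤ L → ContinuousOn (u L) (Set.Ici β₀)) ∧
        (∀ L : ℕ, 8 ≤ L → Filter.Tendsto (u L) Filter.atTop (nhds 0)) ∧
        (∀ β : ℝ, β₀ ≤ β → c₈ ≤ β * u 8 β) ∧
        (∀ (L L' : ℕ) (β : ℝ), β₀ ≤ β → 8 ≤ L → L ≤ L' → L' ≤ 2 * L →
            (∀ M : ℕ, 8 ≤ M → M ≤ L → u M β ≤ u₀) → |(u L β)⁻¹ - (u L' β)⁻¹| ≤ κ₂) ∧
        (∀ (k m : ℕ) (β : ℝ), β₀ ≤ β → (∀ M : ℕ, 8 ≤ M → M ≤ 8 * 2 ^ (k + m) → u M β ≤ u₀) →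
            κ₁ * m - κ₃ ≤ (u (8 * 2 ^ k) β)⁻¹ - (u (8 * 2 ^ (k + m)) β)⁻¹ ∧
              (u (8 * 2 ^ k) β)⁻¹ - (u (8 * 2 ^ (k + m)) β)⁻¹ ≤ κ₂ * m + κ₃) ∧
        (∀ (L : ℕ) [NeZero L] (β : ℝ), β₀ ≤ β → 8 ≤ L →
            (∀ M : ℕ, 8 ≤ M → M ≤ L → u M β ≤ u₀) →
            ∀ (P : (Fin 4 → ZMod L) → Fin 4 → Fin 4 → GaugeConfig 4 L G → ℝ)
              (E : (GaugeConfig 4 L G → ℝ) → ℝ),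
              (P = fun x i j U => (r.N : ℝ) - (r.ρ (plaquetteHolonomy U x i j)).trace.re) →
              (E = fun F => wilsonExpectation r.ρ β F) →
              c * u L β ^ 2 ≤
                ((L / 8 : ℕ) : ℝ) ^ 8 * (E (fun U => P 0 0 1 U * P (Pi.single (2 : Fin 4) ((L / 8 : ℕ) : ZMod L)) 0 1 U)
                  - E (P 0 0 1) * E (P (Pi.single (2 : Fin 4) ((L / 8 : ℕ) : ZMod L)) 0 1)) ∧
              ((L / 8 : ℕ) : ℝ) ^ 8 * (E (fun U => P 0 0 1 U * P (Pi.single (2 : Fin 4) ((L / 8 : ℕ) : ZMod L)) 0 1 U)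
                - E (P 0 0 1) * E (P (Pi.single (2 : Fin 4) ((L / 8 : ℕ) : ZMod L)) 0 1)) ≤ C * u L β ^ 2)) →
      ∃ (β₁ C' : ℝ),
        (∀ (L : ℕ) [NeZero L] (β : ℝ) (s : ℕ), β₁ ≤ β → 8 ≤ L → 1 ≤ s → 8 * s ≤ L →
            (∀ M : ℕ, 8 ≤ M → M ≤ L → u M β ≤ u₀) →
            ∀ (P : (Fin 4 → ZMod L) → Fin 4 → Fin 4 → GaugeConfig 4 L G → ℝ)
              (E : (GaugeConfig 4 L G → ℝ) → ℝ),
              (P = fun x i j U => (r.N : ℝ) - (r.ρ (plaquetteHolonomy U x i j)).trace.re) →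
              (E = fun F => wilsonExpectation r.ρ β F) →
              (s : ℝ) ^ 8 * |E (fun U => P 0 0 1 U * P (Pi.single (0 : Fin 4) ((s : ℕ) : ZMod L)) 0 1 U)
                  - E (P 0 0 1) * E (P (Pi.single (0 : Fin 4) ((s : ℕ) : ZMod L)) 0 1)| ≤
                C' * u (8 * s) β ^ 2))
    (hV : ∀ (G : Type) [Group G] [TopologicalSpace G] [IsTopologicalGroup G] [CompactSpace G]
        [MeasurableSpace G] [BorelSpace G], IsCompactSimpleLieGroup G →
        ∀ r : LatticeRep G, ∀ (u : ℕ → ℝ → ℝ) (u₀ β₀ κ₁ κ₂ κ₃ c C c₈ : ℝ),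
      (0 < u₀ ∧ 0 < c ∧ 0 < κ₁ ∧ 0 ≤ κ₃ ∧ 0 < c₈ ∧
        (∀ (L : ℕ) (β : ℝ), 8 ≤ L → β₀ ≤ β → 0 < u L β) ∧
        (∀ L : ℕ, 8 ≤ L → ContinuousOn (u L) (Set.Ici β₀)) ∧
        (∀ L : ℕ, 8 ≤ L → Filter.Tendsto (u L) Filter.atTop (nhds 0)) ∧
        (∀ β : ℝ, β₀ ≤ β → c₈ ≤ β * u 8 β) ∧
        (∀ (L L' : ℕ) (β : ℝ), β₀ ≤ β → 8 ≤ L → L ≤ L' → L' ≤ 2 * L →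
            (∀ M : ℕ, 8 ≤ M → M ≤ L → u M β ≤ u₀) → |(u L β)⁻¹ - (u L' β)⁻¹| ≤ κ₂) ∧
        (∀ (k m : ℕ) (β : ℝ), β₀ ≤ β → (∀ M : ℕ, 8 ≤ M → M ≤ 8 * 2 ^ (k + m) → u M β ≤ u₀) →
            κ₁ * m - κ₃ ≤ (u (8 * 2 ^ k) β)⁻¹ - (u (8 * 2 ^ (k + m)) β)⁻¹ ∧
              (u (8 * 2 ^ k) β)⁻¹ - (u (8 * 2 ^ (k + m)) β)⁻¹ ≤ κ₂ * m + κ₃) ∧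
        (∀ (L : ℕ) [NeZero L] (β : ℝ), β₀ ≤ β → 8 ≤ L →
            (∀ M : ℕ, 8 ≤ M → M ≤ L → u M β ≤ u₀) →
            ∀ (P : (Fin 4 → ZMod L) → Fin 4 → Fin 4 → GaugeConfig 4 L G → ℝ)
              (E : (GaugeConfig 4 L G → ℝ) → ℝ),
              (P = fun x i j U => (r.N : ℝ) - (r.ρ (plaquetteHolonomy U x i j)).trace.re) →
              (E = fun F => wilsonExpectation r.ρ β F) →
              c * u L β ^ 2 ≤
                ((L / 8 : ℕ) : ℝ) ^ 8 * (E (fun U => P 0 0 1 U * P (Pi.single (2 : Fin 4) ((L / 8 : ℕ) : ZMod L)) 0 1 U)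
                  - E (P 0 0 1) * E (P (Pi.single (2 : Fin 4) ((L / 8 : ℕ) : ZMod L)) 0 1)) ∧
              ((L / 8 : ℕ) : ℝ) ^ 8 * (E (fun U => P 0 0 1 U * P (Pi.single (2 : Fin 4) ((L / 8 : ℕ) : ZMod L)) 0 1 U)
                - E (P 0 0 1) * E (P (Pi.single (2 : Fin 4) ((L / 8 : ℕ) : ZMod L)) 0 1)) ≤ C * u L β ^ 2)) →
      ∃ (β₁ C' : ℝ),
        (∀ (L : ℕ) [NeZero L] (β : ℝ), β₁ ≤ β → 8 ≤ L → (L : ℝ) ^ 4 < Real.log β →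
            (∀ M : ℕ, 8 ≤ M → M ≤ L → u M β ≤ u₀) →
            ∀ (P : (Fin 4 → ZMod L) → Fin 4 → Fin 4 → GaugeConfig 4 L G → ℝ)
              (E : (GaugeConfig 4 L G → ℝ) → ℝ),
              (P = fun x i j U => (r.N : ℝ) - (r.ρ (plaquetteHolonomy U x i j)).trace.re) →
              (E = fun F => wilsonExpectation r.ρ β F) →
              E (fun U => P 0 0 1 U * P 0 0 1 U) - E (P 0 0 1) * E (P 0 0 1) ≤ C' * u 8 β ^ 2))
    (hDom : ∀ (L N : ℕ) [NeZero L] (G : Type) [Group G] [TopologicalSpace G] [IsTopologicalGroup G]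
        [CompactSpace G] [MeasurableSpace G] [BorelSpace G] (ρ : G →* Matrix (Fin N) (Fin N) ℂ),
        Continuous ρ → ∀ (β : ℝ), 0 ≤ β → ∀ (m t : ℕ), 1 ≤ m → m ≤ L →
        ∀ (P : (Fin 4 → ZMod L) → Fin 4 → Fin 4 → GaugeConfig 4 L G → ℝ)
          (B : ℕ → GaugeConfig 4 L G → ℝ) (E : (GaugeConfig 4 L G → ℝ) → ℝ),
          (P = fun x i j U => (N : ℝ) - (ρ (plaquetteHolonomy U x i j)).trace.re) →
          (B = fun s U => (((m : ℕ) : ℝ) ^ 3)⁻¹ *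
              ∑ v : Fin (m) × Fin (m) × Fin (m),
                P ![((v.1 : ℕ) : ZMod L), ((v.2.1 : ℕ) : ZMod L), ((s : ℕ) : ZMod L), ((v.2.2 : ℕ) : ZMod L)] 0 1 U) →
          (E = fun F => wilsonExpectation ρ β F) →
          E (fun U => B 0 U * B t U) - E (B 0) * E (B t) ≤
            E (fun U => P 0 0 1 U * P (Pi.single (2 : Fin 4) ((t : ℕ) : ZMod L)) 0 1 U)
              - E (P 0 0 1) * E (P (Pi.single (2 : Fin 4) ((t : ℕ) : ZMod L)) 0 1))
    (hFlo : ∀ (G : Type) [Group G] [TopologicalSpace G] [IsTopologicalGroup G] [CompactSpace G]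
        [MeasurableSpace G] [BorelSpace G], IsCompactSimpleLieGroup G →
        ∀ r : LatticeRep G, ∀ (u : ℕ → ℝ → ℝ) (u₀ β₀ κ₁ κ₂ κ₃ c C c₈ : ℝ),
      (0 < u₀ ∧ 0 < c ∧ 0 < κ₁ ∧ 0 ≤ κ₃ ∧ 0 < c₈ ∧
        (∀ (L : ℕ) (β : ℝ), 8 ≤ L → β₀ ≤ β → 0 < u L β) ∧
        (∀ L : ℕ, 8 ≤ L → ContinuousOn (u L) (Set.Ici β₀)) ∧
        (∀ L : ℕ, 8 ≤ L → Filter.Tendsto (u L) Filter.atTop (nhds 0)) ∧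
        (∀ β : ℝ, β₀ ≤ β → c₈ ≤ β * u 8 β) ∧
        (∀ (L L' : ℕ) (β : ℝ), β₀ ≤ β → 8 ≤ L → L ≤ L' → L' ≤ 2 * L →
            (∀ M : ℕ, 8 ≤ M → M ≤ L → u M β ≤ u₀) → |(u L β)⁻¹ - (u L' β)⁻¹| ≤ κ₂) ∧
        (∀ (k m : ℕ) (β : ℝ), β₀ ≤ β → (∀ M : ℕ, 8 ≤ M → M ≤ 8 * 2 ^ (k + m) → u M β ≤ u₀) →
            κ₁ * m - κ₃ ≤ (u (8 * 2 ^ k) β)⁻¹ - (u (8 * 2 ^ (k + m)) β)⁻¹ ∧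
              (u (8 * 2 ^ k) β)⁻¹ - (u (8 * 2 ^ (k + m)) β)⁻¹ ≤ κ₂ * m + κ₃) ∧
        (∀ (L : ℕ) [NeZero L] (β : ℝ), β₀ ≤ β → 8 ≤ L →
            (∀ M : ℕ, 8 ≤ M → M ≤ L → u M β ≤ u₀) →
            ∀ (P : (Fin 4 → ZMod L) → Fin 4 → Fin 4 → GaugeConfig 4 L G → ℝ)
              (E : (GaugeConfig 4 L G → ℝ) → ℝ),
              (P = fun x i j U => (r.N : ℝ) - (r.ρ (plaquetteHolonomy U x i j)).trace.re) →
              (E = fun F => wilsonExpectation r.ρ β F) →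
              c * u L β ^ 2 ≤
                ((L / 8 : ℕ) : ℝ) ^ 8 * (E (fun U => P 0 0 1 U * P (Pi.single (2 : Fin 4) ((L / 8 : ℕ) : ZMod L)) 0 1 U)
                  - E (P 0 0 1) * E (P (Pi.single (2 : Fin 4) ((L / 8 : ℕ) : ZMod L)) 0 1)) ∧
              ((L / 8 : ℕ) : ℝ) ^ 8 * (E (fun U => P 0 0 1 U * P (Pi.single (2 : Fin 4) ((L / 8 : ℕ) : ZMod L)) 0 1 U)
                - E (P 0 0 1) * E (P (Pi.single (2 : Fin 4) ((L / 8 : ℕ) : ZMod L)) 0 1)) ≤ C * u L β ^ 2)) →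
      ∃ (c_F : ℝ) (D₁ : ℕ), 0 < c_F ∧ 1 ≤ D₁ ∧ ∀ D₀ : ℕ, D₁ ≤ D₀ → ∃ β₁ : ℝ,
        ∀ (L : ℕ) [NeZero L] (β : ℝ) (n : ℕ), β₁ ≤ β → 2 * D₀ ≤ n → 8 * n ≤ L →
          (∀ M : ℕ, 8 ≤ M → M ≤ L → u M β ≤ u₀) →
          ∀ (P : (Fin 4 → ZMod L) → Fin 4 → Fin 4 → GaugeConfig 4 L G → ℝ)
            (X Y : GaugeConfig 4 L G → ℝ) (μ : Measure (GaugeConfig 4 L G))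
            (mB : MeasurableSpace (GaugeConfig 4 L G)),
            (P = fun x i j U => (r.N : ℝ) - (r.ρ (plaquetteHolonomy U x i j)).trace.re) →
            (X = fun U => (((n / D₀ : ℕ) : ℝ) ^ 3)⁻¹ *
                ∑ v : Fin (n / D₀) × Fin (n / D₀) × Fin (n / D₀),
                  P ![((v.1 : ℕ) : ZMod L), ((v.2.1 : ℕ) : ZMod L), ((0 : ℕ) : ZMod L), ((v.2.2 : ℕ) : ZMod L)] 0 1 U) →
            (Y = fun U => (((n / D₀ : ℕ) : ℝ) ^ 3)⁻¹ *
                ∑ v : Fin (n / D₀) × Fin (n / D₀) × Fin (n / D₀),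
                  P ![((v.1 : ℕ) : ZMod L), ((v.2.1 : ℕ) : ZMod L), ((n : ℕ) : ZMod L), ((v.2.2 : ℕ) : ZMod L)] 0 1 U) →
            (μ = wilsonMeasure r.ρ β) →
            (mB = MeasurableSpace.comap
                (fun (U : GaugeConfig 4 L G) (e : Edge 4 (L / (n / D₀))) (i j : Fin r.N) =>
                  unevenAxialLink (n / D₀) L (L / (n / D₀))
                    (Literature.MathematicalPhysics.QuantumLattice.wilsonFlowMatrix r.ρ
                      (((n / D₀ : ℕ) : ℝ) ^ 2 / 64) U) e i j)
                inferInstance) →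
            c_F * u (8 * n) β ^ 2 ≤ (n : ℝ) ^ 8 * cov[μ[X|mB], μ[Y|mB]; μ])
    (hDec : ∀ (G : Type) [Group G] [TopologicalSpace G] [IsTopologicalGroup G] [CompactSpace G]
        [MeasurableSpace G] [BorelSpace G], IsCompactSimpleLieGroup G →
        ∀ r : LatticeRep G, ∀ (u : ℕ → ℝ → ℝ) (u₀ β₀ κ₁ κ₂ κ₃ c C c₈ : ℝ),
      (0 < u₀ ∧ 0 < c ∧ 0 < κ₁ ∧ 0 ≤ κ₃ ∧ 0 < c₈ ∧
        (∀ (L : ℕ) (β : ℝ), 8 ≤ L → β₀ ≤ β → 0 < u L β) ∧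
        (∀ L : ℕ, 8 ≤ L → ContinuousOn (u L) (Set.Ici β₀)) ∧
        (∀ L : ℕ, 8 ≤ L → Filter.Tendsto (u L) Filter.atTop (nhds 0)) ∧
        (∀ β : ℝ, β₀ ≤ β → c₈ ≤ β * u 8 β) ∧
        (∀ (L L' : ℕ) (β : ℝ), β₀ ≤ β → 8 ≤ L → L ≤ L' → L' ≤ 2 * L →
            (∀ M : ℕ, 8 ≤ M → M ≤ L → u M β ≤ u₀) → |(u L β)⁻¹ - (u L' β)⁻¹| ≤ κ₂) ∧
        (∀ (k m : ℕ) (β : ℝ), β₀ ≤ β → (∀ M : ℕ, 8 ≤ M → M ≤ 8 * 2 ^ (k + m) → u M β ≤ u₀) →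
            κ₁ * m - κ₃ ≤ (u (8 * 2 ^ k) β)⁻¹ - (u (8 * 2 ^ (k + m)) β)⁻¹ ∧
              (u (8 * 2 ^ k) β)⁻¹ - (u (8 * 2 ^ (k + m)) β)⁻¹ ≤ κ₂ * m + κ₃) ∧
        (∀ (L : ℕ) [NeZero L] (β : ℝ), β₀ ≤ β → 8 ≤ L →
            (∀ M : ℕ, 8 ≤ M → M ≤ L → u M β ≤ u₀) →
            ∀ (P : (Fin 4 → ZMod L) → Fin 4 → Fin 4 → GaugeConfig 4 L G → ℝ)
              (E : (GaugeConfig 4 L G → ℝ) → ℝ),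
              (P = fun x i j U => (r.N : ℝ) - (r.ρ (plaquetteHolonomy U x i j)).trace.re) →
              (E = fun F => wilsonExpectation r.ρ β F) →
              c * u L β ^ 2 ≤
                ((L / 8 : ℕ) : ℝ) ^ 8 * (E (fun U => P 0 0 1 U * P (Pi.single (2 : Fin 4) ((L / 8 : ℕ) : ZMod L)) 0 1 U)
                  - E (P 0 0 1) * E (P (Pi.single (2 : Fin 4) ((L / 8 : ℕ) : ZMod L)) 0 1)) ∧
              ((L / 8 : ℕ) : ℝ) ^ 8 * (E (fun U => P 0 0 1 U * P (Pi.single (2 : Fin 4) ((L / 8 : ℕ) : ZMod L)) 0 1 U)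
                - E (P 0 0 1) * E (P (Pi.single (2 : Fin 4) ((L / 8 : ℕ) : ZMod L)) 0 1)) ≤ C * u L β ^ 2)) →
      ∀ ε : ℝ, 0 < ε → ∃ D₁ : ℕ, 1 ≤ D₁ ∧ ∀ D₀ : ℕ, D₁ ≤ D₀ → ∃ β₁ : ℝ,
        ∀ (L : ℕ) [NeZero L] (β : ℝ) (n : ℕ), β₁ ≤ β → 2 * D₀ ≤ n → 8 * n ≤ L →
          (∀ M : ℕ, 8 ≤ M → M ≤ L → u M β ≤ u₀) →
          ∀ (P : (Fin 4 → ZMod L) → Fin 4 → Fin 4 → GaugeConfig 4 L G → ℝ)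
            (X Y : GaugeConfig 4 L G → ℝ) (μ : Measure (GaugeConfig 4 L G))
            (mB : MeasurableSpace (GaugeConfig 4 L G)),
            (P = fun x i j U => (r.N : ℝ) - (r.ρ (plaquetteHolonomy U x i j)).trace.re) →
            (X = fun U => (((n / D₀ : ℕ) : ℝ) ^ 3)⁻¹ *
                ∑ v : Fin (n / D₀) × Fin (n / D₀) × Fin (n / D₀),
                  P ![((v.1 : ℕ) : ZMod L), ((v.2.1 : ℕ) : ZMod L), ((0 : ℕ) : ZMod L), ((v.2.2 : ℕ) : ZMod L)] 0 1 U) →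
            (Y = fun U => (((n / D₀ : ℕ) : ℝ) ^ 3)⁻¹ *
                ∑ v : Fin (n / D₀) × Fin (n / D₀) × Fin (n / D₀),
                  P ![((v.1 : ℕ) : ZMod L), ((v.2.1 : ℕ) : ZMod L), ((n : ℕ) : ZMod L), ((v.2.2 : ℕ) : ZMod L)] 0 1 U) →
            (μ = wilsonMeasure r.ρ β) →
            (mB = MeasurableSpace.comap
                (fun (U : GaugeConfig 4 L G) (e : Edge 4 (L / (n / D₀))) (i j : Fin r.N) =>
                  unevenAxialLink (n / D₀) L (L / (n / D₀))
                    (Literature.MathematicalPhysics.QuantumLattice.wilsonFlowMatrix r.ρ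
                      (((n / D₀ : ℕ) : ℝ) ^ 2 / 64) U) e i j)
                inferInstance) →
            (n : ℝ) ^ 8 * |∫ U, (X U - (μ[X|mB]) U) * (Y U - (μ[Y|mB]) U) ∂μ| ≤ ε * u (8 * n) β ^ 2)
    (hNN : ∀ (G : Type) [Group G] [TopologicalSpace G] [IsTopologicalGroup G] [CompactSpace G]
        [MeasurableSpace G] [BorelSpace G], IsCompactSimpleLieGroup G →
        ∀ r : LatticeRep G, ∀ L₀ : ℕ, ∃ (β₂ c₁ : ℝ), 0 < c₁ ∧
        ∀ (L : ℕ) [NeZero L] (β : ℝ), 8 ≤ L → L ≤ L₀ → β₂ ≤ β →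
          ∀ (P : (Fin 4 → ZMod L) → Fin 4 → Fin 4 → GaugeConfig 4 L G → ℝ)
            (E : (GaugeConfig 4 L G → ℝ) → ℝ),
            (P = fun x i j U => (r.N : ℝ) - (r.ρ (plaquetteHolonomy U x i j)).trace.re) →
            (E = fun F => wilsonExpectation r.ρ β F) →
            c₁ / β ^ 2 ≤
              E (fun U => P 0 0 1 U * P (Pi.single (2 : Fin 4) ((1 : ℕ) : ZMod L)) 0 1 U)
                - E (P 0 0 1) * E (P (Pi.single (2 : Fin 4) ((1 : ℕ) : ZMod L)) 0 1)) :
    AFProfilesCore := by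
  intro G _ _ _ _ _ _ hG r
  exact afProfilesCoreAt_of_floor hG r (hR G hG r) (hTU G hG r) (hLU G hG r) (hV G hG r)
    (fun L _ β hβ m t hm hmL => hDom L r.N G r.ρ r.continuous β hβ m t hm hmL)
    (hFlo G hG r) (hDec G hG r) (hNN G hG r)

end Glue

/-- **Composition (BC3 hypothesis form, sorry-free): the eight stub STATEMENTS imply the crux BY NAME**, through
`afProfilesCore_of_floor` and the landed `femtoCurvatureTwoPointC_of_core : AFProfilesCore → FemtoCurvatureTwoPointC`
(p134841). -/
theorem FemtoCurvatureTwoPointC_of :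
    (∀ (G : Type) [Group G] [TopologicalSpace G] [IsTopologicalGroup G] [CompactSpace G]
        [MeasurableSpace G] [BorelSpace G], IsCompactSimpleLieGroup G →
        ∀ r : LatticeRep G, ∃ (u : ℕ → ℝ → ℝ) (u₀ β₀ κ₁ κ₂ κ₃ c C c₈ : ℝ),
      0 < u₀ ∧ 0 < c ∧ 0 < κ₁ ∧ 0 ≤ κ₃ ∧ 0 < c₈ ∧
        (∀ (L : ℕ) (β : ℝ), 8 ≤ L → β₀ ≤ β → 0 < u L β) ∧
        (∀ L : ℕ, 8 ≤ L → ContinuousOn (u L) (Set.Ici β₀)) ∧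
        (∀ L : ℕ, 8 ≤ L → Filter.Tendsto (u L) Filter.atTop (nhds 0)) ∧
        (∀ β : ℝ, β₀ ≤ β → c₈ ≤ β * u 8 β) ∧
        (∀ (L L' : ℕ) (β : ℝ), β₀ ≤ β → 8 ≤ L → L ≤ L' → L' ≤ 2 * L →
            (∀ M : ℕ, 8 ≤ M → M ≤ L → u M β ≤ u₀) → |(u L β)⁻¹ - (u L' β)⁻¹| ≤ κ₂) ∧
        (∀ (k m : ℕ) (β : ℝ), β₀ ≤ β → (∀ M : ℕ, 8 ≤ M → M ≤ 8 * 2 ^ (k + m) → u M β ≤ u₀) →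
            κ₁ * m - κ₃ ≤ (u (8 * 2 ^ k) β)⁻¹ - (u (8 * 2 ^ (k + m)) β)⁻¹ ∧
              (u (8 * 2 ^ k) β)⁻¹ - (u (8 * 2 ^ (k + m)) β)⁻¹ ≤ κ₂ * m + κ₃) ∧
        (∀ (L : ℕ) [NeZero L] (β : ℝ), β₀ ≤ β → 8 ≤ L →
            (∀ M : ℕ, 8 ≤ M → M ≤ L → u M β ≤ u₀) →
            ∀ (P : (Fin 4 → ZMod L) → Fin 4 → Fin 4 → GaugeConfig 4 L G → ℝ)
              (E : (GaugeConfig 4 L G → ℝ) → ℝ),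
              (P = fun x i j U => (r.N : ℝ) - (r.ρ (plaquetteHolonomy U x i j)).trace.re) →
              (E = fun F => wilsonExpectation r.ρ β F) →
              c * u L β ^ 2 ≤
                ((L / 8 : ℕ) : ℝ) ^ 8 * (E (fun U => P 0 0 1 U * P (Pi.single (2 : Fin 4) ((L / 8 : ℕ) : ZMod L)) 0 1 U)
                  - E (P 0 0 1) * E (P (Pi.single (2 : Fin 4) ((L / 8 : ℕ) : ZMod L)) 0 1)) ∧
              ((L / 8 : ℕ) : ℝ) ^ 8 * (E (fun U => P 0 0 1 U * P (Pi.single (2 : Fin 4) ((L / 8 : ℕ) : ZMod L)) 0 1 U)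
                - E (P 0 0 1) * E (P (Pi.single (2 : Fin 4) ((L / 8 : ℕ) : ZMod L)) 0 1)) ≤ C * u L β ^ 2)) →
    (∀ (G : Type) [Group G] [TopologicalSpace G] [IsTopologicalGroup G] [CompactSpace G]
        [MeasurableSpace G] [BorelSpace G], IsCompactSimpleLieGroup G →
        ∀ r : LatticeRep G, ∀ (u : ℕ → ℝ → ℝ) (u₀ β₀ κ₁ κ₂ κ₃ c C c₈ : ℝ),
      (0 < u₀ ∧ 0 < c ∧ 0 < κ₁ ∧ 0 ≤ κ₃ ∧ 0 < c₈ ∧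
        (∀ (L : ℕ) (β : ℝ), 8 ≤ L → β₀ ≤ β → 0 < u L β) ∧
        (∀ L : ℕ, 8 ≤ L → ContinuousOn (u L) (Set.Ici β₀)) ∧
        (∀ L : ℕ, 8 ≤ L → Filter.Tendsto (u L) Filter.atTop (nhds 0)) ∧
        (∀ β : ℝ, β₀ ≤ β → c₈ ≤ β * u 8 β) ∧
        (∀ (L L' : ℕ) (β : ℝ), β₀ ≤ β → 8 ≤ L → L ≤ L' → L' ≤ 2 * L →
            (∀ M : ℕ, 8 ≤ M → M ≤ L → u M β ≤ u₀) → |(u L β)⁻¹ - (u L' β)⁻¹| ≤ κ₂) ∧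
        (∀ (k m : ℕ) (β : ℝ), β₀ ≤ β → (∀ M : ℕ, 8 ≤ M → M ≤ 8 * 2 ^ (k + m) → u M β ≤ u₀) →
            κ₁ * m - κ₃ ≤ (u (8 * 2 ^ k) β)⁻¹ - (u (8 * 2 ^ (k + m)) β)⁻¹ ∧
              (u (8 * 2 ^ k) β)⁻¹ - (u (8 * 2 ^ (k + m)) β)⁻¹ ≤ κ₂ * m + κ₃) ∧
        (∀ (L : ℕ) [NeZero L] (β : ℝ), β₀ ≤ β → 8 ≤ L →
            (∀ M : ℕ, 8 ≤ M → M ≤ L → u M β ≤ u₀) →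
            ∀ (P : (Fin 4 → ZMod L) → Fin 4 → Fin 4 → GaugeConfig 4 L G → ℝ)
              (E : (GaugeConfig 4 L G → ℝ) → ℝ),
              (P = fun x i j U => (r.N : ℝ) - (r.ρ (plaquetteHolonomy U x i j)).trace.re) →
              (E = fun F => wilsonExpectation r.ρ β F) →
              c * u L β ^ 2 ≤
                ((L / 8 : ℕ) : ℝ) ^ 8 * (E (fun U => P 0 0 1 U * P (Pi.single (2 : Fin 4) ((L / 8 : ℕ) : ZMod L)) 0 1 U)
                  - E (P 0 0 1) * E (P (Pi.single (2 : Fin 4) ((L / 8 : ℕ) : ZMod L)) 0 1)) ∧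
              ((L / 8 : ℕ) : ℝ) ^ 8 * (E (fun U => P 0 0 1 U * P (Pi.single (2 : Fin 4) ((L / 8 : ℕ) : ZMod L)) 0 1 U)
                - E (P 0 0 1) * E (P (Pi.single (2 : Fin 4) ((L / 8 : ℕ) : ZMod L)) 0 1)) ≤ C * u L β ^ 2)) →
      ∃ (β₁ C' : ℝ),
          (∀ (L : ℕ) [NeZero L] (β : ℝ) (s : ℕ), β₁ ≤ β → 8 ≤ L → 1 ≤ s → 8 * s ≤ L →
              (∀ M : ℕ, 8 ≤ M → M ≤ L → u M β ≤ u₀) →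
              ∀ (P : (Fin 4 → ZMod L) → Fin 4 → Fin 4 → GaugeConfig 4 L G → ℝ)
                (E : (GaugeConfig 4 L G → ℝ) → ℝ),
                (P = fun x i j U => (r.N : ℝ) - (r.ρ (plaquetteHolonomy U x i j)).trace.re) →
                (E = fun F => wilsonExpectation r.ρ β F) →
                (s : ℝ) ^ 8 * (E (fun U => P 0 0 1 U * P (Pi.single (2 : Fin 4) ((s : ℕ) : ZMod L)) 0 1 U)
                      - E (P 0 0 1) * E (P (Pi.single (2 : Fin 4) ((s : ℕ) : ZMod L)) 0 1)) ≤
                  C' * u (8 * s) β ^ 2)) →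
    (∀ (G : Type) [Group G] [TopologicalSpace G] [IsTopologicalGroup G] [CompactSpace G]
        [MeasurableSpace G] [BorelSpace G], IsCompactSimpleLieGroup G →
        ∀ r : LatticeRep G, ∀ (u : ℕ → ℝ → ℝ) (u₀ β₀ κ₁ κ₂ κ₃ c C c₈ : ℝ),
      (0 < u₀ ∧ 0 < c ∧ 0 < κ₁ ∧ 0 ≤ κ₃ ∧ 0 < c₈ ∧
        (∀ (L : ℕ) (β : ℝ), 8 ≤ L → β₀ ≤ β → 0 < u L β) ∧
        (∀ L : ℕ, 8 ≤ L → ContinuousOn (u L) (Set.Ici β₀)) ∧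
        (∀ L : ℕ, 8 ≤ L → Filter.Tendsto (u L) Filter.atTop (nhds 0)) ∧
        (∀ β : ℝ, β₀ ≤ β → c₈ ≤ β * u 8 β) ∧
        (∀ (L L' : ℕ) (β : ℝ), β₀ ≤ β → 8 ≤ L → L ≤ L' → L' ≤ 2 * L →
            (∀ M : ℕ, 8 ≤ M → M ≤ L → u M β ≤ u₀) → |(u L β)⁻¹ - (u L' β)⁻¹| ≤ κ₂) ∧
        (∀ (k m : ℕ) (β : ℝ), β₀ ≤ β → (∀ M : ℕ, 8 ≤ M → M ≤ 8 * 2 ^ (k + m) → u M β ≤ u₀) →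
            κ₁ * m - κ₃ ≤ (u (8 * 2 ^ k) β)⁻¹ - (u (8 * 2 ^ (k + m)) β)⁻¹ ∧
              (u (8 * 2 ^ k) β)⁻¹ - (u (8 * 2 ^ (k + m)) β)⁻¹ ≤ κ₂ * m + κ₃) ∧
        (∀ (L : ℕ) [NeZero L] (β : ℝ), β₀ ≤ β → 8 ≤ L →
            (∀ M : ℕ, 8 ≤ M → M ≤ L → u M β ≤ u₀) →
            ∀ (P : (Fin 4 → ZMod L) → Fin 4 → Fin 4 → GaugeConfig 4 L G → ℝ)
              (E : (GaugeConfig 4 L G → ℝ) → ℝ),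
              (P = fun x i j U => (r.N : ℝ) - (r.ρ (plaquetteHolonomy U x i j)).trace.re) →
              (E = fun F => wilsonExpectation r.ρ β F) →
              c * u L β ^ 2 ≤
                ((L / 8 : ℕ) : ℝ) ^ 8 * (E (fun U => P 0 0 1 U * P (Pi.single (2 : Fin 4) ((L / 8 : ℕ) : ZMod L)) 0 1 U)
                  - E (P 0 0 1) * E (P (Pi.single (2 : Fin 4) ((L / 8 : ℕ) : ZMod L)) 0 1)) ∧
              ((L / 8 : ℕ) : ℝ) ^ 8 * (E (fun U => P 0 0 1 U * P (Pi.single (2 : Fin 4) ((L / 8 : ℕ) : ZMod L)) 0 1 U)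
                - E (P 0 0 1) * E (P (Pi.single (2 : Fin 4) ((L / 8 : ℕ) : ZMod L)) 0 1)) ≤ C * u L β ^ 2)) →
      ∃ (β₁ C' : ℝ),
        (∀ (L : ℕ) [NeZero L] (β : ℝ) (s : ℕ), β₁ ≤ β → 8 ≤ L → 1 ≤ s → 8 * s ≤ L →
            (∀ M : ℕ, 8 ≤ M → M ≤ L → u M β ≤ u₀) →
            ∀ (P : (Fin 4 → ZMod L) → Fin 4 → Fin 4 → GaugeConfig 4 L G → ℝ)
              (E : (GaugeConfig 4 L G → ℝ) → ℝ),
              (P = fun x i j U => (r.N : ℝ) - (r.ρ (plaquetteHolonomy U x i j)).trace.re) →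
              (E = fun F => wilsonExpectation r.ρ β F) →
              (s : ℝ) ^ 8 * |E (fun U => P 0 0 1 U * P (Pi.single (0 : Fin 4) ((s : ℕ) : ZMod L)) 0 1 U)
                  - E (P 0 0 1) * E (P (Pi.single (0 : Fin 4) ((s : ℕ) : ZMod L)) 0 1)| ≤
                C' * u (8 * s) β ^ 2)) →
    (∀ (G : Type) [Group G] [TopologicalSpace G] [IsTopologicalGroup G] [CompactSpace G]
        [MeasurableSpace G] [BorelSpace G], IsCompactSimpleLieGroup G →
        ∀ r : LatticeRep G, ∀ (u : ℕ → ℝ → ℝ) (u₀ β₀ κ₁ κ₂ κ₃ c C c₈ : ℝ),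
      (0 < u₀ ∧ 0 < c ∧ 0 < κ₁ ∧ 0 ≤ κ₃ ∧ 0 < c₈ ∧
        (∀ (L : ℕ) (β : ℝ), 8 ≤ L → β₀ ≤ β → 0 < u L β) ∧
        (∀ L : ℕ, 8 ≤ L → ContinuousOn (u L) (Set.Ici β₀)) ∧
        (∀ L : ℕ, 8 ≤ L → Filter.Tendsto (u L) Filter.atTop (nhds 0)) ∧
        (∀ β : ℝ, β₀ ≤ β → c₈ ≤ β * u 8 β) ∧
        (∀ (L L' : ℕ) (β : ℝ), β₀ ≤ β → 8 ≤ L → L ≤ L' → L' ≤ 2 * L →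
            (∀ M : ℕ, 8 ≤ M → M ≤ L → u M β ≤ u₀) → |(u L β)⁻¹ - (u L' β)⁻¹| ≤ κ₂) ∧
        (∀ (k m : ℕ) (β : ℝ), β₀ ≤ β → (∀ M : ℕ, 8 ≤ M → M ≤ 8 * 2 ^ (k + m) → u M β ≤ u₀) →
            κ₁ * m - κ₃ ≤ (u (8 * 2 ^ k) β)⁻¹ - (u (8 * 2 ^ (k + m)) β)⁻¹ ∧
              (u (8 * 2 ^ k) β)⁻¹ - (u (8 * 2 ^ (k + m)) β)⁻¹ ≤ κ₂ * m + κ₃) ∧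
        (∀ (L : ℕ) [NeZero L] (β : ℝ), β₀ ≤ β → 8 ≤ L →
            (∀ M : ℕ, 8 ≤ M → M ≤ L → u M β ≤ u₀) →
            ∀ (P : (Fin 4 → ZMod L) → Fin 4 → Fin 4 → GaugeConfig 4 L G → ℝ)
              (E : (GaugeConfig 4 L G → ℝ) → ℝ),
              (P = fun x i j U => (r.N : ℝ) - (r.ρ (plaquetteHolonomy U x i j)).trace.re) →
              (E = fun F => wilsonExpectation r.ρ β F) →
              c * u L β ^ 2 ≤
                ((L / 8 : ℕ) : ℝ) ^ 8 * (E (fun U => P 0 0 1 U * P (Pi.single (2 : Fin 4) ((L / 8 : ℕ) : ZMod L)) 0 1 U)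
                  - E (P 0 0 1) * E (P (Pi.single (2 : Fin 4) ((L / 8 : ℕ) : ZMod L)) 0 1)) ∧
              ((L / 8 : ℕ) : ℝ) ^ 8 * (E (fun U => P 0 0 1 U * P (Pi.single (2 : Fin 4) ((L / 8 : ℕ) : ZMod L)) 0 1 U)
                - E (P 0 0 1) * E (P (Pi.single (2 : Fin 4) ((L / 8 : ℕ) : ZMod L)) 0 1)) ≤ C * u L β ^ 2)) →
      ∃ (β₁ C' : ℝ),
        (∀ (L : ℕ) [NeZero L] (β : ℝ), β₁ ≤ β → 8 ≤ L → (L : ℝ) ^ 4 < Real.log β →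
            (∀ M : ℕ, 8 ≤ M → M ≤ L → u M β ≤ u₀) →
            ∀ (P : (Fin 4 → ZMod L) → Fin 4 → Fin 4 → GaugeConfig 4 L G → ℝ)
              (E : (GaugeConfig 4 L G → ℝ) → ℝ),
              (P = fun x i j U => (r.N : ℝ) - (r.ρ (plaquetteHolonomy U x i j)).trace.re) →
              (E = fun F => wilsonExpectation r.ρ β F) →
              E (fun U => P 0 0 1 U * P 0 0 1 U) - E (P 0 0 1) * E (P 0 0 1) ≤ C' * u 8 β ^ 2)) →
    (∀ (L N : ℕ) [NeZero L] (G : Type) [Group G] [TopologicalSpace G] [IsTopologicalGroup G]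
        [CompactSpace G] [MeasurableSpace G] [BorelSpace G] (ρ : G →* Matrix (Fin N) (Fin N) ℂ),
        Continuous ρ → ∀ (β : ℝ), 0 ≤ β → ∀ (m t : ℕ), 1 ≤ m → m ≤ L →
        ∀ (P : (Fin 4 → ZMod L) → Fin 4 → Fin 4 → GaugeConfig 4 L G → ℝ)
          (B : ℕ → GaugeConfig 4 L G → ℝ) (E : (GaugeConfig 4 L G → ℝ) → ℝ),
          (P = fun x i j U => (N : ℝ) - (ρ (plaquetteHolonomy U x i j)).trace.re) →
          (B = fun s U => (((m : ℕ) : ℝ) ^ 3)⁻¹ *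
              ∑ v : Fin (m) × Fin (m) × Fin (m),
                P ![((v.1 : ℕ) : ZMod L), ((v.2.1 : ℕ) : ZMod L), ((s : ℕ) : ZMod L), ((v.2.2 : ℕ) : ZMod L)] 0 1 U) →
          (E = fun F => wilsonExpectation ρ β F) →
          E (fun U => B 0 U * B t U) - E (B 0) * E (B t) ≤
            E (fun U => P 0 0 1 U * P (Pi.single (2 : Fin 4) ((t : ℕ) : ZMod L)) 0 1 U)
              - E (P 0 0 1) * E (P (Pi.single (2 : Fin 4) ((t : ℕ) : ZMod L)) 0 1)) →
    (∀ (G : Type) [Group G] [TopologicalSpace G] [IsTopologicalGroup G] [CompactSpace G]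
        [MeasurableSpace G] [BorelSpace G], IsCompactSimpleLieGroup G →
        ∀ r : LatticeRep G, ∀ (u : ℕ → ℝ → ℝ) (u₀ β₀ κ₁ κ₂ κ₃ c C c₈ : ℝ),
      (0 < u₀ ∧ 0 < c ∧ 0 < κ₁ ∧ 0 ≤ κ₃ ∧ 0 < c₈ ∧
        (∀ (L : ℕ) (β : ℝ), 8 ≤ L → β₀ ≤ β → 0 < u L β) ∧
        (∀ L : ℕ, 8 ≤ L → ContinuousOn (u L) (Set.Ici β₀)) ∧
        (∀ L : ℕ, 8 ≤ L → Filter.Tendsto (u L) Filter.atTop (nhds 0)) ∧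
        (∀ β : ℝ, β₀ ≤ β → c₈ ≤ β * u 8 β) ∧
        (∀ (L L' : ℕ) (β : ℝ), β₀ ≤ β → 8 ≤ L → L ≤ L' → L' ≤ 2 * L →
            (∀ M : ℕ, 8 ≤ M → M ≤ L → u M β ≤ u₀) → |(u L β)⁻¹ - (u L' β)⁻¹| ≤ κ₂) ∧
        (∀ (k m : ℕ) (β : ℝ), β₀ ≤ β → (∀ M : ℕ, 8 ≤ M → M ≤ 8 * 2 ^ (k + m) → u M β ≤ u₀) →
            κ₁ * m - κ₃ ≤ (u (8 * 2 ^ k) β)⁻¹ - (u (8 * 2 ^ (k + m)) β)⁻¹ ∧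
              (u (8 * 2 ^ k) β)⁻¹ - (u (8 * 2 ^ (k + m)) β)⁻¹ ≤ κ₂ * m + κ₃) ∧
        (∀ (L : ℕ) [NeZero L] (β : ℝ), β₀ ≤ β → 8 ≤ L →
            (∀ M : ℕ, 8 ≤ M → M ≤ L → u M β ≤ u₀) →
            ∀ (P : (Fin 4 → ZMod L) → Fin 4 → Fin 4 → GaugeConfig 4 L G → ℝ)
              (E : (GaugeConfig 4 L G → ℝ) → ℝ),
              (P = fun x i j U => (r.N : ℝ) - (r.ρ (plaquetteHolonomy U x i j)).trace.re) →
              (E = fun F => wilsonExpectation r.ρ β F) →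
              c * u L β ^ 2 ≤
                ((L / 8 : ℕ) : ℝ) ^ 8 * (E (fun U => P 0 0 1 U * P (Pi.single (2 : Fin 4) ((L / 8 : ℕ) : ZMod L)) 0 1 U)
                  - E (P 0 0 1) * E (P (Pi.single (2 : Fin 4) ((L / 8 : ℕ) : ZMod L)) 0 1)) ∧
              ((L / 8 : ℕ) : ℝ) ^ 8 * (E (fun U => P 0 0 1 U * P (Pi.single (2 : Fin 4) ((L / 8 : ℕ) : ZMod L)) 0 1 U)
                - E (P 0 0 1) * E (P (Pi.single (2 : Fin 4) ((L / 8 : ℕ) : ZMod L)) 0 1)) ≤ C * u L β ^ 2)) →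
      ∃ (c_F : ℝ) (D₁ : ℕ), 0 < c_F ∧ 1 ≤ D₁ ∧ ∀ D₀ : ℕ, D₁ ≤ D₀ → ∃ β₁ : ℝ,
        ∀ (L : ℕ) [NeZero L] (β : ℝ) (n : ℕ), β₁ ≤ β → 2 * D₀ ≤ n → 8 * n ≤ L →
          (∀ M : ℕ, 8 ≤ M → M ≤ L → u M β ≤ u₀) →
          ∀ (P : (Fin 4 → ZMod L) → Fin 4 → Fin 4 → GaugeConfig 4 L G → ℝ)
            (X Y : GaugeConfig 4 L G → ℝ) (μ : Measure (GaugeConfig 4 L G))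
            (mB : MeasurableSpace (GaugeConfig 4 L G)),
            (P = fun x i j U => (r.N : ℝ) - (r.ρ (plaquetteHolonomy U x i j)).trace.re) →
            (X = fun U => (((n / D₀ : ℕ) : ℝ) ^ 3)⁻¹ *
                ∑ v : Fin (n / D₀) × Fin (n / D₀) × Fin (n / D₀),
                  P ![((v.1 : ℕ) : ZMod L), ((v.2.1 : ℕ) : ZMod L), ((0 : ℕ) : ZMod L), ((v.2.2 : ℕ) : ZMod L)] 0 1 U) →
            (Y = fun U => (((n / D₀ : ℕ) : ℝ) ^ 3)⁻¹ *
                ∑ v : Fin (n / D₀) × Fin (n / D₀) × Fin (n / D₀),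
                  P ![((v.1 : ℕ) : ZMod L), ((v.2.1 : ℕ) : ZMod L), ((n : ℕ) : ZMod L), ((v.2.2 : ℕ) : ZMod L)] 0 1 U) →
            (μ = wilsonMeasure r.ρ β) →
            (mB = MeasurableSpace.comap
                (fun (U : GaugeConfig 4 L G) (e : Edge 4 (L / (n / D₀))) (i j : Fin r.N) =>
                  unevenAxialLink (n / D₀) L (L / (n / D₀))
                    (Literature.MathematicalPhysics.QuantumLattice.wilsonFlowMatrix r.ρ
                      (((n / D₀ : ℕ) : ℝ) ^ 2 / 64) U) e i j)
                inferInstance) →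
            c_F * u (8 * n) β ^ 2 ≤ (n : ℝ) ^ 8 * cov[μ[X|mB], μ[Y|mB]; μ]) →
    (∀ (G : Type) [Group G] [TopologicalSpace G] [IsTopologicalGroup G] [CompactSpace G]
        [MeasurableSpace G] [BorelSpace G], IsCompactSimpleLieGroup G →
        ∀ r : LatticeRep G, ∀ (u : ℕ → ℝ → ℝ) (u₀ β₀ κ₁ κ₂ κ₃ c C c₈ : ℝ),
      (0 < u₀ ∧ 0 < c ∧ 0 < κ₁ ∧ 0 ≤ κ₃ ∧ 0 < c₈ ∧
        (∀ (L : ℕ) (β : ℝ), 8 ≤ L → β₀ ≤ β → 0 < u L β) ∧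
        (∀ L : ℕ, 8 ≤ L → ContinuousOn (u L) (Set.Ici β₀)) ∧
        (∀ L : ℕ, 8 ≤ L → Filter.Tendsto (u L) Filter.atTop (nhds 0)) ∧
        (∀ β : ℝ, β₀ ≤ β → c₈ ≤ β * u 8 β) ∧
        (∀ (L L' : ℕ) (β : ℝ), β₀ ≤ β → 8 ≤ L → L ≤ L' → L' ≤ 2 * L →
            (∀ M : ℕ, 8 ≤ M → M ≤ L → u M β ≤ u₀) → |(u L β)⁻¹ - (u L' β)⁻¹| ≤ κ₂) ∧
        (∀ (k m : ℕ) (β : ℝ), β₀ ≤ β → (∀ M : ℕ, 8 ≤ M → M ≤ 8 * 2 ^ (k + m) → u M β ≤ u₀) →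
            κ₁ * m - κ₃ ≤ (u (8 * 2 ^ k) β)⁻¹ - (u (8 * 2 ^ (k + m)) β)⁻¹ ∧
              (u (8 * 2 ^ k) β)⁻¹ - (u (8 * 2 ^ (k + m)) β)⁻¹ ≤ κ₂ * m + κ₃) ∧
        (∀ (L : ℕ) [NeZero L] (β : ℝ), β₀ ≤ β → 8 ≤ L →
            (∀ M : ℕ, 8 ≤ M → M ≤ L → u M β ≤ u₀) →
            ∀ (P : (Fin 4 → ZMod L) → Fin 4 → Fin 4 → GaugeConfig 4 L G → ℝ)
              (E : (GaugeConfig 4 L G → ℝ) → ℝ),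
              (P = fun x i j U => (r.N : ℝ) - (r.ρ (plaquetteHolonomy U x i j)).trace.re) →
              (E = fun F => wilsonExpectation r.ρ β F) →
              c * u L β ^ 2 ≤
                ((L / 8 : ℕ) : ℝ) ^ 8 * (E (fun U => P 0 0 1 U * P (Pi.single (2 : Fin 4) ((L / 8 : ℕ) : ZMod L)) 0 1 U)
                  - E (P 0 0 1) * E (P (Pi.single (2 : Fin 4) ((L / 8 : ℕ) : ZMod L)) 0 1)) ∧
              ((L / 8 : ℕ) : ℝ) ^ 8 * (E (fun U => P 0 0 1 U * P (Pi.single (2 : Fin 4) ((L / 8 : ℕ) : ZMod L)) 0 1 U)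
                - E (P 0 0 1) * E (P (Pi.single (2 : Fin 4) ((L / 8 : ℕ) : ZMod L)) 0 1)) ≤ C * u L β ^ 2)) →
      ∀ ε : ℝ, 0 < ε → ∃ D₁ : ℕ, 1 ≤ D₁ ∧ ∀ D₀ : ℕ, D₁ ≤ D₀ → ∃ β₁ : ℝ,
        ∀ (L : ℕ) [NeZero L] (β : ℝ) (n : ℕ), β₁ ≤ β → 2 * D₀ ≤ n → 8 * n ≤ L →
          (∀ M : ℕ, 8 ≤ M → M ≤ L → u M β ≤ u₀) →
          ∀ (P : (Fin 4 → ZMod L) → Fin 4 → Fin 4 → GaugeConfig 4 L G → ℝ)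
            (X Y : GaugeConfig 4 L G → ℝ) (μ : Measure (GaugeConfig 4 L G))
            (mB : MeasurableSpace (GaugeConfig 4 L G)),
            (P = fun x i j U => (r.N : ℝ) - (r.ρ (plaquetteHolonomy U x i j)).trace.re) →
            (X = fun U => (((n / D₀ : ℕ) : ℝ) ^ 3)⁻¹ *
                ∑ v : Fin (n / D₀) × Fin (n / D₀) × Fin (n / D₀),
                  P ![((v.1 : ℕ) : ZMod L), ((v.2.1 : ℕ) : ZMod L), ((0 : ℕ) : ZMod L), ((v.2.2 : ℕ) : ZMod L)] 0 1 U) →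
            (Y = fun U => (((n / D₀ : ℕ) : ℝ) ^ 3)⁻¹ *
                ∑ v : Fin (n / D₀) × Fin (n / D₀) × Fin (n / D₀),
                  P ![((v.1 : ℕ) : ZMod L), ((v.2.1 : ℕ) : ZMod L), ((n : ℕ) : ZMod L), ((v.2.2 : ℕ) : ZMod L)] 0 1 U) →
            (μ = wilsonMeasure r.ρ β) →
            (mB = MeasurableSpace.comap
                (fun (U : GaugeConfig 4 L G) (e : Edge 4 (L / (n / D₀))) (i j : Fin r.N) =>
                  unevenAxialLink (n / D₀) L (L / (n / D₀))
                    (Literature.MathematicalPhysics.QuantumLattice.wilsonFlowMatrix r.ρ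
                      (((n / D₀ : ℕ) : ℝ) ^ 2 / 64) U) e i j)
                inferInstance) →
            (n : ℝ) ^ 8 * |∫ U, (X U - (μ[X|mB]) U) * (Y U - (μ[Y|mB]) U) ∂μ| ≤ ε * u (8 * n) β ^ 2) →
    (∀ (G : Type) [Group G] [TopologicalSpace G] [IsTopologicalGroup G] [CompactSpace G]
        [MeasurableSpace G] [BorelSpace G], IsCompactSimpleLieGroup G →
        ∀ r : LatticeRep G, ∀ L₀ : ℕ, ∃ (β₂ c₁ : ℝ), 0 < c₁ ∧
        ∀ (L : ℕ) [NeZero L] (β : ℝ), 8 ≤ L → L ≤ L₀ → β₂ ≤ β →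
          ∀ (P : (Fin 4 → ZMod L) → Fin 4 → Fin 4 → GaugeConfig 4 L G → ℝ)
            (E : (GaugeConfig 4 L G → ℝ) → ℝ),
            (P = fun x i j U => (r.N : ℝ) - (r.ρ (plaquetteHolonomy U x i j)).trace.re) →
            (E = fun F => wilsonExpectation r.ρ β F) →
            c₁ / β ^ 2 ≤
              E (fun U => P 0 0 1 U * P (Pi.single (2 : Fin 4) ((1 : ℕ) : ZMod L)) 0 1 U)
                - E (P 0 0 1) * E (P (Pi.single (2 : Fin 4) ((1 : ℕ) : ZMod L)) 0 1)) →
    Summit.QuantumFields.YangMills.Theses.LangevinControlUV.FemtoCurvatureTwoPointC :=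
  fun hR hTU hLU hV hDom hFlo hDec hNN =>
    femtoCurvatureTwoPointC_of_core (afProfilesCore_of_floor hR hTU hLU hV hDom hFlo hDec hNN)

/-- **The registered stubs conclude the crux BY NAME** (stubs fed by name into `FemtoCurvatureTwoPointC_of`). -/
theorem femtoCurvatureTwoPointC_of_stubs :
    Summit.QuantumFields.YangMills.Theses.LangevinControlUV.FemtoCurvatureTwoPointC :=
  FemtoCurvatureTwoPointC_of stub_intrinsicRunning stub_transverseUpper stub_longitudinalUpper
    stub_varianceCeilingCorner stub_smearingDomination stub_flowedMeanFloor stub_flowedDecoupling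
    stub_nearestNeighbourFloor

end Summit.QuantumFields.YangMills.Cruxes.FemtoCurvatureTwoPointC.ConditionalCovarianceFloor

end
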